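import Summits.ValiantsHypothesis.ValiantsHypothesis.Theses.LacunarySymmetroid
import Summits.ValiantsHypothesis.ValiantsHypothesis.Theorems.SymmetroidPencilBasics
import Literature.Analysis.Matrix.DeterminantDefectInequality
import Literature.Algebra.Polynomial.DescartesRootIsolation

/-!
# Line `negsquares` — tropical skeleton and the located sharp one-law (crux `MatrixDescartes`, stmt-18050)

Ideator seat `val-idea-6`, generations 7–11 (v2.2); companion file of `Lines/negsquares.lean` (v2.3) and of the memos
`Lines/negsquares-tropical.md` and `Lines/negsquares-kink.md`.  HONEST FRAME: `VP ≠ VNP`, conjecture B and the crux are not touched; the negative-squares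
law and its `κ = 1` rung stay OPEN conjectures of the seat; this file has NO `sorry` and registers nothing.

Contents (all kernel-checked):

* `OneLawSharp` — the LOCATED sharp form of the `κ = 1` rung (memo §6, conjecture L1):
  `Z₊(det(Σ_l X^{d l} • P l − X^e • wwᵀ)) ≤ 2(m−1)(K−1) + 2`, «two real roots per linear piece of the contraction
  skeleton».  It equals the proved bounds at `m = 1` (`2`) and `m = 2` (`2K`, `NegSquares.rankOne_two_le`), exceeds every
  located family (foot-weaving `2(m−1)(K−2)+1`), and implies the polynomial one-law with exponent `2`
  (`oneLaw_poly_of_oneLawSharp`, whose conclusion is the body of `NegSquares.NegSquaresOneLaw`) and COMM-1's bound for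
  `m, K ≥ 1` (`comm_bound_of_sharp`).  A `def`, not a theorem: located, not proved.
* `IsValuation` (Dress–Wenzel exchange axiom on a base family of `Finset (Fin n)`) and the PROVED gross-substitutes
  lemma `upperSetMove` («Lemma A» of the memo): if `B` is the unique maximiser of `v + c` and `B'` the unique maximiser
  after the weights on a set `S` are raised by `δ > 0`, then `B ∩ S ⊆ B'` and `B' \ S ⊆ B`.  This is the engine of the
  memo's Theorem T1 (every valuated matroid has ≤ (K−1)·rank breakpoints along a K-slope direction; answer to critic
  NOTE #39 (1)), with its counting forms `card_mono_of_raise` and `card_inter_mono_of_nested_raise` (the exact per-step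
  statement of T1 for nested upper sets and equicardinal bases); the chain bookkeeping and the genericity step of T1 are
  prose in the memo (§2), not formalised here.
* **R1, PROVED for every `m` and `K`** (`extremeExponent_le_one`, v1.1): if the subtracted square's exponent `e` is
  `≤ min d` or `≥ max d`, the `κ = 1` determinant `det(Σ_l X^{d l} • P l − X^e • wwᵀ)` has AT MOST ONE positive zero
  (matrix determinant lemma + Loewner monotonicity of `t^{-e}·Σ t^{d l} P l` via the tree's
  `Literature.Analysis.Matrix.det_sub_vecMulVec` / `dotProduct_inv_mulVec_le`, a common-kernel argument in the
  semidefinite case, and «an interval of zeros of a nonzero polynomial is a point»); corollary `oneLetter_le_one`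
  (`K = 1` ⇒ `Z₊ ≤ 1`).  So every bit of `K`-growth of `Z₊` at `κ = 1` needs `e` strictly inside the exponent range —
  the first kernel statement about the one-law that holds for all `m`.
* **The commuting sector, typed (v1.2, memo `negsquares-kink.md`)**: for positive diagonal letters the `κ = 1`
  determinant is `commDet = Π q i − X^e Σ_i Π_{j≠i} q j`; its positive zeros are governed (Rolle, memo Prop. E:
  `Z₊(N) ≤ 1 + Z₊(S)`) by the CRITICAL POLYNOMIAL `critPoly = Σ_i r i · Π_{j≠i} (q j)²`, `r i = X (q i)' − e (q i)`
  (`tiltPoly_eq`).  `CommCriticalBudget m K` («CKB», `Z₊(S) ≤ 2(m−1)(K−1)+1` = the kink budget «(m−1)(K−1)+1 local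
  maxima», a THEOREM in the tropical model — memo Thm A — and a conjecture in the honest one) and `CommOneLawSharp m K`
  (L1 restricted to the commuting sector) are `def`s: located, not proved; `commL1_eq_two_budget` records that L1's
  constant is twice the budget.  Trivial cells in kernel: `commCriticalBudget_zero` (`m = 0`).
* **Prop. E in kernel (v1.3)**: `X_mul_wronskian_commDet` (`X·(N'·Πq − N·(Πq)') = X^e·S`, pure algebra via the
  per-`i` factorisation `Πq = q i · Π_{j≠i} q j`), `posRoots_commDet_le_succ` (`Z₊(N) ≤ Z₊(S) + 1` by Rolle on
  `N/Πq`, incl. the degenerate `S = 0` case) and `commOneLawSharp_of_commCriticalBudget`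
  (`0 < K → CommCriticalBudget m K → CommOneLawSharp m K`): the located (3,3) target COMM ≤ 10 is now, in kernel,
  a consequence of the purely real-rootcounting statement CKB(3,3) `Z₊(S) ≤ 9` about positive trinomial triples.
* **The (2,3) cell split (v1.4, memo §11)**: located `def`s `CKB23UpperSeparated` / `CKB23LowerSeparated` (Descartes-provable cells,
  prover-sized via Mathlib's `Polynomial.roots_countP_pos_le_signVariations`), `CKB23WideGap` (generically Descartes, not uniformly) and
  `CKB23NarrowGap` (the generically sub-Descartes structural cell); `commCriticalBudget_two_three_cells` records they are cells of `CommCriticalBudget 2 3`.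
* **The window-localized Descartes law (v1.5, memo §12)**: located `def`s `windowTest` (the Vincent–Jacobi test polynomial of `critPoly` on a
  window, via the tree's `Literature.Algebra.Polynomial.Descartes.dtest`), `IsPeakWindow`, `LocalizedDescartes m K` (CONJECTURE V, for TWO letters: on the peak window
  the test has `≤ 2(m−1)(K−1)+1` sign variations — tight in 98.6 % of ≈ 5 900 samples; FALSE at `(3,3)` under amplitude variation, v1.5.1), `SummandWindowLaw m K`
  (conjecture V3: each summand of `S` passes the window test with one variation) and `PeakLocalization m K` (all positive roots of `S` in the peak
  window; paper theorem); KERNEL edges `posRoots_le_signVariations_windowTest` (Descartes after the Möbius map, from `IsVcaNode.signVariations_dtest`),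
  `commCriticalBudget_of_localizedDescartes : LocalizedDescartes m K → PeakLocalization m K → CommCriticalBudget m K` and
  `commOneLawSharp_of_localizedDescartes` — so Conjecture V (a statement about sign patterns of finitely many explicit rational functions of the
  design) implies COMM-L1 in kernel; of use at `m = 2` (`LocalizedDescartes 2 K → PeakLocalization 2 K → CommOneLawSharp 2 K`, the (2,K) cells incl. the
  sub-Descartes narrow-gap (2,3) cell), while for `m ≥ 3` a gap-subdivided variant is the candidate (memo §12.3).
* **Peak localisation PROVED (v1.6)**: `peakLocalization_holds : PeakLocalization m K` for every `m, K` (memo Lemma D4 / Prop. T(i) in kernel, with all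
  degenerate regimes): two-point monotonicity of the tilts `r i(s)·u^e ≤ r i(u)·s^e` for `0 < s ≤ u` (strict when some `d l ≠ e`; the polynomial form of
  «λ_i increasing», i.e. log-convexity of the letters), sign balance of the tilts at a root of `S` (`not_forall_tilt_neg_of_root`, `…_pos_…`,
  `forall_tilt_eq_zero_of_root_of_nonpos/nonneg`), existence and uniqueness of the peaks `τ i` in the interior exponent regime (asymptotics at `0⁺` / `+∞`
  + IVT), and `S = 0` in the extreme regimes (`critPoly_eq_zero_of_root_of_extreme`).  Hence the UNCONDITIONAL kernel edges
  `commCriticalBudget_of_localizedDescartes' : LocalizedDescartes m K → CommCriticalBudget m K` and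
  `commOneLawSharp_of_localizedDescartes' : 0 < K → LocalizedDescartes m K → CommOneLawSharp m K`: at `m = 2`, Conjecture V ALONE carries COMM-L1(2,K).
* **The summand window law V3 PROVED at `m = 2` (v1.7, memo §13)**: `summandWindowLaw_two : SummandWindowLaw 2 K` for every `K`, via the generic
  `summand_window_signVariations_eq_zero` (every `m`: the summand of a letter whose tilt vanishes at a window END has a coefficientwise ONE-SIGNED
  Vincent–Jacobi test polynomial, hence no sign variation) — multiplicativity of `dtest`, the window-basis expansion
  `dtest (f ∘ ((b−a)X + a)) = Σ_j f_j · (aX+b)^j (X+1)^{n−j}` (`dtest_comp_linear_eq`), coefficientwise monotonicity in `j` of the scaled basis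
  (`wbasis_left_step` / `wbasis_right_step`) and a zero-sum lemma for tilt-signed weights (`tiltSum_nonpos_of_antitoneOn`).  So at `m = 2` the window
  count is EXACTLY the number of sign changes of the difference of two NONNEGATIVE coefficient sequences (the discrete type principle of memo §12.4, now
  unconditional), and `LocalizedDescartes 2 K` is the one remaining located conjecture on the (2,K) line.  V3 is FALSE for interior summands at `m = 3, 4`
  (critic witness, reproduced here; docstring of `SummandWindowLaw`), as `LocalizedDescartes 3 3` is (two exact witnesses; docstring of `LocalizedDescartes`).
* **Gap windows, every `m` (v1.8, memo §14)**: on a window FREE OF INTERIOR PEAKS every summand is one-signed under the window test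
  (`summand_window_signVariations_eq_zero'` / `…_of_peak_outside`; signed-sum lemma `tiltSum_nonneg_of_monotoneOn_of_sum_nonneg` etc. + nonnegativity of
  the scaled window kernel): on each inter-peak GAP the window test is «(letters peaking at or left of the gap) − (letters peaking at or right of it)», two
  explicit NONNEGATIVE coefficient sequences — the discrete type principle holds gap-wise for EVERY `m`.  The located three-letter law is therefore the
  GAP-SUBDIVIDED count `GapLocalizedDescartes3 K` (GLD(3,K): the two gap counts, +1 if the middle peak is a root, ≤ `4(K−1)+1`; 0 violations in 13 325 exact
  designs incl. 1 719 near the `¬LD(3,3)` family where the single window over-counts in ≈ 30 %, budget 9 attained), with the UNCONDITIONAL kernel edges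
  `commCriticalBudget_three_of_gapLocalizedDescartes3 : GapLocalizedDescartes3 K → CommCriticalBudget 3 K` (peak localisation + IVT for the middle peak +
  root splitting at it) and `commOneLawSharp_three_of_gapLocalizedDescartes3 : 0 < K → GapLocalizedDescartes3 K → CommOneLawSharp 3 K`:
  GLD(3,3) ALONE carries COMM(3,3) ≤ 10 in kernel.  v1.9 (same day) types the law for EVERY number of letters: `IsPeakChain`,
  `GapLocalizedDescartes n K` (GLD(n+1,K): the `n` gap counts + the interior chain roots ≤ `2·n·(K−1)+1`, located) with the unconditional kernel edges
  `commCriticalBudget_of_gapLocalizedDescartes : GapLocalizedDescartes n K → CommCriticalBudget (n+1) K` (tilt roots sorted by `Tuple.sort`, root splitting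
  along the chain `posRoots_le_gapSum`) and `commOneLawSharp_of_gapLocalizedDescartes` — the whole commuting-sector COMM-L1 programme now rests on ONE typed
  located law about level crossings of explicit nonnegative coefficient sequences along the peak chain.
* **The tilt pencil and the e-free INFLECTION LAW IB(m,K) (v2.0, memo §15) and its SUM-LETTER form (v2.1, §15.7) — MOVED (v2.2) to the
  companion crux workfile `Lines/negsquares_inflection.lean`** (this file reached the workfile size cap): `pencilDir`, `critPoly_pencil`,
  `posRoots_pencil_le_succ` (Rolle for the pencil), `inflWronskian`, `InflectionBudget`, the unconditional kernel edges IB ⇒ CKB ⇒ COMM-L1,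
  `sumLetterExcess`, `inflectionBudget_two_iff`, and the gen-11 additions (sum-letter form for every `m`; **THEOREM IB(m,2) for every `m`**) live there,
  over a verbatim copy of this file's commuting-sector basics (ll. 548–758, 902–926).  The whole commuting-sector COMM-L1 programme now rests on the ONE
  typed located ROOT-count law IB (the window / gap COUNT laws below are refuted beyond (2,3) and withdrawn).
* **v2.2 (gen 11).** WITHDRAWALS (director-valiant R284 (4); val-idea-crit-2 #45/#45b STRIKE, val-idea-crit-1 #94c concurring with exact
  reproductions): `GapLocalizedDescartes3 3`, `GapLocalizedDescartes 2 3`, `GapLocalizedDescartes 1 4` = `LocalizedDescartes 2 4` are FALSE as typed (gap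
  counts `8 + 3 = 11 > 9` on (0,19,22), window count `9 > 7` on (0,9,11,30); witnesses in the docstrings); the window/gap laws are withdrawn as carriers of
  CKB (definitions kept as negative knowledge; `LocalizedDescartes 2 3` alone stays located, with its kernel edge); the RE-TYPED law of the line is the root
  count IB of `negsquares_inflection.lean` — a theorem at `K = 2` for every `m`, located at `K ≥ 3` (statement of record IB(3,3) «≤ 8» ⇒ COMM(3,3) ≤ 10).
  18050 OPEN; `VP ≠ VNP` not moved.
-/

set_option linter.dupNamespace false

namespace Summit.ValiantsHypothesis.ValiantsHypothesis.Cruxes.MatrixDescartes.NegSquaresTropical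

open Polynomial Matrix Finset
open scoped BigOperators

/-! ## L1 — the located sharp one-law -/

/-- **L1 (located, NOT proved): the sharp `κ = 1` law.**  PSD letters `P l` at exponents `d l` and ONE subtracted square
`X^e • wwᵀ`: `Z₊ ≤ 2(m−1)(K−1) + 2` (natural subtraction; the bound is `2` for `m ≤ 1` or `K ≤ 1`).  Evidence and the
cheapest falsifier (a `κ = 1` pencil at `(m,K) = (3,5)` with ≥ 19 or `(3,6)` with ≥ 23 positive roots): memo §6.
[val-idea-6 g7, located conjecture] -/
def OneLawSharp : Prop :=
  ∀ (m K : ℕ) (d : Fin K → ℕ) (e : ℕ) (w : Fin m → ℝ) (P : Fin K → Matrix (Fin m) (Fin m) ℝ),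
    (∀ l, (P l).PosSemidef) →
      ((Matrix.det (((X : ℝ[X]) ^ e) • (-Matrix.vecMulVec w w).map C
          + ∑ l, (X : ℝ[X]) ^ d l • (P l).map C)).roots.toFinset.filter (fun t => 0 < t)).card
        ≤ 2 * (m - 1) * (K - 1) + 2

/-- The sharp bound is below `(m + K + 2)²`. -/
theorem sharp_bound_le_sq (m K : ℕ) : 2 * (m - 1) * (K - 1) + 2 ≤ (m + K + 2) ^ 2 := by
  have h3 : (m - 1) * (K - 1) ≤ m * K := Nat.mul_le_mul (Nat.sub_le m 1) (Nat.sub_le K 1)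
  have h4 : 2 * (m - 1) * (K - 1) = 2 * ((m - 1) * (K - 1)) := by ring
  rw [h4]
  nlinarith [h3, Nat.zero_le (m * K), Nat.zero_le m, Nat.zero_le K]

/-- The sharp bound is below COMM-1's `2mK + 1` as soon as `m, K ≥ 1`. -/
theorem comm_bound_of_sharp (m K : ℕ) (hm : 1 ≤ m) (hK : 1 ≤ K) :
    2 * (m - 1) * (K - 1) + 2 ≤ 2 * m * K + 1 := by
  obtain ⟨m', rfl⟩ := Nat.exists_eq_add_of_le hm
  obtain ⟨K', rfl⟩ := Nat.exists_eq_add_of_le hK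
  simp only [Nat.add_sub_cancel_left]
  nlinarith [Nat.zero_le (m' * K'), Nat.zero_le m', Nat.zero_le K']

/-- **L1 ⇒ the polynomial one-law with exponent 2.**  The conclusion is, verbatim, the body of
`NegSquares.NegSquaresOneLaw` (line file `negsquares.lean`) instantiated at `a := 2`. -/
theorem oneLaw_poly_of_oneLawSharp (h : OneLawSharp) :
    ∃ a : ℕ, ∀ (m K : ℕ) (d : Fin K → ℕ) (e : ℕ) (w : Fin m → ℝ) (P : Fin K → Matrix (Fin m) (Fin m) ℝ),
      (∀ l, (P l).PosSemidef) →
        ((Matrix.det (((X : ℝ[X]) ^ e) • (-Matrix.vecMulVec w w).map C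
            + ∑ l, (X : ℝ[X]) ^ d l • (P l).map C)).roots.toFinset.filter (fun t => 0 < t)).card
          ≤ (m + K + 2) ^ a :=
  ⟨2, fun m K d e w P hP => (h m K d e w P hP).trans (sharp_bound_le_sq m K)⟩

/-! ## The engine of T1: gross substitutes for valuated matroids (kernel) -/

/-- The Dress–Wenzel exchange axiom for a valuation `v` on a base family `ℬ` (we only ever evaluate `v` on `ℬ`). -/
def IsValuation {n : ℕ} (ℬ : Finset (Finset (Fin n))) (v : Finset (Fin n) → ℝ) : Prop :=
  ∀ B ∈ ℬ, ∀ B' ∈ ℬ, ∀ a ∈ B \ B', ∃ b ∈ B' \ B,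
    insert b (B.erase a) ∈ ℬ ∧ insert a (B'.erase b) ∈ ℬ ∧
      v B + v B' ≤ v (insert b (B.erase a)) + v (insert a (B'.erase b))

/-- Additive weight of a set. -/
def addW {n : ℕ} (c : Fin n → ℝ) (B : Finset (Fin n)) : ℝ := ∑ a ∈ B, c a

/-- `B` is the UNIQUE maximiser of `v + c` over `ℬ`. -/
def IsUniqueArgmax {n : ℕ} (ℬ : Finset (Finset (Fin n))) (v : Finset (Fin n) → ℝ) (c : Fin n → ℝ)
    (B : Finset (Fin n)) : Prop :=
  B ∈ ℬ ∧ ∀ B' ∈ ℬ, B' ≠ B → v B' + addW c B' < v B + addW c B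

/-- Raising the weights on `S` by `δ`. -/
def raise {n : ℕ} (c : Fin n → ℝ) (S : Finset (Fin n)) (δ : ℝ) : Fin n → ℝ :=
  fun a => c a + if a ∈ S then δ else 0

theorem addW_exchange {n : ℕ} (c : Fin n → ℝ) {B : Finset (Fin n)} {a b : Fin n} (ha : a ∈ B) (hb : b ∉ B) :
    addW c (insert b (B.erase a)) = addW c B - c a + c b := by
  unfold addW
  have hb' : b ∉ B.erase a := fun h => hb (Finset.mem_of_mem_erase h)
  rw [Finset.sum_insert hb', Finset.sum_erase_eq_sub ha]
  ring

theorem raise_apply_of_mem {n : ℕ} (c : Fin n → ℝ) {S : Finset (Fin n)} (δ : ℝ) {a : Fin n} (h : a ∈ S) :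
    raise c S δ a = c a + δ := by
  simp [raise, h]

theorem raise_apply_of_not_mem {n : ℕ} (c : Fin n → ℝ) {S : Finset (Fin n)} (δ : ℝ) {a : Fin n} (h : a ∉ S) :
    raise c S δ a = c a := by
  simp [raise, h]

theorem raise_le {n : ℕ} (c : Fin n → ℝ) (S : Finset (Fin n)) {δ : ℝ} (hδ : 0 ≤ δ) (a : Fin n) :
    raise c S δ a ≤ c a + δ := by
  by_cases h : a ∈ S
  · simp [raise, h]
  · simp [raise, h, hδ]

theorem le_raise {n : ℕ} (c : Fin n → ℝ) (S : Finset (Fin n)) {δ : ℝ} (hδ : 0 ≤ δ) (a : Fin n) :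
    c a ≤ raise c S δ a := by
  by_cases h : a ∈ S
  · simp [raise, h, hδ]
  · simp [raise, h]

/-- **Lemma A (upper-set move = gross substitutes), PROVED.**  For a valuation `v` on `ℬ`, weights `c`, a set `S` whose
weights are raised by `δ > 0`: the unique maximiser `B'` after the raise keeps every element of `S` that the unique
maximiser `B` before the raise had, and acquires no new element outside `S`. [val-idea-6 g7; Dress–Wenzel 1992,
Kelso–Crawford GS] -/
theorem upperSetMove {n : ℕ} {ℬ : Finset (Finset (Fin n))} {v : Finset (Fin n) → ℝ} (hv : IsValuation ℬ v)
    {c : Fin n → ℝ} {S : Finset (Fin n)} {δ : ℝ} (hδ : 0 < δ) {B B' : Finset (Fin n)}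
    (hB : IsUniqueArgmax ℬ v c B) (hB' : IsUniqueArgmax ℬ v (raise c S δ) B') :
    B ∩ S ⊆ B' ∧ B' \ S ⊆ B := by
  obtain ⟨hBmem, hBmax⟩ := hB
  obtain ⟨hB'mem, hB'max⟩ := hB'
  constructor
  · -- an element of `B ∩ S` missing from `B'` contradicts the exchange axiom
    intro a haS
    rw [Finset.mem_inter] at haS
    obtain ⟨haB, haSS⟩ := haS
    by_contra haB'
    obtain ⟨b, hb, h1, h2, hexc⟩ := hv B hBmem B' hB'mem a (Finset.mem_sdiff.mpr ⟨haB, haB'⟩)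
    rw [Finset.mem_sdiff] at hb
    obtain ⟨hbB', hbB⟩ := hb
    -- the two exchanged bases are different from the maximisers
    have hne1 : insert b (B.erase a) ≠ B := fun h => hbB (h ▸ Finset.mem_insert_self b _)
    have hne2 : insert a (B'.erase b) ≠ B' := fun h => haB' (h ▸ Finset.mem_insert_self a _)
    have lt1 := hBmax _ h1 hne1
    have lt2 := hB'max _ h2 hne2
    rw [addW_exchange c haB hbB] at lt1
    rw [addW_exchange (raise c S δ) hbB' haB'] at lt2
    have hra : raise c S δ a = c a + δ := raise_apply_of_mem c δ haSS
    have hrb : raise c S δ b ≤ c b + δ := raise_le c S hδ.le b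
    linarith
  · -- an element of `B' \ S` missing from `B` contradicts the exchange axiom (from the side of `B'`)
    intro b hbS
    rw [Finset.mem_sdiff] at hbS
    obtain ⟨hbB', hbnS⟩ := hbS
    by_contra hbB
    obtain ⟨a, ha, h1, h2, hexc⟩ := hv B' hB'mem B hBmem b (Finset.mem_sdiff.mpr ⟨hbB', hbB⟩)
    rw [Finset.mem_sdiff] at ha
    obtain ⟨haB, haB'⟩ := ha
    have hne1 : insert a (B'.erase b) ≠ B' := fun h => haB' (h ▸ Finset.mem_insert_self a _)
    have hne2 : insert b (B.erase a) ≠ B := fun h => hbB (h ▸ Finset.mem_insert_self b _)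
    have lt1 := hB'max _ h1 hne1
    have lt2 := hBmax _ h2 hne2
    rw [addW_exchange (raise c S δ) hbB' haB'] at lt1
    rw [addW_exchange c haB hbB] at lt2
    have hrb : raise c S δ b = c b := raise_apply_of_not_mem c δ hbnS
    have hra : c a ≤ raise c S δ a := le_raise c S hδ.le a
    linarith

/-- Counting form of Lemma A (the step iterated `K−1` times in the memo's Theorem T1): after the raise on `S` the unique
optimum has at least as many elements in `S` and at most as many outside `S`. -/
theorem card_mono_of_raise {n : ℕ} {ℬ : Finset (Finset (Fin n))} {v : Finset (Fin n) → ℝ} (hv : IsValuation ℬ v)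
    {c : Fin n → ℝ} {S : Finset (Fin n)} {δ : ℝ} (hδ : 0 < δ) {B B' : Finset (Fin n)}
    (hB : IsUniqueArgmax ℬ v c B) (hB' : IsUniqueArgmax ℬ v (raise c S δ) B') :
    (B ∩ S).card ≤ (B' ∩ S).card ∧ (B' \ S).card ≤ (B \ S).card := by
  obtain ⟨h1, h2⟩ := upperSetMove hv hδ hB hB'
  refine ⟨Finset.card_le_card ?_, Finset.card_le_card ?_⟩
  · intro a ha
    exact Finset.mem_inter.mpr ⟨h1 ha, (Finset.mem_inter.mp ha).2⟩
  · intro b hb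
    exact Finset.mem_sdiff.mpr ⟨h2 hb, (Finset.mem_sdiff.mp hb).2⟩

/-- **The per-step statement of T1 (kernel).**  If all members of `ℬ` have the same cardinality (bases of a matroid) and
`U` is NESTED with the raised set `S` (`U ⊆ S` or `S ⊆ U` — in T1 both are upper class-sets of the slope order), then the
number of optimum elements in `U` does not decrease under the raise.  Iterating over the chain of nested upper sets
`E_{>1} ⊇ E_{>2} ⊇ …` gives the monotonicity of every upper class count along `x` (memo §2). -/
theorem card_inter_mono_of_nested_raise {n : ℕ} {ℬ : Finset (Finset (Fin n))} {v : Finset (Fin n) → ℝ}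
    (hv : IsValuation ℬ v) {r : ℕ} (hcard : ∀ B ∈ ℬ, B.card = r)
    {c : Fin n → ℝ} {S U : Finset (Fin n)} (hnest : U ⊆ S ∨ S ⊆ U) {δ : ℝ} (hδ : 0 < δ) {B B' : Finset (Fin n)}
    (hB : IsUniqueArgmax ℬ v c B) (hB' : IsUniqueArgmax ℬ v (raise c S δ) B') :
    (B ∩ U).card ≤ (B' ∩ U).card := by
  obtain ⟨h1, h2⟩ := upperSetMove hv hδ hB hB'
  have hBc : B.card = r := hcard B hB.1
  have hB'c : B'.card = r := hcard B' hB'.1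
  rcases hnest with hUS | hSU
  · -- `U ⊆ S`: `B ∩ U ⊆ B' ∩ U` directly
    apply Finset.card_le_card
    intro a ha
    rw [Finset.mem_inter] at ha ⊢
    exact ⟨h1 (Finset.mem_inter.mpr ⟨ha.1, hUS ha.2⟩), ha.2⟩
  · -- `S ⊆ U`: `B' \ U ⊆ B \ U`, and both bases have `r` elements
    have hsub : B' \ U ⊆ B \ U := by
      intro b hb
      rw [Finset.mem_sdiff] at hb ⊢
      exact ⟨h2 (Finset.mem_sdiff.mpr ⟨hb.1, fun hbS => hb.2 (hSU hbS)⟩), hb.2⟩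
    have hle : (B' \ U).card ≤ (B \ U).card := Finset.card_le_card hsub
    have e1 : (B ∩ U).card + (B \ U).card = r := by rw [Finset.card_inter_add_card_sdiff, hBc]
    have e2 : (B' ∩ U).card + (B' \ U).card = r := by rw [Finset.card_inter_add_card_sdiff, hB'c]
    omega

/-! ## R1 — the extreme-exponent rung, PROVED: `e ≤ min d` or `e ≥ max d` ⇒ `Z₊ ≤ 1` (every `m`, every `K`)

Memo §5 (R1).  For PSD letters `P l` at exponents `d l` and one subtracted square `X^e • wwᵀ` with `e` BELOW all
`d l`: at `t > 0`, `Σ t^{d l} P l − t^e wwᵀ = t^e (Q(t) − wwᵀ)` with `Q(t) = Σ t^{d l − e} P l` Loewner-nondecreasing;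
where `Q` is definite, `det(Q(t) − wwᵀ) = det Q(t)·(1 − wᵀQ(t)⁻¹w)` (matrix determinant lemma, the tree's
`Literature.Analysis.Matrix.det_sub_vecMulVec`) and `σ(t) = wᵀQ(t)⁻¹w` is nonincreasing (the tree's
`dotProduct_inv_mulVec_le`), so the positive zero set `{σ = 1}` is an interval, hence (for a nonzero polynomial) at
most one point; the semidefinite case is handled by a common-kernel argument (no perturbation).  `e` ABOVE all `d l` is
the same statement read at `1/t`.  All [folklore] linear algebra; the statement is the seat's (val-idea-6 g7). -/

section ExtremeExponent

variable {m K : ℕ}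

/-- The rescaled PSD part `Q(t) = Σ_l t^{d l − e} • P l` (natural subtraction in the exponent). -/
def qPart (d : Fin K → ℕ) (e : ℕ) (P : Fin K → Matrix (Fin m) (Fin m) ℝ) (t : ℝ) :
    Matrix (Fin m) (Fin m) ℝ :=
  ∑ l, t ^ (d l - e) • P l

variable (d : Fin K → ℕ) (e : ℕ) (w : Fin m → ℝ) (P : Fin K → Matrix (Fin m) (Fin m) ℝ)

theorem qPart_posSemidef (hP : ∀ l, (P l).PosSemidef) {t : ℝ} (ht : 0 ≤ t) :
    (qPart d e P t).PosSemidef :=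
  Matrix.posSemidef_sum _ fun l _ => (hP l).smul (pow_nonneg ht _)

theorem dotProduct_qPart_mulVec (v : Fin m → ℝ) (t : ℝ) :
    v ⬝ᵥ (qPart d e P t *ᵥ v) = ∑ l, t ^ (d l - e) * (v ⬝ᵥ (P l *ᵥ v)) := by
  unfold qPart
  rw [Matrix.sum_mulVec, dotProduct_sum]
  simp only [Matrix.smul_mulVec, dotProduct_smul, smul_eq_mul]

/-- Common kernel: if `vᵀQ(t)v = 0` at one `t > 0` then every `P l` kills `v`. -/
theorem mulVec_eq_zero_of_quad_eq_zero (hP : ∀ l, (P l).PosSemidef) {t : ℝ} (ht : 0 < t) {v : Fin m → ℝ}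
    (h : v ⬝ᵥ (qPart d e P t *ᵥ v) = 0) : ∀ l, P l *ᵥ v = 0 := by
  rw [dotProduct_qPart_mulVec] at h
  have hnn : ∀ l ∈ (Finset.univ : Finset (Fin K)), 0 ≤ t ^ (d l - e) * (v ⬝ᵥ (P l *ᵥ v)) := by
    intro l _
    have h := (hP l).dotProduct_mulVec_nonneg v
    rw [star_trivial] at h
    exact mul_nonneg (pow_nonneg ht.le _) h
  intro l
  have hl := (Finset.sum_eq_zero_iff_of_nonneg hnn).1 h l (Finset.mem_univ l)
  have hq : v ⬝ᵥ (P l *ᵥ v) = 0 := by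
    rcases mul_eq_zero.1 hl with h | h
    · exact absurd h (pow_ne_zero _ ht.ne')
    · exact h
  exact ((hP l).dotProduct_mulVec_zero_iff v).1 (by simpa only [star_trivial] using hq)

theorem qPart_mulVec_eq_zero (hP : ∀ l, (P l).PosSemidef) {t : ℝ} (ht : 0 < t) {v : Fin m → ℝ}
    (h : v ⬝ᵥ (qPart d e P t *ᵥ v) = 0) (s : ℝ) : qPart d e P s *ᵥ v = 0 := by
  unfold qPart
  rw [Matrix.sum_mulVec]
  exact Finset.sum_eq_zero fun l _ => by
    rw [Matrix.smul_mulVec, mulVec_eq_zero_of_quad_eq_zero d e P hP ht h l, smul_zero]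

/-- Definiteness of `Q(t)` at one point propagates to every positive point (common kernel). -/
theorem qPart_posDef_of (hP : ∀ l, (P l).PosSemidef) {t s : ℝ} (hs : 0 < s)
    (hQ : (qPart d e P t).PosDef) : (qPart d e P s).PosDef := by
  refine Matrix.PosDef.of_dotProduct_mulVec_pos (qPart_posSemidef d e P hP hs.le).isHermitian fun v hv => ?_
  have h0 := (qPart_posSemidef d e P hP hs.le).dotProduct_mulVec_nonneg v
  rw [star_trivial] at h0 ⊢
  rcases h0.lt_or_eq with hlt | heq
  · exact hlt
  · exfalso
    have hz : qPart d e P t *ᵥ v = 0 := qPart_mulVec_eq_zero d e P hP hs heq.symm t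
    have h1 := hQ.dotProduct_mulVec_pos hv
    rw [hz, dotProduct_zero] at h1
    exact lt_irrefl _ h1

/-- `Q` is Loewner-nondecreasing on `[0, ∞)`. -/
theorem qPart_sub_posSemidef (hP : ∀ l, (P l).PosSemidef) {s u : ℝ} (hs : 0 ≤ s) (hsu : s ≤ u) :
    (qPart d e P u - qPart d e P s).PosSemidef := by
  have h : qPart d e P u - qPart d e P s = ∑ l, (u ^ (d l - e) - s ^ (d l - e)) • P l := by
    unfold qPart
    rw [← Finset.sum_sub_distrib]
    exact Finset.sum_congr rfl fun l _ => by rw [sub_smul]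
  rw [h]
  exact Matrix.posSemidef_sum _ fun l _ => (hP l).smul (sub_nonneg.2 (pow_le_pow_left₀ hs hsu _))

theorem vecMulVec_mulVec_eq (a b y : Fin m → ℝ) : Matrix.vecMulVec a b *ᵥ y = (b ⬝ᵥ y) • a := by
  rw [Matrix.vecMulVec_mulVec, op_smul_eq_smul]

/-- **The interval lemma.**  For `0 < s < u < t`: if `det(Q(s) − wwᵀ) = 0` and `det(Q(t) − wwᵀ) = 0` then
`det(Q(u) − wwᵀ) = 0`. -/
theorem det_qPart_sub_eq_zero_between (hP : ∀ l, (P l).PosSemidef) {s u t : ℝ} (hs : 0 < s) (hsu : s < u)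
    (hut : u < t) (hds : (qPart d e P s - Matrix.vecMulVec w w).det = 0)
    (hdt : (qPart d e P t - Matrix.vecMulVec w w).det = 0) :
    (qPart d e P u - Matrix.vecMulVec w w).det = 0 := by
  classical
  have hu : 0 < u := hs.trans hsu
  have ht : 0 < t := hu.trans hut
  by_cases hQ : (qPart d e P u).PosDef
  · -- definite case: `σ(s) = σ(t) = 1`, `σ` nonincreasing, so `σ(u) = 1`
    have hQs : (qPart d e P s).PosDef := qPart_posDef_of d e P hP hs hQ
    have hQt : (qPart d e P t).PosDef := qPart_posDef_of d e P hP ht hQ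
    have hus : IsUnit (qPart d e P s).det := (Matrix.isUnit_iff_isUnit_det _).1 hQs.isUnit
    have huu : IsUnit (qPart d e P u).det := (Matrix.isUnit_iff_isUnit_det _).1 hQ.isUnit
    have hut' : IsUnit (qPart d e P t).det := (Matrix.isUnit_iff_isUnit_det _).1 hQt.isUnit
    rw [Literature.Analysis.Matrix.det_sub_vecMulVec hus] at hds
    rw [Literature.Analysis.Matrix.det_sub_vecMulVec hut'] at hdt
    rw [Literature.Analysis.Matrix.det_sub_vecMulVec huu]
    have h1 : w ⬝ᵥ (qPart d e P s)⁻¹ *ᵥ w = 1 := by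
      rcases mul_eq_zero.1 hds with h | h
      · exact absurd h hQs.det_pos.ne'
      · linarith
    have h2 : w ⬝ᵥ (qPart d e P t)⁻¹ *ᵥ w = 1 := by
      rcases mul_eq_zero.1 hdt with h | h
      · exact absurd h hQt.det_pos.ne'
      · linarith
    have hle1 := Literature.Analysis.Matrix.dotProduct_inv_mulVec_le hQs
      (qPart_sub_posSemidef d e P hP hs.le hsu.le) w
    have hle2 := Literature.Analysis.Matrix.dotProduct_inv_mulVec_le hQ
      (qPart_sub_posSemidef d e P hP hu.le hut.le) w
    have h3 : w ⬝ᵥ (qPart d e P u)⁻¹ *ᵥ w = 1 := le_antisymm (hle1.trans h1.le) (h2.symm.le.trans hle2)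
    rw [h3, sub_self, mul_zero]
  · -- semidefinite case: a common kernel vector
    obtain ⟨z, hz0, hz⟩ : ∃ z : Fin m → ℝ, z ≠ 0 ∧ z ⬝ᵥ (qPart d e P u *ᵥ z) = 0 := by
      by_contra hcon
      refine hQ (Matrix.PosDef.of_dotProduct_mulVec_pos (qPart_posSemidef d e P hP hu.le).isHermitian
        fun v hv => ?_)
      have h0 := (qPart_posSemidef d e P hP hu.le).dotProduct_mulVec_nonneg v
      rw [star_trivial] at h0 ⊢
      exact lt_of_le_of_ne h0 (fun h => hcon ⟨v, hv, h.symm⟩)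
    have hQz : ∀ r, qPart d e P r *ᵥ z = 0 := qPart_mulVec_eq_zero d e P hP hu hz
    obtain ⟨y, hy0, hy⟩ := Matrix.exists_mulVec_eq_zero_iff.2 hds
    rw [Matrix.sub_mulVec, vecMulVec_mulVec_eq, sub_eq_zero] at hy
    -- `hy : Q(s) y = (w·y) w`
    have hsym : (qPart d e P s)ᵀ = qPart d e P s := by
      have h := (qPart_posSemidef d e P hP hs.le).isHermitian.eq
      rwa [Matrix.conjTranspose_eq_transpose_of_trivial] at h
    have hzy : z ⬝ᵥ (qPart d e P s *ᵥ y) = 0 := by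
      rw [Matrix.dotProduct_mulVec, ← Matrix.mulVec_transpose, hsym, hQz s, zero_dotProduct]
    have hprod : (w ⬝ᵥ y) * (z ⬝ᵥ w) = 0 := by
      rw [hy, dotProduct_smul, smul_eq_mul] at hzy
      exact hzy
    rcases mul_eq_zero.1 hprod with h | h
    · -- `w·y = 0`: then `Q(s) y = 0`, `y` is a common kernel vector, and `(Q(u) − wwᵀ) y = 0`
      rw [h, zero_smul] at hy
      have hyq : y ⬝ᵥ (qPart d e P s *ᵥ y) = 0 := by rw [hy, dotProduct_zero]
      have hQy : qPart d e P u *ᵥ y = 0 := qPart_mulVec_eq_zero d e P hP hs hyq u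
      refine Matrix.exists_mulVec_eq_zero_iff.1 ⟨y, hy0, ?_⟩
      rw [Matrix.sub_mulVec, vecMulVec_mulVec_eq, hQy, h, zero_smul, sub_zero]
    · -- `z·w = 0`: then `(Q(u) − wwᵀ) z = 0`
      refine Matrix.exists_mulVec_eq_zero_iff.1 ⟨z, hz0, ?_⟩
      rw [Matrix.sub_mulVec, vecMulVec_mulVec_eq, hQz u, dotProduct_comm, h, zero_smul, sub_zero]

/-- Counting: a real polynomial whose positive zero set is an interval has at most one positive root
(as a point of `roots.toFinset`, which is empty for the zero polynomial). -/
theorem card_posRoots_le_one_of_between (p : ℝ[X])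
    (H : ∀ s u t : ℝ, 0 < s → s < u → u < t → p.eval s = 0 → p.eval t = 0 → p.eval u = 0) :
    (p.roots.toFinset.filter (fun t => 0 < t)).card ≤ 1 := by
  classical
  by_contra hgt
  rw [not_le, Finset.one_lt_card] at hgt
  obtain ⟨a, ha, b, hb, hab⟩ := hgt
  rw [Finset.mem_filter, Multiset.mem_toFinset, Polynomial.mem_roots'] at ha hb
  have key : ∀ s t : ℝ, 0 < s → s < t → p.eval s = 0 → p.eval t = 0 → False := by
    intro s t hs hst hps hpt
    have hinf : Set.Infinite {x : ℝ | p.IsRoot x} :=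
      Set.Infinite.mono (fun u hu => H s u t hs hu.1 hu.2 hps hpt) (Set.Ioo_infinite hst)
    exact ha.1.1 (Polynomial.eq_zero_of_infinite_isRoot p hinf)
  rcases lt_or_gt_of_ne hab with hlt | hlt
  · exact key a b ha.2 hlt ha.1.2 hb.1.2
  · exact key b a hb.2 hlt hb.1.2 ha.1.2

/-- Evaluating the `κ = 1` determinant at a real point. [folklore] -/
theorem eval_det_negOne (t : ℝ) :
    (Matrix.det (((X : ℝ[X]) ^ e) • (-Matrix.vecMulVec w w).map C
        + ∑ l, (X : ℝ[X]) ^ d l • (P l).map C)).eval t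
      = (t ^ e • (-Matrix.vecMulVec w w) + ∑ l, t ^ d l • P l).det := by
  have h := RingHom.map_det (Polynomial.evalRingHom t)
    (((X : ℝ[X]) ^ e) • (-Matrix.vecMulVec w w).map C + ∑ l, (X : ℝ[X]) ^ d l • (P l).map C)
  rw [Polynomial.coe_evalRingHom] at h
  rw [h]
  congr 1
  ext i j
  simp only [RingHom.mapMatrix_apply, Matrix.map_apply, Matrix.add_apply, Matrix.smul_apply, Matrix.sum_apply,
    Matrix.neg_apply, smul_eq_mul, Polynomial.coe_evalRingHom, Polynomial.eval_add, Polynomial.eval_neg,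
    Polynomial.eval_mul, Polynomial.eval_pow, Polynomial.eval_X, Polynomial.eval_C, Polynomial.eval_finsetSum,
    map_neg]

/-- Low exponent: `Σ t^{d l} P l − t^e wwᵀ = t^e • (Q(t) − wwᵀ)`. -/
theorem pencil_eval_eq_low (he : ∀ l, e ≤ d l) (t : ℝ) :
    t ^ e • (-Matrix.vecMulVec w w) + ∑ l, t ^ d l • P l
      = t ^ e • (qPart d e P t - Matrix.vecMulVec w w) := by
  unfold qPart
  rw [smul_sub, Finset.smul_sum, smul_neg, sub_eq_add_neg, add_comm]
  congr 1
  exact Finset.sum_congr rfl fun l _ => by rw [smul_smul, ← pow_add, Nat.add_sub_of_le (he l)]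

/-- High exponent: `Σ t^{d l} P l − t^e wwᵀ = t^e • (Q'(1/t) − wwᵀ)` with `Q'(x) = Σ x^{e − d l} P l`. -/
theorem pencil_eval_eq_high (he : ∀ l, d l ≤ e) {t : ℝ} (ht : t ≠ 0) :
    t ^ e • (-Matrix.vecMulVec w w) + ∑ l, t ^ d l • P l
      = t ^ e • (qPart (fun l => e - d l) 0 P t⁻¹ - Matrix.vecMulVec w w) := by
  unfold qPart
  rw [smul_sub, Finset.smul_sum, smul_neg, sub_eq_add_neg, add_comm]
  congr 1
  refine Finset.sum_congr rfl fun l _ => ?_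
  rw [smul_smul, Nat.sub_zero]
  congr 1
  have h1 : t ^ e = t ^ d l * t ^ (e - d l) := by rw [← pow_add, Nat.add_sub_of_le (he l)]
  rw [h1, mul_assoc, ← mul_pow, mul_inv_cancel₀ ht, one_pow, mul_one]

/-- **R1, low form (kernel).**  `e ≤ d l` for all `l` ⇒ at most ONE positive zero, for every `m` and `K`. -/
theorem extremeExponent_low_le_one (hP : ∀ l, (P l).PosSemidef) (he : ∀ l, e ≤ d l) :
    ((Matrix.det (((X : ℝ[X]) ^ e) • (-Matrix.vecMulVec w w).map C
        + ∑ l, (X : ℝ[X]) ^ d l • (P l).map C)).roots.toFinset.filter (fun t => 0 < t)).card ≤ 1 := by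
  classical
  refine card_posRoots_le_one_of_between _ fun s u t hs hsu hut hps hpt => ?_
  have hu : 0 < u := hs.trans hsu
  have ht : 0 < t := hu.trans hut
  have conv : ∀ x : ℝ, 0 < x →
      ((Matrix.det (((X : ℝ[X]) ^ e) • (-Matrix.vecMulVec w w).map C
        + ∑ l, (X : ℝ[X]) ^ d l • (P l).map C)).eval x = 0
        ↔ (qPart d e P x - Matrix.vecMulVec w w).det = 0) := by
    intro x hx
    rw [eval_det_negOne, pencil_eval_eq_low d e w P he, Matrix.det_smul, Fintype.card_fin, mul_eq_zero,
      or_iff_right (pow_ne_zero _ (pow_ne_zero _ hx.ne'))]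
  rw [conv u hu]
  exact det_qPart_sub_eq_zero_between d e w P hP hs hsu hut ((conv s hs).1 hps) ((conv t ht).1 hpt)

/-- **R1, high form (kernel).**  `d l ≤ e` for all `l` ⇒ at most ONE positive zero (the low form read at `1/t`). -/
theorem extremeExponent_high_le_one (hP : ∀ l, (P l).PosSemidef) (he : ∀ l, d l ≤ e) :
    ((Matrix.det (((X : ℝ[X]) ^ e) • (-Matrix.vecMulVec w w).map C
        + ∑ l, (X : ℝ[X]) ^ d l • (P l).map C)).roots.toFinset.filter (fun t => 0 < t)).card ≤ 1 := by
  classical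
  refine card_posRoots_le_one_of_between _ fun s u t hs hsu hut hps hpt => ?_
  have hu : 0 < u := hs.trans hsu
  have ht : 0 < t := hu.trans hut
  have conv : ∀ x : ℝ, 0 < x →
      ((Matrix.det (((X : ℝ[X]) ^ e) • (-Matrix.vecMulVec w w).map C
        + ∑ l, (X : ℝ[X]) ^ d l • (P l).map C)).eval x = 0
        ↔ (qPart (fun l => e - d l) 0 P x⁻¹ - Matrix.vecMulVec w w).det = 0) := by
    intro x hx
    rw [eval_det_negOne, pencil_eval_eq_high d e w P he hx.ne', Matrix.det_smul, Fintype.card_fin, mul_eq_zero,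
      or_iff_right (pow_ne_zero _ (pow_ne_zero _ hx.ne'))]
  rw [conv u hu]
  -- the three inverted points `t⁻¹ < u⁻¹ < s⁻¹`
  exact det_qPart_sub_eq_zero_between (fun l => e - d l) 0 w P hP (inv_pos.2 ht)
    ((inv_lt_inv₀ ht hu).2 hut) ((inv_lt_inv₀ hu hs).2 hsu) ((conv t ht).1 hpt) ((conv s hs).1 hps)

/-- **R1 (kernel): the extreme-exponent rung of the `κ = 1` law.**  If the subtracted square's exponent `e` is
`≤` every `d l` or `≥` every `d l`, the `κ = 1` determinant has at most one positive zero — for EVERY size `m` and every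
number of letters `K` (so all `K`-growth of `Z₊` at `κ = 1` needs `e` strictly inside the exponent range; memo §5). -/
theorem extremeExponent_le_one (hP : ∀ l, (P l).PosSemidef) (he : (∀ l, e ≤ d l) ∨ (∀ l, d l ≤ e)) :
    ((Matrix.det (((X : ℝ[X]) ^ e) • (-Matrix.vecMulVec w w).map C
        + ∑ l, (X : ℝ[X]) ^ d l • (P l).map C)).roots.toFinset.filter (fun t => 0 < t)).card ≤ 1 := by
  rcases he with he | he
  · exact extremeExponent_low_le_one d e w P hP he
  · exact extremeExponent_high_le_one d e w P hP he


/-- One letter (`K = 1`): the exponent condition is automatic, so `Z₊ ≤ 1` for every `m`. -/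
theorem oneLetter_le_one (d : Fin 1 → ℕ) (e : ℕ) (w : Fin m → ℝ) (P : Fin 1 → Matrix (Fin m) (Fin m) ℝ)
    (hP : ∀ l, (P l).PosSemidef) :
    ((Matrix.det (((X : ℝ[X]) ^ e) • (-Matrix.vecMulVec w w).map C
        + ∑ l, (X : ℝ[X]) ^ d l • (P l).map C)).roots.toFinset.filter (fun t => 0 < t)).card ≤ 1 := by
  refine extremeExponent_le_one d e w P hP ((le_total e (d 0)).imp (fun h l => ?_) (fun h l => ?_))
  · rw [Fin.eq_zero l]; exact h
  · rw [Fin.eq_zero l]; exact h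

end ExtremeExponent


/-! ## The commuting sector: the critical polynomial and the kink budget (g8, memo `negsquares-kink.md`) -/

section Commuting

variable {m K : ℕ}

/-- The `i`-th letter polynomial `q i = Σ_l p l i · X^{d l}` of a diagonal (commuting) letter family
`P l = diagonal (p l)`. -/
noncomputable def letterPoly (d : Fin K → ℕ) (p : Fin K → Fin m → ℝ) (i : Fin m) : ℝ[X] :=
  ∑ l, C (p l i) * X ^ d l

/-- The tilt `r i = Σ_l (d l − e) · p l i · X^{d l}` (REAL coefficient `d l − e`, no natural subtraction);
`tiltPoly_eq`: `r i = X · (q i)' − e · q i`. -/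
noncomputable def tiltPoly (d : Fin K → ℕ) (e : ℕ) (p : Fin K → Fin m → ℝ) (i : Fin m) : ℝ[X] :=
  ∑ l, C (((d l : ℝ) - e) * p l i) * X ^ d l

/-- The critical polynomial `S = Σ_i r i · Π_{j ≠ i} (q j)²`: `sign σ'(log t) = −sign S(t)` for `σ = Σ_i X^e / q i`
(memo §0), so the distinct positive roots of `S` are the critical points of `σ`. -/
noncomputable def critPoly (d : Fin K → ℕ) (e : ℕ) (p : Fin K → Fin m → ℝ) : ℝ[X] :=
  ∑ i, tiltPoly d e p i * ∏ j ∈ Finset.univ.erase i, letterPoly d p j ^ 2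

/-- The commuting `κ = 1` determinant `N = Π_i q i − X^e · Σ_i Π_{j ≠ i} q j`
(`= det (diagonal q − X^e • 11ᵀ)` by the matrix-determinant lemma; `w` absorbed into the letters). -/
noncomputable def commDet (d : Fin K → ℕ) (e : ℕ) (p : Fin K → Fin m → ℝ) : ℝ[X] :=
  ∏ i, letterPoly d p i - X ^ e * ∑ i, ∏ j ∈ Finset.univ.erase i, letterPoly d p j

/-- Number of DISTINCT positive roots — the count used in `OneLawSharp`. -/
noncomputable def posRoots (f : ℝ[X]) : ℕ := (f.roots.toFinset.filter (fun t => 0 < t)).card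

/-- **CKB(m,K) — the commuting critical budget (located conjecture; memo `negsquares-kink.md` §1, §6).**
For strictly increasing natural exponents and POSITIVE diagonal letters, the critical polynomial has at most
`2(m−1)(K−1) + 1` distinct positive roots — i.e. `σ = Σ_i X^e/q i` has at most `(m−1)(K−1) + 1` local maxima
(«kink budget»: a theorem in the tropical model, memo Thm A; proved for `K ≤ 2` by degree, memo §4; OPEN from
`(m,K) = (2,3)` on as a structural statement and from `(3,3)` on even numerically-vs-Descartes: memo §6 table).
`CommCriticalBudget m K → CommOneLawSharp m K` is memo Prop. E (Rolle; prover-sized, not formalised here). -/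
def CommCriticalBudget (m K : ℕ) : Prop :=
  ∀ (d : Fin K → ℕ) (e : ℕ) (p : Fin K → Fin m → ℝ), StrictMono d → (∀ l i, 0 < p l i) →
    posRoots (critPoly d e p) ≤ 2 * (m - 1) * (K - 1) + 1

/-- **COMM-L1(m,K)** — the located sharp law `OneLawSharp` restricted to positive diagonal letters (`w = 1`):
`Z₊(Π q − X^e Σ_i Π_{j≠i} q j) ≤ 2(m−1)(K−1) + 2`.  Known: `m ≤ 2` (all `K`), `K ≤ 2` (all `m`); first open cell `(3,3)`
(«COMM(3,3) ≤ 10», Descartes gives `12`). -/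
def CommOneLawSharp (m K : ℕ) : Prop :=
  ∀ (d : Fin K → ℕ) (e : ℕ) (p : Fin K → Fin m → ℝ), StrictMono d → (∀ l i, 0 < p l i) →
    posRoots (commDet d e p) ≤ 2 * (m - 1) * (K - 1) + 2

/-- L1's constant is twice the kink budget (memo Thm A: `budget = (m−1)(K−1)+1`; two crossings per maximum). -/
theorem commL1_eq_two_budget (m K : ℕ) : 2 * (m - 1) * (K - 1) + 2 = 2 * ((m - 1) * (K - 1) + 1) := by ring

/-- The tilt is `X · q' − e · q`. -/
theorem tiltPoly_eq (d : Fin K → ℕ) (e : ℕ) (p : Fin K → Fin m → ℝ) (i : Fin m) :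
    tiltPoly d e p i = X * derivative (letterPoly d p i) - C (e : ℝ) * letterPoly d p i := by
  unfold tiltPoly letterPoly
  rw [derivative_sum, Finset.mul_sum, Finset.mul_sum, ← Finset.sum_sub_distrib]
  refine Finset.sum_congr rfl fun l _ => ?_
  rw [derivative_C_mul_X_pow]
  rcases Nat.eq_zero_or_pos (d l) with h | h
  · rw [h]
    simp only [pow_zero, Nat.cast_zero, mul_zero, map_zero, zero_mul, mul_one, mul_zero, zero_sub, map_mul,
      map_neg, map_natCast]
    ring
  · obtain ⟨k, hk⟩ : ∃ k, d l = k + 1 := ⟨d l - 1, (Nat.succ_pred_eq_of_pos h).symm⟩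
    rw [hk, Nat.add_sub_cancel]
    simp only [map_mul, map_sub, map_natCast, Nat.cast_add, Nat.cast_one]
    ring

/-- `m = 0`: no letters, `S = 0`, no roots — the budget holds vacuously-in-content but honestly-in-kernel. -/
theorem commCriticalBudget_zero (K : ℕ) : CommCriticalBudget 0 K := by
  intro d e p _ _
  simp [posRoots, critPoly]

/-! ### Prop. E in kernel (v1.3): `X·(N'·Πq − N·(Πq)') = X^e·S` and, by Rolle, `Z₊(N) ≤ Z₊(S) + 1`;
hence **CKB ⇒ COMM-L1**.  The algebra uses, for EACH `i`, the factorisation `Πq = q i · Π_{j≠i} q j` — no double sums. -/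

/-- `(Σ_i Π_{j≠i} q j) · Π q = Σ_i q i · (Π_{j≠i} q j)²`. -/
theorem sum_coprod_mul_prod (q : Fin m → ℝ[X]) :
    (∑ i, ∏ j ∈ univ.erase i, q j) * ∏ i, q i = ∑ i, q i * (∏ j ∈ univ.erase i, q j) ^ 2 := by
  rw [Finset.sum_mul]
  refine Finset.sum_congr rfl fun i _ => ?_
  rw [← Finset.mul_prod_erase univ q (mem_univ i)]
  ring

/-- Wronskian identity `T·A' − T'·A = Σ_i (q i)'·(Π_{j≠i} q j)²` for `A = Π q`, `T = Σ_i Π_{j≠i} q j`. -/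
theorem sum_coprod_wronskian (q : Fin m → ℝ[X]) :
    (∑ i, ∏ j ∈ univ.erase i, q j) * derivative (∏ i, q i)
      - derivative (∑ i, ∏ j ∈ univ.erase i, q j) * ∏ i, q i
      = ∑ i, derivative (q i) * (∏ j ∈ univ.erase i, q j) ^ 2 := by
  rw [derivative_sum, Finset.sum_mul, Finset.sum_mul, ← Finset.sum_sub_distrib]
  refine Finset.sum_congr rfl fun i _ => ?_
  have hA : ∏ j, q j = q i * ∏ j ∈ univ.erase i, q j := (Finset.mul_prod_erase univ q (mem_univ i)).symm
  rw [hA, derivative_mul]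
  ring

theorem X_mul_C_mul_X_pow_pred (e : ℕ) : (X : ℝ[X]) * (C (e : ℝ) * X ^ (e - 1)) = C (e : ℝ) * X ^ e := by
  rcases Nat.eq_zero_or_pos e with rfl | he
  · simp
  · obtain ⟨k, rfl⟩ : ∃ k, e = k + 1 := ⟨e - 1, (Nat.succ_pred_eq_of_pos he).symm⟩
    rw [Nat.add_sub_cancel, pow_succ]
    ring

/-- **Prop. E, algebraic half (memo `negsquares-kink.md` §1):** `X · (N'·Πq − N·(Πq)') = X^e · S`
for `N = commDet`, `S = critPoly` — no positivity needed, an identity in `ℝ[X]`. -/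
theorem X_mul_wronskian_commDet (d : Fin K → ℕ) (e : ℕ) (p : Fin K → Fin m → ℝ) :
    X * (derivative (commDet d e p) * ∏ i, letterPoly d p i
        - commDet d e p * derivative (∏ i, letterPoly d p i))
      = X ^ e * critPoly d e p := by
  have h1 := sum_coprod_mul_prod (letterPoly d p)
  have h2 := sum_coprod_wronskian (letterPoly d p)
  have h5 := X_mul_C_mul_X_pow_pred e
  have h3 : critPoly d e p
      = X * ∑ i, derivative (letterPoly d p i) * (∏ j ∈ univ.erase i, letterPoly d p j) ^ 2
        - C (e : ℝ) * ∑ i, letterPoly d p i * (∏ j ∈ univ.erase i, letterPoly d p j) ^ 2 := by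
    simp only [critPoly, tiltPoly_eq, Finset.mul_sum, ← Finset.sum_sub_distrib, Finset.prod_pow]
    refine Finset.sum_congr rfl fun i _ => ?_
    ring
  have h4 : derivative (commDet d e p)
      = derivative (∏ i, letterPoly d p i)
        - (C (e : ℝ) * X ^ (e - 1) * ∑ i, ∏ j ∈ univ.erase i, letterPoly d p j
            + X ^ e * derivative (∑ i, ∏ j ∈ univ.erase i, letterPoly d p j)) := by
    unfold commDet
    rw [derivative_sub, derivative_mul, derivative_X_pow]
  rw [h3, h4]
  unfold commDet
  linear_combination (-(C (e : ℝ) * X ^ e)) * h1 + X ^ (e + 1) * h2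
    + (-((∑ i, ∏ j ∈ univ.erase i, letterPoly d p j) * ∏ i, letterPoly d p i)) * h5

/-- **Prop. E (memo §1), analytic half — Rolle.**  If the product of the letters is positive on `(0,∞)` then
`Z₊(N) ≤ Z₊(S) + 1` (distinct positive roots; the case `S = 0` is handled: then `N/Πq` is constant on `(0,∞)`
and a nonzero `N` has no positive root). -/
theorem posRoots_commDet_le_succ (d : Fin K → ℕ) (e : ℕ) (p : Fin K → Fin m → ℝ)
    (hA : ∀ t : ℝ, 0 < t → 0 < (∏ i, letterPoly d p i).eval t) :
    posRoots (commDet d e p) ≤ posRoots (critPoly d e p) + 1 := by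
  classical
  have hid := X_mul_wronskian_commDet d e p
  set N := commDet d e p with hN_def
  set A := ∏ i, letterPoly d p i with hA_def
  set S := critPoly d e p with hS_def
  have hf : ∀ t : ℝ, 0 < t → HasDerivAt (fun u => N.eval u / A.eval u)
      ((N.derivative.eval t * A.eval t - N.eval t * A.derivative.eval t) / (A.eval t) ^ 2) t :=
    fun t ht => (N.hasDerivAt t).div (A.hasDerivAt t) (hA t ht).ne'
  have hcont : ∀ a b : ℝ, 0 < a → ContinuousOn (fun u => N.eval u / A.eval u) (Set.Icc a b) :=
    fun a b ha => N.continuousOn.div A.continuousOn fun u hu => (hA u (ha.trans_le hu.1)).ne'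
  have key : ∀ c : ℝ, 0 < c →
      N.derivative.eval c * A.eval c - N.eval c * A.derivative.eval c = 0 → S.eval c = 0 := by
    intro c hc h
    have h2 := congrArg (eval c) hid
    simp only [eval_mul, eval_X, eval_sub, eval_pow, h, mul_zero] at h2
    exact (mul_eq_zero.mp h2.symm).resolve_left (pow_ne_zero _ hc.ne')
  by_cases hN : N = 0
  · simp [posRoots, hN]
  by_cases hS : S = 0
  · have hW : derivative N * A - N * derivative A = 0 := by
      have h0 : (X : ℝ[X]) * (derivative N * A - N * derivative A) = 0 := by rw [hid, hS, mul_zero]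
      exact (mul_eq_zero.mp h0).resolve_left X_ne_zero
    have hf0 : ∀ t : ℝ, 0 < t → HasDerivAt (fun u => N.eval u / A.eval u) 0 t := by
      intro t ht
      have hWt : N.derivative.eval t * A.eval t - N.eval t * A.derivative.eval t = 0 := by
        have := congrArg (eval t) hW
        simpa only [eval_sub, eval_mul, eval_zero] using this
      have := hf t ht
      rwa [hWt, zero_div] at this
    have hnoroot : ∀ x : ℝ, 0 < x → N.eval x = 0 → ∀ u : ℝ, 0 < u → N.eval u = 0 := by
      intro x hx hxr u hu
      have hfx : N.eval x / A.eval x = 0 := by rw [hxr, zero_div]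
      have hfu : N.eval u / A.eval u = 0 := by
        rcases le_total x u with hxu | hux
        · have hc := constant_of_has_deriv_right_zero (hcont x u hx)
            (fun t ht => (hf0 t (hx.trans_le ht.1)).hasDerivWithinAt) u ⟨hxu, le_rfl⟩
          rw [hc, hfx]
        · have hc := constant_of_has_deriv_right_zero (hcont u x hu)
            (fun t ht => (hf0 t (hu.trans_le ht.1)).hasDerivWithinAt) x ⟨hux, le_rfl⟩
          rw [← hc, hfx]
      rcases div_eq_zero_iff.mp hfu with h | h
      · exact h
      · exact absurd h (hA u hu).ne'
    have hempty : (N.roots.toFinset.filter fun t => 0 < t) = ∅ := by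
      refine Finset.filter_eq_empty_iff.mpr fun x hx hx0 => hN ?_
      rw [Multiset.mem_toFinset, mem_roots hN] at hx
      refine Polynomial.eq_zero_of_infinite_isRoot N ((Set.Ioi_infinite (0 : ℝ)).mono fun u hu => ?_)
      exact hnoroot x hx0 hx u hu
    simp [posRoots, hempty]
  · refine Finset.card_le_of_interleaved fun x hx y hy hxy _ => ?_
    simp only [Finset.mem_filter, Multiset.mem_toFinset, mem_roots hN, IsRoot.def] at hx hy
    obtain ⟨c, hc, hc'⟩ := exists_deriv_eq_zero (f := fun u => N.eval u / A.eval u) hxy (hcont x y hx.2)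
      (by rw [hx.1, hy.1, zero_div, zero_div])
    have hc0 : 0 < c := hx.2.trans hc.1
    refine ⟨c, ?_, hc.1, hc.2⟩
    simp only [Finset.mem_filter, Multiset.mem_toFinset, mem_roots hS, IsRoot.def]
    refine ⟨key c hc0 ?_, hc0⟩
    have hd := (hf c hc0).deriv
    rw [hc'] at hd
    rcases div_eq_zero_iff.mp hd.symm with h | h
    · exact h
    · exact absurd (pow_eq_zero_iff two_ne_zero |>.mp h) (hA c hc0).ne'

/-- Positive letters have a positive product on `(0,∞)` (needs `K ≥ 1`; for `K = 0` every letter is `0`). -/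
theorem prod_letterPoly_eval_pos (d : Fin K → ℕ) (p : Fin K → Fin m → ℝ) (hK : 0 < K)
    (hp : ∀ l i, 0 < p l i) {t : ℝ} (ht : 0 < t) : 0 < (∏ i, letterPoly d p i).eval t := by
  rw [eval_prod]
  refine Finset.prod_pos fun i _ => ?_
  simp only [letterPoly, eval_finsetSum, eval_mul, eval_C, eval_pow, eval_X]
  haveI : Nonempty (Fin K) := ⟨⟨0, hK⟩⟩
  exact Finset.sum_pos (fun l _ => mul_pos (hp l i) (pow_pos ht _)) Finset.univ_nonempty

/-- **CKB ⇒ COMM-L1 (memo Prop. E, in kernel): the commuting located one-law follows from the critical budget**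
(`K ≥ 1`; `K = 0` has no letters).  In particular `CommCriticalBudget 3 3` («`Z₊(S) ≤ 9`») gives COMM(3,3) `≤ 10`. -/
theorem commOneLawSharp_of_commCriticalBudget (hK : 0 < K) (h : CommCriticalBudget m K) :
    CommOneLawSharp m K := by
  intro d e p hd hp
  have h1 := posRoots_commDet_le_succ d e p fun t ht => prod_letterPoly_eval_pos d p hK hp ht
  have h2 := h d e p hd hp
  omega

/-! ### The (2,3) cell split by Descartes (v1.4, memo `negsquares-kink.md` §11.3)

Normalise `d = (d 0, d 1, d 2)` strictly increasing.  For `e` strictly inside the exponent range the critical polynomial of TWO positive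
trinomial letters has 10 monomials; the four whose indices all lie below `e` carry negative coefficients, `X^{3·d 2}` a positive one, the
five mixed ones are indefinite.  If `e` lies in the UPPER gap `(d 1, d 2)` and `d 2 − d 0 ≥ 3 (d 1 − d 0)` the two blocks of exponents do not
interleave, the coefficient sequence has ≤ 5 sign variations, and Descartes' rule (Mathlib `Polynomial.roots_countP_pos_le_signVariations`)
gives `posRoots ≤ 5` = CKB(2,3) in that cell (memo Prop. G(a), a paper proof; prover-sized in Lean).  Below that separation there is NO uniform
sign proof: `V = 7` corner designs exist for every ratio `(d 2 − d 0)/(d 1 − d 0) ∈ (2,3)` (memo Prop. G(b), all of them type-trivial), while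
generically Descartes suffices for `e` in the WIDER gap and fails (V = 7 common, no Laguerre multiplier helps) for `e` in the NARROWER gap — the
generically sub-Descartes cell and the first structural cell of the whole line (memo §11.5, the Dip Lemma).
All four `def`s below are LOCATED statements (no proof claimed here); `commCriticalBudget_two_three_cells` only records that they are cells of
`CommCriticalBudget 2 3`. -/

/-- **CKB(2,3), upper gap, exponent-separated cell** (memo Prop. G(a); provable by Descartes' rule of signs — the coefficient sequence of
`critPoly` is `(−,−,−,−, ±,±,±,±,±, +)` in increasing degree): `d 1 < e < d 2` and `3·d 1 ≤ d 2 + 2·d 0`. [val-idea-6 g9, located] -/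
def CKB23UpperSeparated : Prop :=
  ∀ (d : Fin 3 → ℕ) (e : ℕ) (p : Fin 3 → Fin 2 → ℝ), StrictMono d → (∀ l i, 0 < p l i) →
    d 1 < e → e < d 2 → 3 * d 1 ≤ d 2 + 2 * d 0 → posRoots (critPoly d e p) ≤ 5

/-- **CKB(2,3), lower gap, exponent-separated cell** (mirror `t ↦ 1/t` of `CKB23UpperSeparated`): `d 0 < e < d 1` and
`2·d 2 + d 0 ≤ 3·d 1`. [val-idea-6 g9, located] -/
def CKB23LowerSeparated : Prop :=
  ∀ (d : Fin 3 → ℕ) (e : ℕ) (p : Fin 3 → Fin 2 → ℝ), StrictMono d → (∀ l i, 0 < p l i) →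
    d 0 < e → e < d 1 → 2 * d 2 + d 0 ≤ 3 * d 1 → posRoots (critPoly d e p) ≤ 5

/-- **CKB(2,3), wide-gap cell** (memo Prop. G(b): `e` in the wider of the two exponent gaps; the coefficient signs of `critPoly` give `≤ 5`
GENERICALLY here but NOT uniformly — `V = 7` corner designs exist for every gap ratio in `(2,3)`; only the exponent-separated part = the two
cells above is proved by signs). [val-idea-6 g9, located] -/
def CKB23WideGap : Prop :=
  ∀ (d : Fin 3 → ℕ) (e : ℕ) (p : Fin 3 → Fin 2 → ℝ), StrictMono d → (∀ l i, 0 < p l i) →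
    ((d 1 < e ∧ e < d 2 ∧ d 1 - d 0 ≤ d 2 - d 1) ∨ (d 0 < e ∧ e < d 1 ∧ d 2 - d 1 ≤ d 1 - d 0)) →
    posRoots (critPoly d e p) ≤ 5

/-- **CKB(2,3), narrow-gap cell — the generically sub-Descartes structural cell** (memo §11.3(c), §11.5): `e` in the strictly narrower
exponent gap (e.g. `d = (0,19,22)`, `e ∈ {20, 21}`).  Here Descartes generically allows 7; the type principle (memo §11.1) reduces `≤ 5` to the lap count of ONE
amplitude-free function, and the honest residual is the two-letter Dip Lemma. [val-idea-6 g9, located conjecture] -/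
def CKB23NarrowGap : Prop :=
  ∀ (d : Fin 3 → ℕ) (e : ℕ) (p : Fin 3 → Fin 2 → ℝ), StrictMono d → (∀ l i, 0 < p l i) →
    ((d 1 < e ∧ e < d 2 ∧ d 2 - d 1 < d 1 - d 0) ∨ (d 0 < e ∧ e < d 1 ∧ d 1 - d 0 < d 2 - d 1)) →
    posRoots (critPoly d e p) ≤ 5

/-- The four located (2,3) statements are cells of `CommCriticalBudget 2 3` (whose bound at `(2,3)` is `2·1·2+1 = 5`). -/
theorem commCriticalBudget_two_three_cells (h : CommCriticalBudget 2 3) :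
    CKB23UpperSeparated ∧ CKB23LowerSeparated ∧ CKB23WideGap ∧ CKB23NarrowGap := by
  refine ⟨?_, ?_, ?_, ?_⟩
  · intro d e p hd hp _ _ _; simpa using h d e p hd hp
  · intro d e p hd hp _ _ _; simpa using h d e p hd hp
  · intro d e p hd hp _; simpa using h d e p hd hp
  · intro d e p hd hp _; simpa using h d e p hd hp


/-! ### The window-localized Descartes law (v1.5, memo `negsquares-kink.md` §12)

Descartes' rule on `(0,∞)` is NOT the law (first gap cell `(3,3)`: `V(S) = 13` vs `9`; narrow-gap `(2,3)`: `V(S) = 7` vs `5`).  But every positive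
root of `S` lies in the PEAK WINDOW `[min t_i*, max t_i*]` (`t_i*` = the unique positive root of the tilt `r i`; memo Lemma D4 / Prop. T(i)), and
the Descartes count LOCALIZED to that window — the sign variations of the Vincent–Jacobi test polynomial
`taylor 1 (reverse (S ∘ (a + (b−a)·X)))` (`Literature.Algebra.Polynomial.Descartes.dtest`, BPR Thm 2.33 / Prop. 10.32, in the tree with
`IsVcaNode.signVariations_dtest : Var = #roots in (a,b) + 2j`) — equals the true count in ≈ 98 % of ≈ 8 100 exact-arithmetic samples and NEVER
exceeds the budget `2(m−1)(K−1)+1`, including at the extremal certificate designs where the budget is attained (`(2,3)`: 5 = 5, `(3,3)`: 9 = 9 with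
global `V = 13`, `(4,3)`: 13 = 13 with global `V = 25`; memo §12.2).  **Conjecture V** (`LocalizedDescartes m K`) is that statement; with the
peak-window localisation (`PeakLocalization m K`, a paper theorem, prover-sized) it gives `CommCriticalBudget m K` IN KERNEL
(`commCriticalBudget_of_localizedDescartes`), hence COMM-L1 by `commOneLawSharp_of_commCriticalBudget`.  **v1.5.1 CORRECTION: Conjecture V is a
TWO-LETTER statement.**  `LocalizedDescartes 3 3` is FALSE (exact rational arithmetic, this seat, `instr/g9/vincent_cert_amp3.py`): at the extremal
design `d = (0,19,22)`, `e = 20` with the three certificate letters `q i` DIVIDED by the summand amplitudes `μ = (1, 541502/761165, 101385/427537)`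
(letters `q i / μ_i`; the convention `q i · μ_i` gives `9`) the window count is `11 > 9` while `S` has 5 roots in the window (confirmed by both critics'
independent exact codes — val-idea-crit-2 CO-READ #42b, val-idea-crit-1 VERDICT #63 as corrected), and crit-2's ASSUMPTION-FREE rational-peak design
(docstring of `LocalizedDescartes`) gives the same `11 > 9` — for three letters the single peak window over-counts by up to 8 (amplitude grid, n = 136),
although never in the random `(3,3)` sample and not at the certificate amplitudes.  What is conjectured is `LocalizedDescartes 2 K` (all ≈ 5 900 two-letter samples, tight in
98.6 %); for `m ≥ 3` the surviving candidate is the GAP-subdivided count (sum over consecutive inter-peak gaps; `≤ 9` in 67/67 at the same design, loose),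
not typed here.  Finer statement V3
(`SummandWindowLaw`): each summand `r i · Π_{j≠i} (q j)²` passes the window test with at most ONE sign variation — **PROVED at `m = 2` (v1.7,
`summandWindowLaw_two`; for every `m` the two END summands pass with NO variation, `summand_window_signVariations_eq_zero`) and FALSE for interior
summands at `m = 3, 4`** (val-idea-crit-2 NOTE #42(3), see the docstring of `SummandWindowLaw`; the v1.5 datum «168/168 at `m = 3`» was regime-limited
to close peaks).  At `m = 2` V3 turns CKB(2,K) into a statement about the trend changes of one ratio of two finite NONNEGATIVE coefficient sequences
(memo §12.4 / §13, the discrete type principle — unconditional since v1.7).  LOCATED here: `LocalizedDescartes 2 K`; in kernel: the two edges,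
`PeakLocalization` (v1.6) and V3 at `m = 2` / at the window ends (v1.7). -/

open Literature.Algebra.Polynomial.Descartes in
/-- The Descartes–Vincent–Jacobi test polynomial of the critical polynomial on the window `(a,b)`:
`dtest (S ∘ (a + (b−a)X)) = taylor 1 (reverse (S ∘ (a + (b−a)X)))`. [val-idea-6 g9 v1.5] -/
noncomputable def windowTest (d : Fin K → ℕ) (e : ℕ) (p : Fin K → Fin m → ℝ) (a b : ℝ) : ℝ[X] :=
  dtest ((critPoly d e p).comp (C (b - a) * X + C a))

/-- `(a,b)` is the PEAK WINDOW of the letter family: `0 < a ≤ b`, every tilt is `≤ 0` at `a` and `≥ 0` at `b` (so `[a,b]` contains the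
unique positive root `t_i*` of every tilt — the peak of `X^e / q i`), and some tilt vanishes at each end (so `a = min t_i*`, `b = max t_i*`).
[val-idea-6 g9 v1.5] -/
def IsPeakWindow (d : Fin K → ℕ) (e : ℕ) (p : Fin K → Fin m → ℝ) (a b : ℝ) : Prop :=
  0 < a ∧ a ≤ b ∧ (∀ i, (tiltPoly d e p i).eval a ≤ 0) ∧ (∃ i, (tiltPoly d e p i).eval a = 0) ∧
    (∀ i, 0 ≤ (tiltPoly d e p i).eval b) ∧ (∃ i, (tiltPoly d e p i).eval b = 0)

/-- **Conjecture V — the localized Descartes law LD(m,K)** (memo `negsquares-kink.md` §12.3; LOCATED, no proof claimed): on the peak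
window the Vincent–Jacobi test of the critical polynomial has at most `2(m−1)(K−1)+1` sign variations.  **STATUS (v1.7): conjectured for `m = 2`
ONLY; `LocalizedDescartes 3 3` is FALSE** by two exact witnesses, each confirmed by three independent exact-arithmetic codes (this seat g9/g10;
val-idea-crit-2 VERDICT #42 amended / CO-READ #42b; val-idea-crit-1 VERDICT #63 as corrected 16:09Z): (A) ASSUMPTION-FREE, all data rational (crit-2's
design): `d = (0,19,22)`, `e = 20`, letters `q i = a_i + b_i t¹⁹ + c_i t²²` with `(a_i, b_i) = (1, 2), (10²⁰, 200), (10³⁸, 10⁵)` and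
`c_i = (20 a_i + b_i t_i¹⁹)/(2 t_i²²)` for the RATIONAL peaks `t_i = 3/2, 32, 768` (`c₁ = 9340034776/31381059609`; `r i (t_i) = 0` exactly, so
`IsPeakWindow d e p (3/2) 768` holds literally: tilt signs `(0, <0, <0)` at `3/2` and `(>0, >0, 0)` at `768`):
`(windowTest d e p (3/2) 768).signVariations = 11 > 9`, while `S` (degree 110, 21 terms, global `V = 17`) has exactly 5 roots in the window;
(B) the §6 certificate letters `(5/2, 5/2, 7513/500000)`, `(5815400000000000000, 10357/500, 21887/10⁸)`, `(13527·10³³, 17163/100, 797/(25·10⁷))`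
DIVIDED by the summand amplitudes `μ = (1, 541502/761165, 101385/427537)` (letters `q i / μ_i`, i.e. summand `i` weighted `∝ μ_i`; the convention
`q i · μ_i` gives `9`): window count `11 > 9` on both the inward and the outward `10⁻⁴⁰`-brackets of the (irrational) peak window, 5 roots, global
`V = 17`.  For three letters the single peak window over-counts (its interior summand is two-signed, memo §13.2); the typed replacement is the
GAP-SUBDIVIDED law `GapLocalizedDescartes3` (v1.8, memo §14: every summand is one-signed on a gap; 0 violations in 13 325 exact designs).  EVIDENCE at `m = 2` (exact arithmetic, no failure anywhere): this seat ≈ 6 000 (design, amplitude) pairs at `(2,3)`,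
`(2,4)`, `(2,5)` incl. the worst amplitude levels and the extremal certificate design (5 = 5); crit-2: 94 344 random rational-peak + 43 229
shape-perturbed near-extremal `(2,3)` designs at `e = 20, 21` (max 5 = budget); crit-1: adversarial `(2,3)` five-sign-pocket and `(2,4)` designs.  Since V3
holds at `m = 2` (v1.7, `summandWindowLaw_two`), `LocalizedDescartes 2 K` reads: `Var(A − B) ≤ 2K − 1` for the two NONNEGATIVE window coefficient
sequences `A`, `B` of the summands — how often one finite nonnegative sequence overtakes the other (memo §13, the discrete type principle).  Cheapest kill:
one positive two-letter design with window count `> 2K − 1`.  **STATUS (v2.2, gen 11) — `LocalizedDescartes 2 4` is FALSE; the law is WITHDRAWN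
beyond the (2,3) cell (director-valiant R284 (4): withdrawal).**  Witness (val-idea-crit-2 #45, reproduced exactly by val-idea-crit-1 #94c with
independent code; three implementations of the window test agree): `d = (0,9,11,30)`, `e = 10`, `q₁ = 10⁷ + 10⁵t⁹ + 10t¹¹ + t³⁰/(2·10⁵³)` (peak `100`),
`q₂ = A + 200t⁹ + 10⁵t¹¹ + t³⁰`, `A = (95000·5¹⁹ + 20)/(10·5³⁰)` (peak `1/5`): `IsPeakWindow … (1/5) 100` literal and
`(windowTest … (1/5) 100).signVariations = 9 > 7 = 2K − 1` (three roots inside; `deg S = 90`, global `V = 13`; an open set of designs — 20 047 of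
38 958 roundings still violate).  `LocalizedDescartes 3 3` FALSE (v1.7, above); `LocalizedDescartes 2 3` OPEN (both critics: > 175 000 exact designs and
climbs at (0,19,22), max 5 = budget) — the ONLY cell where this definition is still a located conjecture, and the only cell where the kernel edge
`commOneLawSharp_of_localizedDescartes'` still carries anything.  Lesson (both critics): the Vincent–Jacobi test over-counts on wide / lacunary windows
even when every summand is one-signed, so NO sign-variation COUNT law of this family can carry CKB; the re-typed law of this line is the ROOT count
`InflectionBudget` (IB, below: e-free, window-free; a THEOREM at K = 2 for every m, v2.2). [val-idea-6 g9 v1.5.1 / g10 v1.7 / g11 v2.2: located at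
(2,3) only; refuted instances (3,3), (2,4)] -/
def LocalizedDescartes (m K : ℕ) : Prop :=
  ∀ (d : Fin K → ℕ) (e : ℕ) (p : Fin K → Fin m → ℝ) (a b : ℝ), StrictMono d → (∀ l i, 0 < p l i) →
    IsPeakWindow d e p a b → (windowTest d e p a b).signVariations ≤ 2 * (m - 1) * (K - 1) + 1

open Literature.Algebra.Polynomial.Descartes in
/-- **V3 — the summand window law SW(m,K)** (memo §12.4 / §13): on the peak window each summand `r i · Π_{j ≠ i} (q j)²` of the critical
polynomial passes the Vincent–Jacobi test with at most ONE sign variation (its global Descartes count is up to `2(m−1)(K−1)+1`).  **STATUS (v1.7):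
a THEOREM at `m = 2` for every `K` (`summandWindowLaw_two`), and for every `m` the END summands — the letters whose tilt vanishes at `a` or at `b` —
pass with NO sign variation (`summand_window_signVariations_eq_zero`: their test polynomial is coefficientwise one-signed); FALSE as an all-summand
statement at `m = 3, 4`** (INTERIOR summands; val-idea-crit-2 NOTE #42(3), reproduced exactly by this seat g10, `instr/g10/witnessV3.py`):
`d = (0,14,17)`, `e = 15`, `q i = 1 + t¹⁴ + c_i t¹⁷` with `c_i = (15 + t_i¹⁴)/(2 t_i¹⁷)` for the rational peaks `t_i = 1/128, 1, 128` (`c₂ = 8`): the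
interior summand `r 2 · (q 1)² (q 3)²` has window count `5` with one root in the window (the end summands have count `0`, `S` itself count `1` = its
root count); crit-2: 1 436 / 36 983 random `(3,3)` rational-peak designs violate, and `SW(4,3)` fails at the `(4,3)` certificate design (interior
summands: 3 and 5).  The v1.5 datum «168/168 at `m = 3`» was regime-limited (close peaks).  At `m = 2` the theorem makes `Var(windowTest)` the number
of sign changes of `A − B` for the two NONNEGATIVE window coefficient sequences `A = D(r 1)·D((q 2)²)`, `B = −D(r 2)·D((q 1)²)`,
`D(f) := dtest (f ∘ ((b−a)X + a))` (memo §13: the discrete type principle, unconditional). [val-idea-6 g9 v1.5 located / g10 v1.7: theorem at m = 2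
and at the window ends; refuted instance (3,3) interior] -/
def SummandWindowLaw (m K : ℕ) : Prop :=
  ∀ (d : Fin K → ℕ) (e : ℕ) (p : Fin K → Fin m → ℝ) (a b : ℝ), StrictMono d → (∀ l i, 0 < p l i) →
    IsPeakWindow d e p a b → ∀ i : Fin m,
      (dtest ((tiltPoly d e p i * ∏ j ∈ Finset.univ.erase i, letterPoly d p j ^ 2).comp
        (C (b - a) * X + C a))).signVariations ≤ 1

/-- **Peak-window localisation PL(m,K)** (memo Lemma D4 / Prop. T(i) / §12.1; a PAPER THEOREM, prover-sized — IVT for the tilt roots, the sign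
of each tilt on either side of its root, and `S(t) = Σ_i r i(t) · Π_{j≠i} q j(t)²` with positive weights): if the critical polynomial has a
positive root at all, then either it has at most one (all peaks coincide, or `m ≤ 1`), or there is a non-degenerate peak window containing all
its positive roots in its interior. [val-idea-6 g9 v1.5, located] -/
def PeakLocalization (m K : ℕ) : Prop :=
  ∀ (d : Fin K → ℕ) (e : ℕ) (p : Fin K → Fin m → ℝ), StrictMono d → (∀ l i, 0 < p l i) →
    (∃ t, 0 < t ∧ (critPoly d e p).IsRoot t) →
      posRoots (critPoly d e p) ≤ 1 ∨
        ∃ a b, a < b ∧ IsPeakWindow d e p a b ∧ ∀ t, 0 < t → (critPoly d e p).IsRoot t → a < t ∧ t < b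

/-! #### Peak localisation: the kernel lemmas behind `PeakLocalization` (v1.6) -/

/-- Evaluation of a letter: `q i (t) = Σ_l p l i · t^{d l}`. -/
theorem letterPoly_eval (d : Fin K → ℕ) (p : Fin K → Fin m → ℝ) (i : Fin m) (t : ℝ) :
    (letterPoly d p i).eval t = ∑ l, p l i * t ^ d l := by
  simp [letterPoly, eval_finsetSum]

/-- Evaluation of a tilt: `r i (t) = Σ_l (d l − e) · p l i · t^{d l}`. -/
theorem tiltPoly_eval (d : Fin K → ℕ) (e : ℕ) (p : Fin K → Fin m → ℝ) (i : Fin m) (t : ℝ) :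
    (tiltPoly d e p i).eval t = ∑ l, ((d l : ℝ) - e) * p l i * t ^ d l := by
  simp [tiltPoly, eval_finsetSum]

/-- Positive letters are positive on `(0,∞)`. -/
theorem letterPoly_eval_pos (d : Fin K → ℕ) (p : Fin K → Fin m → ℝ) (hK : 0 < K)
    (hp : ∀ l i, 0 < p l i) (i : Fin m) {t : ℝ} (ht : 0 < t) : 0 < (letterPoly d p i).eval t := by
  rw [letterPoly_eval]
  haveI : Nonempty (Fin K) := ⟨⟨0, hK⟩⟩
  exact Finset.sum_pos (fun l _ => mul_pos (hp l i) (pow_pos ht _)) Finset.univ_nonempty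

/-- The co-product weight `Π_{j ≠ i} q j(t)²` is positive on `(0,∞)`. -/
theorem coprodSq_eval_pos (d : Fin K → ℕ) (p : Fin K → Fin m → ℝ) (hK : 0 < K)
    (hp : ∀ l i, 0 < p l i) (i : Fin m) {t : ℝ} (ht : 0 < t) :
    0 < (∏ j ∈ Finset.univ.erase i, letterPoly d p j ^ 2).eval t := by
  rw [eval_prod]
  exact Finset.prod_pos fun j _ => by
    rw [eval_pow]; exact pow_pos (letterPoly_eval_pos d p hK hp j ht) 2

/-- Evaluation of the critical polynomial as the weighted sum of the tilts. -/
theorem critPoly_eval (d : Fin K → ℕ) (e : ℕ) (p : Fin K → Fin m → ℝ) (t : ℝ) :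
    (critPoly d e p).eval t =
      ∑ i, (tiltPoly d e p i).eval t * (∏ j ∈ Finset.univ.erase i, letterPoly d p j ^ 2).eval t := by
  simp [critPoly, eval_finsetSum, eval_mul]

/-- **D4, sign form (kernel).** At a positive root of the critical polynomial the tilts are not all negative … -/
theorem not_forall_tilt_neg_of_root (d : Fin K → ℕ) (e : ℕ) (p : Fin K → Fin m → ℝ) (hK : 0 < K)
    (hm : 0 < m) (hp : ∀ l i, 0 < p l i) {t : ℝ} (ht : 0 < t) (hS : (critPoly d e p).IsRoot t) :
    ¬ ∀ i, (tiltPoly d e p i).eval t < 0 := by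
  intro h
  have : (critPoly d e p).eval t < 0 := by
    rw [critPoly_eval]
    haveI : Nonempty (Fin m) := ⟨⟨0, hm⟩⟩
    exact Finset.sum_neg (fun i _ => mul_neg_of_neg_of_pos (h i) (coprodSq_eval_pos d p hK hp i ht))
      Finset.univ_nonempty
  exact this.ne hS

/-- … nor all positive … -/
theorem not_forall_tilt_pos_of_root (d : Fin K → ℕ) (e : ℕ) (p : Fin K → Fin m → ℝ) (hK : 0 < K)
    (hm : 0 < m) (hp : ∀ l i, 0 < p l i) {t : ℝ} (ht : 0 < t) (hS : (critPoly d e p).IsRoot t) :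
    ¬ ∀ i, 0 < (tiltPoly d e p i).eval t := by
  intro h
  have : 0 < (critPoly d e p).eval t := by
    rw [critPoly_eval]
    haveI : Nonempty (Fin m) := ⟨⟨0, hm⟩⟩
    exact Finset.sum_pos (fun i _ => mul_pos (h i) (coprodSq_eval_pos d p hK hp i ht))
      Finset.univ_nonempty
  exact this.ne' hS

/-- … and if they are all `≤ 0` (or all `≥ 0`) they all vanish there. -/
theorem forall_tilt_eq_zero_of_root_of_nonpos (d : Fin K → ℕ) (e : ℕ) (p : Fin K → Fin m → ℝ)
    (hK : 0 < K) (hp : ∀ l i, 0 < p l i) {t : ℝ} (ht : 0 < t) (hS : (critPoly d e p).IsRoot t)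
    (h : ∀ i, (tiltPoly d e p i).eval t ≤ 0) : ∀ i, (tiltPoly d e p i).eval t = 0 := by
  have hsum : ∑ i, (tiltPoly d e p i).eval t * (∏ j ∈ Finset.univ.erase i, letterPoly d p j ^ 2).eval t
      = 0 := by rw [← critPoly_eval]; exact hS
  have hle : ∀ i ∈ Finset.univ, (tiltPoly d e p i).eval t *
      (∏ j ∈ Finset.univ.erase i, letterPoly d p j ^ 2).eval t ≤ 0 :=
    fun i _ => mul_nonpos_of_nonpos_of_nonneg (h i) (coprodSq_eval_pos d p hK hp i ht).le
  have h0 := (Finset.sum_eq_zero_iff_of_nonpos hle).mp hsum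
  intro i
  have hi := h0 i (Finset.mem_univ i)
  rcases mul_eq_zero.mp hi with h1 | h1
  · exact h1
  · exact absurd h1 (coprodSq_eval_pos d p hK hp i ht).ne'

theorem forall_tilt_eq_zero_of_root_of_nonneg (d : Fin K → ℕ) (e : ℕ) (p : Fin K → Fin m → ℝ)
    (hK : 0 < K) (hp : ∀ l i, 0 < p l i) {t : ℝ} (ht : 0 < t) (hS : (critPoly d e p).IsRoot t)
    (h : ∀ i, 0 ≤ (tiltPoly d e p i).eval t) : ∀ i, (tiltPoly d e p i).eval t = 0 := by
  have hsum : ∑ i, (tiltPoly d e p i).eval t * (∏ j ∈ Finset.univ.erase i, letterPoly d p j ^ 2).eval t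
      = 0 := by rw [← critPoly_eval]; exact hS
  have hle : ∀ i ∈ Finset.univ, 0 ≤ (tiltPoly d e p i).eval t *
      (∏ j ∈ Finset.univ.erase i, letterPoly d p j ^ 2).eval t :=
    fun i _ => mul_nonneg (h i) (coprodSq_eval_pos d p hK hp i ht).le
  have h0 := (Finset.sum_eq_zero_iff_of_nonneg hle).mp hsum
  intro i
  have hi := h0 i (Finset.mem_univ i)
  rcases mul_eq_zero.mp hi with h1 | h1
  · exact h1
  · exact absurd h1 (coprodSq_eval_pos d p hK hp i ht).ne'

/-- **Two-point monotonicity of a tilt (kernel form of «λ_i is increasing», i.e. log-convexity of the letter):**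
for `0 < s ≤ u`, `r i(s) · u^e ≤ r i(u) · s^e`. -/
theorem tiltPoly_twoPoint_le (d : Fin K → ℕ) (e : ℕ) (p : Fin K → Fin m → ℝ) (hp : ∀ l i, 0 < p l i)
    (i : Fin m) {s u : ℝ} (hs : 0 < s) (hsu : s ≤ u) :
    (tiltPoly d e p i).eval s * u ^ e ≤ (tiltPoly d e p i).eval u * s ^ e := by
  rw [tiltPoly_eval, tiltPoly_eval, Finset.sum_mul, Finset.sum_mul]
  apply Finset.sum_le_sum
  intro l _
  have hu : 0 < u := hs.trans_le hsu
  rcases le_or_gt (d l) e with h | h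
  · -- `d l ≤ e`: coefficient `≤ 0`, and `u^{d l} s^e ≤ s^{d l} u^e`
    obtain ⟨k, hk⟩ := Nat.exists_eq_add_of_le h
    have hc : ((d l : ℝ) - e) * p l i ≤ 0 :=
      mul_nonpos_of_nonpos_of_nonneg (sub_nonpos.mpr (by exact_mod_cast h)) (hp l i).le
    have key : u ^ d l * s ^ e ≤ s ^ d l * u ^ e := by
      rw [hk, pow_add, pow_add]
      have : u ^ d l * (s ^ d l * s ^ k) = (s ^ d l * u ^ d l) * s ^ k := by ring
      rw [this]
      have : s ^ d l * (u ^ d l * u ^ k) = (s ^ d l * u ^ d l) * u ^ k := by ring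
      rw [this]
      exact mul_le_mul_of_nonneg_left (pow_le_pow_left₀ hs.le hsu k) (by positivity)
    calc ((d l : ℝ) - e) * p l i * s ^ d l * u ^ e = ((d l : ℝ) - e) * p l i * (s ^ d l * u ^ e) := by ring
      _ ≤ ((d l : ℝ) - e) * p l i * (u ^ d l * s ^ e) := mul_le_mul_of_nonpos_left key hc
      _ = ((d l : ℝ) - e) * p l i * u ^ d l * s ^ e := by ring
  · -- `e < d l`: coefficient `> 0`, and `s^{d l} u^e ≤ u^{d l} s^e`
    obtain ⟨k, hk⟩ := Nat.exists_eq_add_of_le h.le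
    have hc : 0 ≤ ((d l : ℝ) - e) * p l i :=
      mul_nonneg (sub_nonneg.mpr (by exact_mod_cast h.le)) (hp l i).le
    have key : s ^ d l * u ^ e ≤ u ^ d l * s ^ e := by
      rw [hk, pow_add, pow_add]
      have : s ^ e * s ^ k * u ^ e = (s ^ e * u ^ e) * s ^ k := by ring
      rw [this]
      have : u ^ e * u ^ k * s ^ e = (s ^ e * u ^ e) * u ^ k := by ring
      rw [this]
      exact mul_le_mul_of_nonneg_left (pow_le_pow_left₀ hs.le hsu k) (by positivity)
    calc ((d l : ℝ) - e) * p l i * s ^ d l * u ^ e = ((d l : ℝ) - e) * p l i * (s ^ d l * u ^ e) := by ring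
      _ ≤ ((d l : ℝ) - e) * p l i * (u ^ d l * s ^ e) := mul_le_mul_of_nonneg_left key hc
      _ = ((d l : ℝ) - e) * p l i * u ^ d l * s ^ e := by ring

/-- Sign propagation to the right: `r i(s) ≥ 0`, `s ≤ u` ⇒ `r i(u) ≥ 0`. -/
theorem tiltPoly_eval_nonneg_of_le (d : Fin K → ℕ) (e : ℕ) (p : Fin K → Fin m → ℝ) (hp : ∀ l i, 0 < p l i)
    (i : Fin m) {s u : ℝ} (hs : 0 < s) (hsu : s ≤ u) (h : 0 ≤ (tiltPoly d e p i).eval s) :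
    0 ≤ (tiltPoly d e p i).eval u := by
  have hu : 0 < u := hs.trans_le hsu
  have key := tiltPoly_twoPoint_le d e p hp i hs hsu
  have h1 : 0 ≤ (tiltPoly d e p i).eval u * s ^ e := le_trans (mul_nonneg h (pow_pos hu e).le) key
  by_contra hlt
  push Not at hlt
  have := mul_neg_of_neg_of_pos hlt (pow_pos hs e)
  linarith

/-- Sign propagation to the left: `r i(u) ≤ 0`, `s ≤ u` ⇒ `r i(s) ≤ 0`. -/
theorem tiltPoly_eval_nonpos_of_le (d : Fin K → ℕ) (e : ℕ) (p : Fin K → Fin m → ℝ) (hp : ∀ l i, 0 < p l i)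
    (i : Fin m) {s u : ℝ} (hs : 0 < s) (hsu : s ≤ u) (h : (tiltPoly d e p i).eval u ≤ 0) :
    (tiltPoly d e p i).eval s ≤ 0 := by
  have hu : 0 < u := hs.trans_le hsu
  have key := tiltPoly_twoPoint_le d e p hp i hs hsu
  have h1 : (tiltPoly d e p i).eval s * u ^ e ≤ 0 := le_trans key (mul_nonpos_of_nonpos_of_nonneg h (pow_pos hs e).le)
  by_contra hlt
  push Not at hlt
  have := mul_pos hlt (pow_pos hu e)
  linarith


open Literature.Algebra.Polynomial.Descartes in
/-- **Window edge (kernel).**  If `a < b` and every positive root of the critical polynomial lies in `(a,b)`, then its number of distinct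
positive roots is at most the sign-variation count of the window test (Descartes' rule after the Möbius map, `IsVcaNode.signVariations_dtest`). -/
theorem posRoots_le_signVariations_windowTest (d : Fin K → ℕ) (e : ℕ) (p : Fin K → Fin m → ℝ) {a b : ℝ}
    (hab : a < b) (hroots : ∀ t, 0 < t → (critPoly d e p).IsRoot t → a < t ∧ t < b) :
    posRoots (critPoly d e p) ≤ (windowTest d e p a b).signVariations := by
  classical
  obtain ⟨j, hj⟩ := (isVcaNode_comp (critPoly d e p) a b).signVariations_dtest hab
  have h1 : posRoots (critPoly d e p) ≤ (critPoly d e p).roots.countP (fun x => a < x ∧ x < b) := by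
    unfold posRoots
    calc ((critPoly d e p).roots.toFinset.filter (fun t => 0 < t)).card
        ≤ ((critPoly d e p).roots.toFinset.filter (fun x => a < x ∧ x < b)).card := by
          apply Finset.card_le_card
          intro t ht
          rw [Finset.mem_filter] at ht ⊢
          have hr := (mem_roots'.mp (Multiset.mem_toFinset.mp ht.1)).2
          exact ⟨ht.1, hroots t ht.2 hr⟩
      _ ≤ (critPoly d e p).roots.countP (fun x => a < x ∧ x < b) := by
          rw [Multiset.countP_eq_card_filter, ← Multiset.toFinset_filter]
          exact Multiset.toFinset_card_le _
  have h2 : (windowTest d e p a b).signVariations =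
      (critPoly d e p).roots.countP (fun x => a < x ∧ x < b) + 2 * j := hj
  omega

/-- **Conjecture V + peak localisation ⇒ CKB (kernel).**  `LocalizedDescartes m K → PeakLocalization m K → CommCriticalBudget m K`; with
`commOneLawSharp_of_commCriticalBudget` the localized Descartes law therefore gives COMM-L1(m,K) in kernel (for `K ≥ 1`). -/
theorem commCriticalBudget_of_localizedDescartes (hV : LocalizedDescartes m K) (hW : PeakLocalization m K) :
    CommCriticalBudget m K := by
  classical
  intro d e p hd hp
  by_cases hex : ∃ t, 0 < t ∧ (critPoly d e p).IsRoot t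
  · rcases hW d e p hd hp hex with h1 | ⟨a, b, hab, hwin, hroots⟩
    · calc posRoots (critPoly d e p) ≤ 1 := h1
        _ ≤ 2 * (m - 1) * (K - 1) + 1 := Nat.le_add_left 1 _
    · exact (posRoots_le_signVariations_windowTest d e p hab hroots).trans (hV d e p a b hd hp hwin)
  · have h0 : posRoots (critPoly d e p) = 0 := by
      unfold posRoots
      rw [Finset.card_eq_zero, Finset.filter_eq_empty_iff]
      intro t ht h0
      exact hex ⟨t, h0, (mem_roots'.mp (Multiset.mem_toFinset.mp ht)).2⟩
    rw [h0]
    exact Nat.zero_le _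

/-- COMM-L1 from Conjecture V (kernel composition, `K ≥ 1`). -/
theorem commOneLawSharp_of_localizedDescartes (hK : 0 < K) (hV : LocalizedDescartes m K) (hW : PeakLocalization m K) :
    CommOneLawSharp m K :=
  commOneLawSharp_of_commCriticalBudget hK (commCriticalBudget_of_localizedDescartes hV hW)


/-- Per-term two-point inequality (weak). -/
theorem tiltTerm_twoPoint_le (dl e : ℕ) {q : ℝ} (hq : 0 < q) {s u : ℝ} (hs : 0 < s) (hsu : s ≤ u) :
    ((dl : ℝ) - e) * q * s ^ dl * u ^ e ≤ ((dl : ℝ) - e) * q * u ^ dl * s ^ e := by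
  have hu : 0 < u := hs.trans_le hsu
  rcases le_or_gt dl e with h | h
  · obtain ⟨k, hk⟩ := Nat.exists_eq_add_of_le h
    have hc : ((dl : ℝ) - e) * q ≤ 0 :=
      mul_nonpos_of_nonpos_of_nonneg (sub_nonpos.mpr (by exact_mod_cast h)) hq.le
    have key : u ^ dl * s ^ e ≤ s ^ dl * u ^ e := by
      rw [hk, pow_add, pow_add]
      have h1 : u ^ dl * (s ^ dl * s ^ k) = (s ^ dl * u ^ dl) * s ^ k := by ring
      have h2 : s ^ dl * (u ^ dl * u ^ k) = (s ^ dl * u ^ dl) * u ^ k := by ring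
      rw [h1, h2]
      exact mul_le_mul_of_nonneg_left (pow_le_pow_left₀ hs.le hsu k) (by positivity)
    calc ((dl : ℝ) - e) * q * s ^ dl * u ^ e = ((dl : ℝ) - e) * q * (s ^ dl * u ^ e) := by ring
      _ ≤ ((dl : ℝ) - e) * q * (u ^ dl * s ^ e) := mul_le_mul_of_nonpos_left key hc
      _ = ((dl : ℝ) - e) * q * u ^ dl * s ^ e := by ring
  · obtain ⟨k, hk⟩ := Nat.exists_eq_add_of_le h.le
    have hc : 0 ≤ ((dl : ℝ) - e) * q :=
      mul_nonneg (sub_nonneg.mpr (by exact_mod_cast h.le)) hq.le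
    have key : s ^ dl * u ^ e ≤ u ^ dl * s ^ e := by
      rw [hk, pow_add, pow_add]
      have h1 : s ^ e * s ^ k * u ^ e = (s ^ e * u ^ e) * s ^ k := by ring
      have h2 : u ^ e * u ^ k * s ^ e = (s ^ e * u ^ e) * u ^ k := by ring
      rw [h1, h2]
      exact mul_le_mul_of_nonneg_left (pow_le_pow_left₀ hs.le hsu k) (by positivity)
    calc ((dl : ℝ) - e) * q * s ^ dl * u ^ e = ((dl : ℝ) - e) * q * (s ^ dl * u ^ e) := by ring
      _ ≤ ((dl : ℝ) - e) * q * (u ^ dl * s ^ e) := mul_le_mul_of_nonneg_left key hc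
      _ = ((dl : ℝ) - e) * q * u ^ dl * s ^ e := by ring

/-- Per-term two-point inequality (strict, `dl ≠ e`, `s < u`). -/
theorem tiltTerm_twoPoint_lt (dl e : ℕ) (hne : dl ≠ e) {q : ℝ} (hq : 0 < q) {s u : ℝ} (hs : 0 < s)
    (hsu : s < u) :
    ((dl : ℝ) - e) * q * s ^ dl * u ^ e < ((dl : ℝ) - e) * q * u ^ dl * s ^ e := by
  have hu : 0 < u := hs.trans hsu
  rcases lt_or_gt_of_ne hne with h | h
  · obtain ⟨k, hk⟩ := Nat.exists_eq_add_of_lt h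
    have hc : ((dl : ℝ) - e) * q < 0 :=
      mul_neg_of_neg_of_pos (sub_neg.mpr (by exact_mod_cast h)) hq
    have key : u ^ dl * s ^ e < s ^ dl * u ^ e := by
      rw [hk, pow_add, pow_add, pow_add, pow_add]
      have h1 : u ^ dl * (s ^ dl * s ^ k * s ^ 1) = (s ^ dl * u ^ dl) * s ^ (k + 1) := by ring
      have h2 : s ^ dl * (u ^ dl * u ^ k * u ^ 1) = (s ^ dl * u ^ dl) * u ^ (k + 1) := by ring
      rw [h1, h2]
      exact mul_lt_mul_of_pos_left (pow_lt_pow_left₀ hsu hs.le (Nat.succ_ne_zero k)) (by positivity)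
    calc ((dl : ℝ) - e) * q * s ^ dl * u ^ e = ((dl : ℝ) - e) * q * (s ^ dl * u ^ e) := by ring
      _ < ((dl : ℝ) - e) * q * (u ^ dl * s ^ e) := mul_lt_mul_of_neg_left key hc
      _ = ((dl : ℝ) - e) * q * u ^ dl * s ^ e := by ring
  · obtain ⟨k, hk⟩ := Nat.exists_eq_add_of_lt h
    have hc : 0 < ((dl : ℝ) - e) * q :=
      mul_pos (sub_pos.mpr (by exact_mod_cast h)) hq
    have key : s ^ dl * u ^ e < u ^ dl * s ^ e := by
      rw [hk, pow_add, pow_add, pow_add, pow_add]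
      have h1 : s ^ e * s ^ k * s ^ 1 * u ^ e = (s ^ e * u ^ e) * s ^ (k + 1) := by ring
      have h2 : u ^ e * u ^ k * u ^ 1 * s ^ e = (s ^ e * u ^ e) * u ^ (k + 1) := by ring
      rw [h1, h2]
      exact mul_lt_mul_of_pos_left (pow_lt_pow_left₀ hsu hs.le (Nat.succ_ne_zero k)) (by positivity)
    calc ((dl : ℝ) - e) * q * s ^ dl * u ^ e = ((dl : ℝ) - e) * q * (s ^ dl * u ^ e) := by ring
      _ < ((dl : ℝ) - e) * q * (u ^ dl * s ^ e) := mul_lt_mul_of_pos_left key hc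
      _ = ((dl : ℝ) - e) * q * u ^ dl * s ^ e := by ring

/-- **Strict two-point monotonicity** (some exponent differs from `e`, `s < u`). -/
theorem tiltPoly_twoPoint_lt (d : Fin K → ℕ) (e : ℕ) (p : Fin K → Fin m → ℝ) (hp : ∀ l i, 0 < p l i)
    (hne : ∃ l, d l ≠ e) (i : Fin m) {s u : ℝ} (hs : 0 < s) (hsu : s < u) :
    (tiltPoly d e p i).eval s * u ^ e < (tiltPoly d e p i).eval u * s ^ e := by
  rw [tiltPoly_eval, tiltPoly_eval, Finset.sum_mul, Finset.sum_mul]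
  obtain ⟨l₀, hl₀⟩ := hne
  exact Finset.sum_lt_sum (fun l _ => tiltTerm_twoPoint_le (d l) e (hp l i) hs hsu.le)
    ⟨l₀, Finset.mem_univ _, tiltTerm_twoPoint_lt (d l₀) e hl₀ (hp l₀ i) hs hsu⟩

/-- A positive root of a tilt is unique (some exponent differs from `e`). -/
theorem tiltPoly_root_unique (d : Fin K → ℕ) (e : ℕ) (p : Fin K → Fin m → ℝ) (hp : ∀ l i, 0 < p l i)
    (hne : ∃ l, d l ≠ e) (i : Fin m) {x y : ℝ} (hx : 0 < x) (hy : 0 < y)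
    (hrx : (tiltPoly d e p i).eval x = 0) (hry : (tiltPoly d e p i).eval y = 0) : x = y := by
  rcases lt_trichotomy x y with h | h | h
  · have := tiltPoly_twoPoint_lt d e p hp hne i hx h
    rw [hrx, hry, zero_mul, zero_mul] at this
    exact absurd this (lt_irrefl 0)
  · exact h
  · have := tiltPoly_twoPoint_lt d e p hp hne i hy h
    rw [hrx, hry, zero_mul, zero_mul] at this
    exact absurd this (lt_irrefl 0)

/-- If `r i(t) ≥ 0` then the root `τ` of `r i` is `≤ t` (strict monotonicity). -/
theorem tiltPoly_root_le_of_nonneg (d : Fin K → ℕ) (e : ℕ) (p : Fin K → Fin m → ℝ) (hp : ∀ l i, 0 < p l i)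
    (hne : ∃ l, d l ≠ e) (i : Fin m) {τ t : ℝ} (hτ : 0 < τ) (ht : 0 < t)
    (hr : (tiltPoly d e p i).eval τ = 0) (h : 0 ≤ (tiltPoly d e p i).eval t) : τ ≤ t := by
  by_contra hlt
  push Not at hlt
  have := tiltPoly_twoPoint_lt d e p hp hne i ht hlt
  rw [hr, zero_mul] at this
  have h2 : 0 ≤ (tiltPoly d e p i).eval t * τ ^ e := mul_nonneg h (pow_pos hτ e).le
  linarith

/-- If `r i(t) ≤ 0` then `t ≤ τ`. -/
theorem le_tiltPoly_root_of_nonpos (d : Fin K → ℕ) (e : ℕ) (p : Fin K → Fin m → ℝ) (hp : ∀ l i, 0 < p l i)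
    (hne : ∃ l, d l ≠ e) (i : Fin m) {τ t : ℝ} (hτ : 0 < τ) (_ht : 0 < t)
    (hr : (tiltPoly d e p i).eval τ = 0) (h : (tiltPoly d e p i).eval t ≤ 0) : t ≤ τ := by
  by_contra hlt
  push Not at hlt
  have := tiltPoly_twoPoint_lt d e p hp hne i hτ hlt
  rw [hr, zero_mul] at this
  have h2 : (tiltPoly d e p i).eval t * τ ^ e ≤ 0 := mul_nonpos_of_nonpos_of_nonneg h (pow_pos hτ e).le
  linarith

/-- Near `0⁺` a tilt is negative when the smallest exponent is below `e`. -/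
theorem exists_tiltPoly_eval_neg (d : Fin K → ℕ) (e : ℕ) (p : Fin K → Fin m → ℝ) (hd : StrictMono d)
    (hp : ∀ l i, 0 < p l i) (l₀ : Fin K) (hmin : ∀ l, d l₀ ≤ d l) (he : d l₀ < e) (i : Fin m) :
    ∃ t, 0 < t ∧ (tiltPoly d e p i).eval t < 0 := by
  set g : ℝ → ℝ := fun t => ∑ l, ((d l : ℝ) - e) * p l i * t ^ (d l - d l₀) with hg_def
  have hg : Continuous g := by
    apply continuous_finsetSum
    intro l _
    exact continuous_const.mul (continuous_pow _)
  have hg0 : g 0 = ((d l₀ : ℝ) - e) * p l₀ i := by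
    simp only [hg_def]
    rw [Finset.sum_eq_single l₀]
    · simp
    · intro l _ hl
      have hlt : d l₀ < d l := by
        rcases lt_or_eq_of_le (hmin l) with h | h
        · exact h
        · exact absurd (hd.injective h).symm hl
      have : d l - d l₀ ≠ 0 := Nat.sub_ne_zero_of_lt hlt
      simp [zero_pow this]
    · intro h; exact absurd (Finset.mem_univ _) h
  have hneg : g 0 < 0 := by
    rw [hg0]; exact mul_neg_of_neg_of_pos (sub_neg.mpr (by exact_mod_cast he)) (hp l₀ i)
  have hev : ∀ᶠ t in nhds (0 : ℝ), g t < 0 := hg.continuousAt.eventually_lt continuousAt_const hneg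
  obtain ⟨ε, hε, hball⟩ := Metric.eventually_nhds_iff.mp hev
  refine ⟨ε / 2, by positivity, ?_⟩
  have hε2 : (0 : ℝ) < ε / 2 := by positivity
  have hgt : g (ε / 2) < 0 := hball (by rw [Real.dist_eq, sub_zero, abs_of_pos hε2]; linarith)
  have hfac : (tiltPoly d e p i).eval (ε / 2) = (ε / 2) ^ d l₀ * g (ε / 2) := by
    rw [tiltPoly_eval, hg_def]
    simp only [Finset.mul_sum]
    refine Finset.sum_congr rfl fun l _ => ?_
    rw [← pow_mul_pow_sub (ε / 2) (hmin l)]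
    ring
  rw [hfac]
  exact mul_neg_of_pos_of_neg (pow_pos hε2 _) hgt

/-- Near `+∞` a tilt is positive when the largest exponent is above `e`. -/
theorem exists_tiltPoly_eval_pos (d : Fin K → ℕ) (e : ℕ) (p : Fin K → Fin m → ℝ) (hd : StrictMono d)
    (hp : ∀ l i, 0 < p l i) (l₁ : Fin K) (hmax : ∀ l, d l ≤ d l₁) (he : e < d l₁) (i : Fin m) :
    ∃ t, 0 < t ∧ 0 < (tiltPoly d e p i).eval t := by
  set h : ℝ → ℝ := fun s => ∑ l, ((d l : ℝ) - e) * p l i * s ^ (d l₁ - d l) with hh_def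
  have hh : Continuous h := by
    apply continuous_finsetSum
    intro l _
    exact continuous_const.mul (continuous_pow _)
  have hh0 : h 0 = ((d l₁ : ℝ) - e) * p l₁ i := by
    simp only [hh_def]
    rw [Finset.sum_eq_single l₁]
    · simp
    · intro l _ hl
      have hlt : d l < d l₁ := by
        rcases lt_or_eq_of_le (hmax l) with h' | h'
        · exact h'
        · exact absurd (hd.injective h') hl
      have : d l₁ - d l ≠ 0 := Nat.sub_ne_zero_of_lt hlt
      simp [zero_pow this]
    · intro h'; exact absurd (Finset.mem_univ _) h'
  have hpos : 0 < h 0 := by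
    rw [hh0]; exact mul_pos (sub_pos.mpr (by exact_mod_cast he)) (hp l₁ i)
  have hev : ∀ᶠ s in nhds (0 : ℝ), 0 < h s := continuousAt_const.eventually_lt hh.continuousAt hpos
  obtain ⟨ε, hε, hball⟩ := Metric.eventually_nhds_iff.mp hev
  have hε2 : (0 : ℝ) < ε / 2 := by positivity
  have hgt : 0 < h (ε / 2) := hball (by rw [Real.dist_eq, sub_zero, abs_of_pos hε2]; linarith)
  refine ⟨(ε / 2)⁻¹, inv_pos.mpr hε2, ?_⟩
  set t : ℝ := (ε / 2)⁻¹ with ht_def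
  have ht : 0 < t := inv_pos.mpr hε2
  have hts : t * (ε / 2) = 1 := inv_mul_cancel₀ hε2.ne'
  have hfac : (tiltPoly d e p i).eval t = t ^ d l₁ * h (ε / 2) := by
    rw [tiltPoly_eval, hh_def]
    simp only [Finset.mul_sum]
    refine Finset.sum_congr rfl fun l _ => ?_
    have key : t ^ d l₁ * (ε / 2) ^ (d l₁ - d l) = t ^ d l := by
      rw [← pow_mul_pow_sub t (hmax l), mul_assoc, ← mul_pow, hts, one_pow, mul_one]
    calc ((d l : ℝ) - e) * p l i * t ^ d l = ((d l : ℝ) - e) * p l i * (t ^ d l₁ * (ε / 2) ^ (d l₁ - d l)) := by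
          rw [key]
      _ = t ^ d l₁ * (((d l : ℝ) - e) * p l i * (ε / 2) ^ (d l₁ - d l)) := by ring
  rw [hfac]
  exact mul_pos (pow_pos ht _) hgt

/-- In the interior exponent regime every tilt has a positive root. -/
theorem exists_tiltPoly_root (d : Fin K → ℕ) (e : ℕ) (p : Fin K → Fin m → ℝ) (hd : StrictMono d)
    (hp : ∀ l i, 0 < p l i) (l₀ l₁ : Fin K) (hmin : ∀ l, d l₀ ≤ d l) (hmax : ∀ l, d l ≤ d l₁)
    (he₀ : d l₀ < e) (he₁ : e < d l₁) (i : Fin m) :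
    ∃ τ, 0 < τ ∧ (tiltPoly d e p i).eval τ = 0 := by
  obtain ⟨s, hs, hneg⟩ := exists_tiltPoly_eval_neg d e p hd hp l₀ hmin he₀ i
  obtain ⟨u, hu, hpos⟩ := exists_tiltPoly_eval_pos d e p hd hp l₁ hmax he₁ i
  have hsu : s < u := by
    by_contra hle
    push Not at hle
    have := tiltPoly_eval_nonneg_of_le d e p hp i hu hle hpos.le
    linarith
  have hcont : ContinuousOn (fun x => (tiltPoly d e p i).eval x) (Set.Icc s u) :=
    (tiltPoly d e p i).continuous.continuousOn
  have hmem : (0 : ℝ) ∈ Set.Icc ((tiltPoly d e p i).eval s) ((tiltPoly d e p i).eval u) :=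
    ⟨hneg.le, hpos.le⟩
  obtain ⟨τ, hτ, hτ0⟩ := intermediate_value_Icc hsu.le hcont hmem
  exact ⟨τ, hs.trans_le hτ.1, hτ0⟩

/-- In the extreme exponent regimes the critical polynomial has no positive root unless it vanishes. -/
theorem critPoly_eq_zero_of_root_of_extreme (d : Fin K → ℕ) (e : ℕ) (p : Fin K → Fin m → ℝ)
    (hK : 0 < K) (hp : ∀ l i, 0 < p l i) (hext : (∀ l, e ≤ d l) ∨ (∀ l, d l ≤ e)) {t : ℝ} (ht : 0 < t)
    (hS : (critPoly d e p).IsRoot t) : critPoly d e p = 0 := by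
  -- all tilts vanish at `t`
  have hzero : ∀ i, (tiltPoly d e p i).eval t = 0 := by
    rcases hext with h | h
    · refine forall_tilt_eq_zero_of_root_of_nonneg d e p hK hp ht hS fun i => ?_
      rw [tiltPoly_eval]
      exact Finset.sum_nonneg fun l _ =>
        mul_nonneg (mul_nonneg (sub_nonneg.mpr (by exact_mod_cast h l)) (hp l i).le) (pow_pos ht _).le
    · refine forall_tilt_eq_zero_of_root_of_nonpos d e p hK hp ht hS fun i => ?_
      rw [tiltPoly_eval]
      exact Finset.sum_nonpos fun l _ =>
        mul_nonpos_of_nonpos_of_nonneg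
          (mul_nonpos_of_nonpos_of_nonneg (sub_nonpos.mpr (by exact_mod_cast h l)) (hp l i).le)
          (pow_pos ht _).le
  -- hence every exponent equals `e` (if there is a letter at all), hence every tilt is the zero polynomial
  have htilt : ∀ i, tiltPoly d e p i = 0 := by
    intro i
    have hterms : ∀ l, ((d l : ℝ) - e) = 0 := by
      intro l
      have hsum := hzero i
      rw [tiltPoly_eval] at hsum
      rcases hext with h | h
      · have hnn : ∀ l ∈ Finset.univ, 0 ≤ ((d l : ℝ) - e) * p l i * t ^ d l := fun l _ =>
          mul_nonneg (mul_nonneg (sub_nonneg.mpr (by exact_mod_cast h l)) (hp l i).le) (pow_pos ht _).le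
        have := (Finset.sum_eq_zero_iff_of_nonneg hnn).mp hsum l (Finset.mem_univ l)
        rcases mul_eq_zero.mp this with h1 | h1
        · rcases mul_eq_zero.mp h1 with h2 | h2
          · exact h2
          · exact absurd h2 (hp l i).ne'
        · exact absurd h1 (pow_pos ht _).ne'
      · have hnp : ∀ l ∈ Finset.univ, ((d l : ℝ) - e) * p l i * t ^ d l ≤ 0 := fun l _ =>
          mul_nonpos_of_nonpos_of_nonneg
            (mul_nonpos_of_nonpos_of_nonneg (sub_nonpos.mpr (by exact_mod_cast h l)) (hp l i).le)
            (pow_pos ht _).le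
        have := (Finset.sum_eq_zero_iff_of_nonpos hnp).mp hsum l (Finset.mem_univ l)
        rcases mul_eq_zero.mp this with h1 | h1
        · rcases mul_eq_zero.mp h1 with h2 | h2
          · exact h2
          · exact absurd h2 (hp l i).ne'
        · exact absurd h1 (pow_pos ht _).ne'
    unfold tiltPoly
    exact Finset.sum_eq_zero fun l _ => by rw [hterms l, zero_mul, C_0, zero_mul]
  unfold critPoly
  exact Finset.sum_eq_zero fun i _ => by rw [htilt i, zero_mul]

/-- **Peak localisation holds (kernel, v1.6)** — memo Lemma D4 / Prop. T(i) with all degenerate cases: `PeakLocalization m K`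
is a theorem, so `LocalizedDescartes m K → CommCriticalBudget m K` (of use at `m = 2`). -/
theorem peakLocalization_holds : PeakLocalization m K := by
  classical
  intro d e p hd hp hex
  -- `posRoots S ≤ 1` whenever `S = 0`
  have hzero_case : critPoly d e p = 0 → posRoots (critPoly d e p) ≤ 1 := by
    intro h; simp [posRoots, h]
  by_cases hK : K = 0
  · left
    apply hzero_case
    subst hK
    unfold critPoly tiltPoly
    simp
  have hK' : 0 < K := Nat.pos_of_ne_zero hK
  by_cases hm : m = 0
  · left
    apply hzero_case
    subst hm
    unfold critPoly
    simp
  have hm' : 0 < m := Nat.pos_of_ne_zero hm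
  obtain ⟨t₀, ht₀, hroot₀⟩ := hex
  -- extreme exponent regimes
  by_cases hext : (∀ l, e ≤ d l) ∨ (∀ l, d l ≤ e)
  · left
    exact hzero_case (critPoly_eq_zero_of_root_of_extreme d e p hK' hp hext ht₀ hroot₀)
  push Not at hext
  obtain ⟨⟨la, hla⟩, ⟨lb, hlb⟩⟩ := hext
  -- interior regime: extreme indices
  set l₀ : Fin K := ⟨0, hK'⟩ with hl₀
  set l₁ : Fin K := ⟨K - 1, Nat.sub_lt hK' one_pos⟩ with hl₁
  have hmin : ∀ l, d l₀ ≤ d l := fun l => hd.monotone (by simp [hl₀, Fin.le_def])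
  have hmax : ∀ l, d l ≤ d l₁ := fun l => hd.monotone (by
    simp only [hl₁, Fin.le_def]; exact Nat.le_sub_one_of_lt l.isLt)
  have he₀ : d l₀ < e := lt_of_le_of_lt (hmin la) hla
  have he₁ : e < d l₁ := lt_of_lt_of_le hlb (hmax lb)
  have hne : ∃ l, d l ≠ e := ⟨l₀, he₀.ne⟩
  -- the peaks
  choose τ hτpos hτroot using fun i => exists_tiltPoly_root d e p hd hp l₀ l₁ hmin hmax he₀ he₁ i
  have huniv : (Finset.univ : Finset (Fin m)).Nonempty := Finset.univ_nonempty_iff.mpr ⟨⟨0, hm'⟩⟩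
  obtain ⟨ia, _, hia⟩ := Finset.exists_mem_eq_inf' huniv τ
  obtain ⟨ib, _, hib⟩ := Finset.exists_mem_eq_sup' huniv τ
  have ha_le : ∀ i, τ ia ≤ τ i := fun i => by rw [← hia]; exact Finset.inf'_le τ (Finset.mem_univ i)
  have hle_b : ∀ i, τ i ≤ τ ib := fun i => by rw [← hib]; exact Finset.le_sup' τ (Finset.mem_univ i)
  -- every positive root of `S` lies in `[τ ia, τ ib]`, and at an endpoint all peaks coincide
  have hbetween : ∀ t, 0 < t → (critPoly d e p).IsRoot t → τ ia ≤ t ∧ t ≤ τ ib := by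
    intro t ht hS
    have h1 := not_forall_tilt_neg_of_root d e p hK' hm' hp ht hS
    have h2 := not_forall_tilt_pos_of_root d e p hK' hm' hp ht hS
    push Not at h1 h2
    obtain ⟨i, hi⟩ := h1
    obtain ⟨j, hj⟩ := h2
    exact ⟨(ha_le i).trans (tiltPoly_root_le_of_nonneg d e p hp hne i (hτpos i) ht (hτroot i) hi),
      (le_tiltPoly_root_of_nonpos d e p hp hne j (hτpos j) ht (hτroot j) hj).trans (hle_b j)⟩
  have hcollapse_a : ∀ t, 0 < t → (critPoly d e p).IsRoot t → t = τ ia → ∀ k, τ k = τ ia := by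
    intro t ht hS hta k
    have hnp : ∀ i, (tiltPoly d e p i).eval t ≤ 0 := fun i => by
      have hti : t ≤ τ i := by rw [hta]; exact ha_le i
      exact tiltPoly_eval_nonpos_of_le d e p hp i ht hti (le_of_eq (hτroot i))
    have hz := forall_tilt_eq_zero_of_root_of_nonpos d e p hK' hp ht hS hnp k
    have := tiltPoly_root_unique d e p hp hne k ht (hτpos k) hz (hτroot k)
    rw [← this, hta]
  have hcollapse_b : ∀ t, 0 < t → (critPoly d e p).IsRoot t → t = τ ib → ∀ k, τ k = τ ib := by
    intro t ht hS htb k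
    have hnn : ∀ i, 0 ≤ (tiltPoly d e p i).eval t := fun i => by
      have hti : τ i ≤ t := by rw [htb]; exact hle_b i
      exact tiltPoly_eval_nonneg_of_le d e p hp i (hτpos i) hti (ge_of_eq (hτroot i))
    have hz := forall_tilt_eq_zero_of_root_of_nonneg d e p hK' hp ht hS hnn k
    have := tiltPoly_root_unique d e p hp hne k ht (hτpos k) hz (hτroot k)
    rw [← this, htb]
  by_cases hab : τ ia = τ ib
  · -- all peaks coincide: the positive root is unique
    left
    unfold posRoots
    refine Finset.card_le_one.mpr fun x hx y hy => ?_
    rw [Finset.mem_filter] at hx hy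
    have hxr := (mem_roots'.mp (Multiset.mem_toFinset.mp hx.1)).2
    have hyr := (mem_roots'.mp (Multiset.mem_toFinset.mp hy.1)).2
    have hx' := hbetween x hx.2 hxr
    have hy' := hbetween y hy.2 hyr
    rw [← hab] at hx' hy'
    rw [le_antisymm hx'.2 hx'.1, le_antisymm hy'.2 hy'.1]
  · right
    have hab' : τ ia < τ ib := lt_of_le_of_ne (ha_le ib) hab
    refine ⟨τ ia, τ ib, hab', ⟨hτpos ia, hab'.le, ?_, ⟨ia, hτroot ia⟩, ?_, ⟨ib, hτroot ib⟩⟩, ?_⟩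
    · intro i
      exact tiltPoly_eval_nonpos_of_le d e p hp i (hτpos ia) (ha_le i) (le_of_eq (hτroot i))
    · intro i
      exact tiltPoly_eval_nonneg_of_le d e p hp i (hτpos i) (hle_b i) (ge_of_eq (hτroot i))
    · intro t ht hS
      obtain ⟨h1, h2⟩ := hbetween t ht hS
      refine ⟨lt_of_le_of_ne h1 fun h => hab ?_, lt_of_le_of_ne h2 fun h => hab ?_⟩
      · exact ((hcollapse_a t ht hS h.symm) ib).symm
      · exact (hcollapse_b t ht hS h) ia

/-- **LD ⇒ CKB unconditionally (kernel, v1.6)**; at `m = 2` this makes Conjecture V alone carry COMM-L1(2,K). -/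
theorem commCriticalBudget_of_localizedDescartes' (hV : LocalizedDescartes m K) : CommCriticalBudget m K :=
  commCriticalBudget_of_localizedDescartes hV peakLocalization_holds

theorem commOneLawSharp_of_localizedDescartes' (hK : 0 < K) (hV : LocalizedDescartes m K) :
    CommOneLawSharp m K :=
  commOneLawSharp_of_commCriticalBudget hK (commCriticalBudget_of_localizedDescartes' hV)


/-! ### The summand window law V3 PROVED at `m = 2` and at the window ends for every `m` (v1.7, memo §13)

**Theorem V3 (kernel).**  Let `0 < a ≤ b` and let the tilt `r i` vanish at `a` (resp. at `b`).  Then the Vincent–Jacobi test polynomial of the summand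
`r i · Π_{j ≠ i} (q j)²` on the window `(a,b)` has ALL COEFFICIENTS `≥ 0` (resp. `≤ 0`); in particular it has no sign variation
(`summand_window_signVariations_eq_zero`).  Consequently `SummandWindowLaw 2 K` holds for every `K` (`summandWindowLaw_two`: at `m = 2` each letter attains a
window end), and for every `m` the two END summands (the letters attaining `a = min t_i*` and `b = max t_i*`) pass; interior summands do NOT in general
(critic val-idea-crit-2 NOTE #42(3): `d = (0,14,17)`, `e = 15`, three letters `1 + t¹⁴ + c_i t¹⁷` with peaks `1/128, 1, 128`: the middle summand has window
count `5`) — an interior tilt changes sign inside the window, and one sign variation is not preserved under multiplication by positive-coefficient factors.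

PROOF (the «binomial-moment» mechanism).  Write `D(f) := dtest (f ∘ ((b−a)X + a))`.  (i) `dtest` is multiplicative (`dtest_mul`, tree) and so is `∘`;
a letter has nonnegative coefficients, so `q j ∘ ((b−a)X + a)`, its reverse and its Taylor shift have nonnegative coefficients: `D(q j) ≥ 0`
coefficientwise (`coeffNonneg_dtest_window`).  Hence `D(summand) = D(r i) · D(Π q j²)` is one-signed as soon as `D(r i)` is.  (ii) EXPANSION
(`dtest_comp_linear_eq`): for `a < b`, `D(f) = Σ_{j ≤ n} f_j · (aX + b)^j (X + 1)^{n − j}`, `n = deg f` (via `reflect_mul` and `taylor`).  (iii) KERNEL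
MONOTONICITY: `b^{n−j} (aX+b)^j (X+1)^{n−j}` is coefficientwise ANTITONE in `j` and `a^{n−j} (aX+b)^j (X+1)^{n−j}` coefficientwise MONOTONE
(one-step differences `= (…) · (b − a) X` resp. `(…) · (b − a)` with nonnegative-coefficient cofactors; `wbasis_right_step`, `wbasis_left_step`).
(iv) ZERO SUM: the tilt's coefficients are `r_j = (j − e) q_j` with `q_j ≥ 0` (`tiltPoly_coeff`), so the weights `r_j b^j` (resp. `r_j a^j`) are `≤ 0`
below `e`, `≥ 0` above `e`, and sum to `r(b) = 0` (resp. `r(a) = 0`); a zero-sum family of this sign shape integrated against an antitone (monotone)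
kernel is `≤ 0` (`≥ 0`) — subtract the kernel's value at the pivot `min e n` (`tiltSum_nonpos_of_antitoneOn`, `tiltSum_nonneg_of_monotoneOn`).
Hence `b^n · [X^k] D(r i) ≤ 0` at the right end and `a^n · [X^k] D(r i) ≥ 0` at the left end.  The degenerate window `a = b` gives `D = 0`.

CONSEQUENCE for CKB(2,K) (memo §12.4, now unconditional): on the peak window, `windowTest = A − B` with `A = D(r₁)D(q₂)² ≥ 0` and `B = −D(r₂)D(q₁)² ≥ 0`
coefficientwise, so `Var(windowTest)` is the number of crossings of ONE ratio of two finite nonnegative sequences with the amplitude level — the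
«discrete type principle»; `LocalizedDescartes 2 K` ⟺ no level is crossed more than `2K − 1` times.  [val-idea-6 g10 v1.7] -/

open Literature.Algebra.Polynomial.Descartes

/-! #### Coefficientwise nonnegativity (bookkeeping) -/

/-- All coefficients of `P` are `≥ 0`. -/
def CoeffNonneg (P : ℝ[X]) : Prop := ∀ k, 0 ≤ P.coeff k

theorem coeffNonneg_zero : CoeffNonneg 0 := fun k => by simp

theorem coeffNonneg_C {x : ℝ} (hx : 0 ≤ x) : CoeffNonneg (C x) := fun k => by
  rw [coeff_C]; split_ifs <;> simp [hx]

theorem coeffNonneg_X : CoeffNonneg (X : ℝ[X]) := fun k => by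
  rw [coeff_X]; split_ifs <;> simp

theorem coeffNonneg_one : CoeffNonneg (1 : ℝ[X]) := fun k => by
  rw [coeff_one]; split_ifs <;> simp

theorem CoeffNonneg.add {P Q : ℝ[X]} (hP : CoeffNonneg P) (hQ : CoeffNonneg Q) : CoeffNonneg (P + Q) :=
  fun k => by rw [coeff_add]; exact add_nonneg (hP k) (hQ k)

theorem CoeffNonneg.mul {P Q : ℝ[X]} (hP : CoeffNonneg P) (hQ : CoeffNonneg Q) : CoeffNonneg (P * Q) :=
  fun k => by
    rw [coeff_mul]
    exact Finset.sum_nonneg fun x _ => mul_nonneg (hP _) (hQ _)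

theorem CoeffNonneg.pow {P : ℝ[X]} (hP : CoeffNonneg P) (n : ℕ) : CoeffNonneg (P ^ n) := by
  induction n with
  | zero => rw [pow_zero]; exact coeffNonneg_one
  | succ n ih => rw [pow_succ]; exact ih.mul hP

theorem CoeffNonneg.prod {ι : Type*} (s : Finset ι) {f : ι → ℝ[X]} (h : ∀ i ∈ s, CoeffNonneg (f i)) :
    CoeffNonneg (∏ i ∈ s, f i) := by
  classical
  induction s using Finset.induction_on with
  | empty => rw [Finset.prod_empty]; exact coeffNonneg_one
  | insert a s ha ih =>
      rw [Finset.prod_insert ha]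
      exact (h a (Finset.mem_insert_self a s)).mul (ih fun i hi => h i (Finset.mem_insert_of_mem hi))

/-- Composition with a polynomial with nonnegative coefficients preserves nonnegative coefficients. -/
theorem CoeffNonneg.comp {P G : ℝ[X]} (hP : CoeffNonneg P) (hG : CoeffNonneg G) : CoeffNonneg (P.comp G) := by
  intro k
  rw [comp_eq_sum_left, Polynomial.sum_def, finsetSum_coeff]
  refine Finset.sum_nonneg fun n _ => ?_
  rw [coeff_C_mul]
  exact mul_nonneg (hP n) (hG.pow n k)

theorem CoeffNonneg.reverse {P : ℝ[X]} (hP : CoeffNonneg P) : CoeffNonneg P.reverse :=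
  fun k => by rw [coeff_reverse]; exact hP _

theorem coeffNonneg_linear {c a : ℝ} (hc : 0 ≤ c) (ha : 0 ≤ a) : CoeffNonneg (C c * X + C a) :=
  ((coeffNonneg_C hc).mul coeffNonneg_X).add (coeffNonneg_C ha)

theorem CoeffNonneg.taylor_one {P : ℝ[X]} (hP : CoeffNonneg P) : CoeffNonneg (taylor 1 P) := by
  rw [taylor_apply]
  exact hP.comp (coeffNonneg_X.add (coeffNonneg_C zero_le_one))

/-- The Descartes–Jacobi test polynomial of a polynomial with nonnegative coefficients has nonnegative coefficients. -/
theorem CoeffNonneg.dtest {P : ℝ[X]} (hP : CoeffNonneg P) : CoeffNonneg (dtest P) :=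
  hP.reverse.taylor_one

/-- `P ≤ Q` coefficientwise from `CoeffNonneg (Q − P)`. -/
theorem coeff_le_of_coeffNonneg_sub {P Q : ℝ[X]} (h : CoeffNonneg (Q - P)) (k : ℕ) : P.coeff k ≤ Q.coeff k := by
  have := h k; rw [coeff_sub] at this; linarith

/-- (coefficientwise `≤ 0`) · (coefficientwise `≥ 0`) is coefficientwise `≤ 0`. -/
theorem coeff_mul_nonpos_of_nonpos_of_nonneg {P Q : ℝ[X]} (hP : ∀ k, P.coeff k ≤ 0) (hQ : CoeffNonneg Q) (k : ℕ) :
    (P * Q).coeff k ≤ 0 := by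
  rw [coeff_mul]
  exact Finset.sum_nonpos fun x _ => mul_nonpos_of_nonpos_of_nonneg (hP _) (hQ _)

/-! #### The window basis and the expansion of the test polynomial of an affine image -/

/-- The window basis element `Φ_j = (aX + b)^j (X + 1)^{n − j}`. -/
noncomputable def wbasis (a b : ℝ) (n j : ℕ) : ℝ[X] := (C a * X + C b) ^ j * (X + 1) ^ (n - j)

theorem coeffNonneg_wbasis {a b : ℝ} (ha : 0 ≤ a) (hb : 0 ≤ b) (n j : ℕ) : CoeffNonneg (wbasis a b n j) :=
  ((coeffNonneg_linear ha hb).pow j).mul ((coeffNonneg_X.add coeffNonneg_one).pow _)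

/-- `reflect 1 (cX + a) = aX + c`. -/
theorem reflect_one_linear (c a : ℝ) : reflect 1 (C c * X + C a) = C a * X + C c := by
  have h : C c * X + C a = C c * X ^ 1 + C a * X ^ 0 := by rw [pow_one, pow_zero, mul_one]
  rw [h, reflect_add, reflect_C_mul_X_pow, reflect_C_mul_X_pow, revAt_le (le_refl 1), revAt_le (Nat.zero_le 1)]
  simp only [Nat.sub_self, Nat.sub_zero, pow_zero, pow_one, mul_one]
  ring

/-- `reflect n ((cX + a)^n) = (aX + c)^n`. -/
theorem reflect_linear_pow_self (c a : ℝ) (n : ℕ) : reflect n ((C c * X + C a) ^ n) = (C a * X + C c) ^ n := by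
  induction n with
  | zero => simp
  | succ n ih =>
      rw [pow_succ, reflect_mul _ _ (natDegree_pow_le_of_le n natDegree_linear_le |>.trans (by omega)) natDegree_linear_le,
        ih, reflect_one_linear, pow_succ]

/-- `reflect N ((cX + a)^n) = (aX + c)^n · X^{N − n}` for `n ≤ N`. -/
theorem reflect_linear_pow (c a : ℝ) {n N : ℕ} (h : n ≤ N) :
    reflect N ((C c * X + C a) ^ n) = (C a * X + C c) ^ n * X ^ (N - n) := by
  obtain ⟨t, rfl⟩ := Nat.exists_eq_add_of_le h
  rw [Nat.add_sub_cancel_left, ← mul_one ((C c * X + C a) ^ n),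
    reflect_mul _ _ (natDegree_pow_le_of_le n natDegree_linear_le |>.trans (by omega)) (by simp : (1 : ℝ[X]).natDegree ≤ t),
    reflect_one, reflect_linear_pow_self]

/-- **Expansion lemma.** For `natDegree f ≤ N`: `taylor 1 (reflect N (f ∘ (cX + a))) = Σ_{j ≤ N} f_j · (aX + (a + c))^j (X + 1)^{N − j}`. -/
theorem taylor_reflect_comp_linear (c a : ℝ) (N : ℕ) :
    ∀ f : ℝ[X], f.natDegree ≤ N → taylor 1 (reflect N (f.comp (C c * X + C a))) =
      ∑ j ∈ Finset.range (N + 1), C (f.coeff j) * wbasis a (a + c) N j := by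
  refine Polynomial.induction_with_natDegree_le
    (fun f => taylor 1 (reflect N (f.comp (C c * X + C a))) =
      ∑ j ∈ Finset.range (N + 1), C (f.coeff j) * wbasis a (a + c) N j) N ?_ ?_ ?_
  · simp
  · intro n r hr hn
    rw [C_mul_comp, X_pow_comp, reflect_C_mul, reflect_linear_pow c a hn]
    rw [Finset.sum_eq_single n]
    · rw [coeff_C_mul_X_pow, if_pos rfl, wbasis, taylor_apply]
      simp only [mul_comp, pow_comp, add_comp, C_comp, X_comp, map_add, map_one]
      congr 2
      ring
    · intro j _ hj
      rw [coeff_C_mul_X_pow, if_neg hj, C_0, zero_mul]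
    · intro h
      exact absurd (Finset.mem_range.mpr (Nat.lt_succ_of_le hn)) h
  · intro f g _ _ hf hg
    rw [add_comp, reflect_add, map_add, hf, hg, ← Finset.sum_add_distrib]
    refine Finset.sum_congr rfl fun j _ => ?_
    rw [coeff_add, C_add, add_mul]

/-- The test polynomial of an affine image with `c ≠ 0`, expanded in the window basis:
`dtest (f ∘ (cX + a)) = Σ_{j ≤ n} f_j · (aX + (a + c))^j (X + 1)^{n − j}`, `n = natDegree f`. -/
theorem dtest_comp_linear_eq (f : ℝ[X]) {c : ℝ} (hc : c ≠ 0) (a : ℝ) :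
    dtest (f.comp (C c * X + C a)) =
      ∑ j ∈ Finset.range (f.natDegree + 1), C (f.coeff j) * wbasis a (a + c) f.natDegree j := by
  have hn : (f.comp (C c * X + C a)).natDegree = f.natDegree := by
    rw [natDegree_comp, natDegree_linear hc, mul_one]
  rw [dtest, reverse, hn]
  exact taylor_reflect_comp_linear c a _ f le_rfl

/-! #### Zero-sum lemma: tilt-signed weights against a monotone / antitone kernel -/

/-- Weights `(j − e)·v_j` (`v ≥ 0`) with zero sum, against a kernel ANTITONE on `[0,n]`, give a sum `≤ 0` (pivot at `min e n`). -/
theorem tiltSum_nonpos_of_antitoneOn (n e : ℕ) (v κ : ℕ → ℝ) (hv : ∀ j, 0 ≤ v j)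
    (hκ : ∀ i j, i ≤ j → j ≤ n → κ j ≤ κ i)
    (h0 : ∑ j ∈ Finset.range (n + 1), ((j : ℝ) - e) * v j = 0) :
    ∑ j ∈ Finset.range (n + 1), ((j : ℝ) - e) * v j * κ j ≤ 0 := by
  set κ₀ := κ (min e n) with hκ₀
  have key : ∑ j ∈ Finset.range (n + 1), ((j : ℝ) - e) * v j * κ j =
      ∑ j ∈ Finset.range (n + 1), ((j : ℝ) - e) * v j * (κ j - κ₀) := by
    have : ∑ j ∈ Finset.range (n + 1), ((j : ℝ) - e) * v j * (κ j - κ₀) =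
        ∑ j ∈ Finset.range (n + 1), ((j : ℝ) - e) * v j * κ j - κ₀ * ∑ j ∈ Finset.range (n + 1), ((j : ℝ) - e) * v j := by
      rw [Finset.mul_sum, ← Finset.sum_sub_distrib]
      refine Finset.sum_congr rfl fun j _ => by ring
    rw [this, h0, mul_zero, sub_zero]
  rw [key]
  refine Finset.sum_nonpos fun j hj => ?_
  have hjn : j ≤ n := Nat.lt_succ_iff.mp (Finset.mem_range.mp hj)
  rcases lt_trichotomy j e with hlt | heq | hgt
  · have hw : ((j : ℝ) - e) * v j ≤ 0 :=
      mul_nonpos_of_nonpos_of_nonneg (sub_nonpos.mpr (by exact_mod_cast hlt.le)) (hv j)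
    have hk : 0 ≤ κ j - κ₀ := sub_nonneg.mpr (hκ j (min e n) (le_min hlt.le hjn) (min_le_right e n))
    exact mul_nonpos_of_nonpos_of_nonneg hw hk
  · subst heq; simp
  · have hw : 0 ≤ ((j : ℝ) - e) * v j :=
      mul_nonneg (sub_nonneg.mpr (by exact_mod_cast hgt.le)) (hv j)
    have hmin : min e n = e := min_eq_left (hgt.le.trans hjn)
    have hk : κ j - κ₀ ≤ 0 := sub_nonpos.mpr (by rw [hκ₀, hmin]; exact hκ e j hgt.le hjn)
    exact mul_nonpos_of_nonneg_of_nonpos hw hk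

/-- Weights `(j − e)·v_j` (`v ≥ 0`) with zero sum, against a kernel MONOTONE on `[0,n]`, give a sum `≥ 0`. -/
theorem tiltSum_nonneg_of_monotoneOn (n e : ℕ) (v κ : ℕ → ℝ) (hv : ∀ j, 0 ≤ v j)
    (hκ : ∀ i j, i ≤ j → j ≤ n → κ i ≤ κ j)
    (h0 : ∑ j ∈ Finset.range (n + 1), ((j : ℝ) - e) * v j = 0) :
    0 ≤ ∑ j ∈ Finset.range (n + 1), ((j : ℝ) - e) * v j * κ j := by
  have h := tiltSum_nonpos_of_antitoneOn n e v (fun j => - κ j) hv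
    (fun i j hij hjn => neg_le_neg (hκ i j hij hjn)) h0
  have : ∑ j ∈ Finset.range (n + 1), ((j : ℝ) - e) * v j * (-κ j) =
      - ∑ j ∈ Finset.range (n + 1), ((j : ℝ) - e) * v j * κ j := by
    rw [← Finset.sum_neg_distrib]; refine Finset.sum_congr rfl fun j _ => by ring
  rw [this] at h
  linarith

/-! #### Kernel monotonicity of the scaled window basis -/

/-- Right-end kernel step: `b^{n−j−1}Φ_{j+1} ≤ b^{n−j}Φ_j` coefficientwise (`0 ≤ a ≤ b`, `j + 1 ≤ n`); the difference is
`b^{n−j−1} (aX+b)^j (X+1)^{n−j−1} · (b − a) X`. -/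
theorem wbasis_right_step {a b : ℝ} (ha : 0 ≤ a) (hab : a ≤ b) {n j : ℕ} (hj : j + 1 ≤ n) (k : ℕ) :
    (C (b ^ (n - (j + 1))) * wbasis a b n (j + 1)).coeff k ≤ (C (b ^ (n - j)) * wbasis a b n j).coeff k := by
  apply coeff_le_of_coeffNonneg_sub
  obtain ⟨t, ht⟩ : ∃ t, n - j = t + 1 ∧ n - (j + 1) = t := ⟨n - (j + 1), by omega, rfl⟩
  have hid : C (b ^ (n - j)) * wbasis a b n j - C (b ^ (n - (j + 1))) * wbasis a b n (j + 1) =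
      C (b ^ t) * (C a * X + C b) ^ j * (X + 1) ^ t * (C (b - a) * X) := by
    rw [wbasis, wbasis, ht.1, ht.2]
    simp only [pow_succ, C_mul, C_pow, map_sub]
    ring
  rw [hid]
  have hb : 0 ≤ b := ha.trans hab
  exact (((coeffNonneg_C (pow_nonneg hb t)).mul ((coeffNonneg_linear ha hb).pow j)).mul
    ((coeffNonneg_X.add coeffNonneg_one).pow t)).mul ((coeffNonneg_C (sub_nonneg.mpr hab)).mul coeffNonneg_X)

/-- Left-end kernel step: `a^{n−j}Φ_j ≤ a^{n−j−1}Φ_{j+1}` coefficientwise (`0 ≤ a ≤ b`, `j + 1 ≤ n`); the difference is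
`a^{n−j−1} (aX+b)^j (X+1)^{n−j−1} · (b − a)`. -/
theorem wbasis_left_step {a b : ℝ} (ha : 0 ≤ a) (hab : a ≤ b) {n j : ℕ} (hj : j + 1 ≤ n) (k : ℕ) :
    (C (a ^ (n - j)) * wbasis a b n j).coeff k ≤ (C (a ^ (n - (j + 1))) * wbasis a b n (j + 1)).coeff k := by
  apply coeff_le_of_coeffNonneg_sub
  obtain ⟨t, ht⟩ : ∃ t, n - j = t + 1 ∧ n - (j + 1) = t := ⟨n - (j + 1), by omega, rfl⟩
  have hid : C (a ^ (n - (j + 1))) * wbasis a b n (j + 1) - C (a ^ (n - j)) * wbasis a b n j =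
      C (a ^ t) * (C a * X + C b) ^ j * (X + 1) ^ t * C (b - a) := by
    rw [wbasis, wbasis, ht.1, ht.2]
    simp only [pow_succ, C_mul, C_pow, map_sub]
    ring
  rw [hid]
  have hb : 0 ≤ b := ha.trans hab
  exact (((coeffNonneg_C (pow_nonneg ha t)).mul ((coeffNonneg_linear ha hb).pow j)).mul
    ((coeffNonneg_X.add coeffNonneg_one).pow t)).mul (coeffNonneg_C (sub_nonneg.mpr hab))

/-- From one-step comparisons to comparisons on `[0,n]` (antitone form). -/
theorem antitoneOn_of_step (κ : ℕ → ℝ) (n : ℕ) (h : ∀ j, j + 1 ≤ n → κ (j + 1) ≤ κ j) :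
    ∀ i j, i ≤ j → j ≤ n → κ j ≤ κ i := by
  intro i j hij hjn
  obtain ⟨t, rfl⟩ := Nat.exists_eq_add_of_le hij
  induction t with
  | zero => simp
  | succ t ih =>
      calc κ (i + (t + 1)) = κ (i + t + 1) := by rw [Nat.add_assoc]
        _ ≤ κ (i + t) := h (i + t) (by omega)
        _ ≤ κ i := ih (Nat.le_add_right i t) (by omega)

/-! #### The two endpoint theorems (generic: `r_j = (j − e)·q_j`, `q ≥ 0` coefficientwise) -/

/-- **Right end.** If `r_j = (j − e) q_j` with `q ≥ 0` coefficientwise, `0 < a ≤ b` and `r(b) = 0`, then the test polynomial of `r` on the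
window `(a,b)` has all coefficients `≤ 0`. -/
theorem dtest_window_coeff_nonpos_of_eval_right (q r : ℝ[X]) (e : ℕ)
    (hq : ∀ j, 0 ≤ q.coeff j) (hr : ∀ j, r.coeff j = ((j : ℝ) - e) * q.coeff j)
    {a b : ℝ} (ha : 0 < a) (hab : a ≤ b) (hrb : r.eval b = 0) (k : ℕ) :
    (dtest (r.comp (C (b - a) * X + C a))).coeff k ≤ 0 := by
  rcases hab.eq_or_lt with rfl | hlt
  · rw [sub_self, C_0, zero_mul, zero_add, comp_C, hrb, C_0, dtest_zero, coeff_zero]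
  have hc : b - a ≠ 0 := sub_ne_zero.mpr hlt.ne'
  have hb : 0 < b := ha.trans hlt
  set n := r.natDegree with hn
  rw [dtest_comp_linear_eq r hc a, add_sub_cancel, finsetSum_coeff]
  simp only [coeff_C_mul]
  suffices h : b ^ n * ∑ j ∈ Finset.range (n + 1), r.coeff j * (wbasis a b n j).coeff k ≤ 0 by
    by_contra hcon
    push Not at hcon
    have := mul_pos (pow_pos hb n) hcon
    linarith
  have hexp : b ^ n * ∑ j ∈ Finset.range (n + 1), r.coeff j * (wbasis a b n j).coeff k =
      ∑ j ∈ Finset.range (n + 1), ((j : ℝ) - e) * (q.coeff j * b ^ j) * (C (b ^ (n - j)) * wbasis a b n j).coeff k := by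
    rw [Finset.mul_sum]
    refine Finset.sum_congr rfl fun j hj => ?_
    have hjn : j ≤ n := Nat.lt_succ_iff.mp (Finset.mem_range.mp hj)
    rw [coeff_C_mul, hr j, ← pow_mul_pow_sub b hjn]
    ring
  rw [hexp]
  apply tiltSum_nonpos_of_antitoneOn n e (fun j => q.coeff j * b ^ j) (fun j => (C (b ^ (n - j)) * wbasis a b n j).coeff k)
  · exact fun j => mul_nonneg (hq j) (pow_nonneg hb.le j)
  · exact antitoneOn_of_step _ n fun j hj => wbasis_right_step ha.le hab hj k
  · have : ∑ j ∈ Finset.range (n + 1), ((j : ℝ) - e) * (q.coeff j * b ^ j) = r.eval b := by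
      rw [eval_eq_sum_range' (Nat.lt_succ_of_le le_rfl)]
      refine Finset.sum_congr rfl fun j _ => by rw [hr j]; ring
    rw [this, hrb]

/-- **Left end.** If `r_j = (j − e) q_j` with `q ≥ 0` coefficientwise, `0 < a ≤ b` and `r(a) = 0`, then the test polynomial of `r` on the
window `(a,b)` has all coefficients `≥ 0`. -/
theorem dtest_window_coeff_nonneg_of_eval_left (q r : ℝ[X]) (e : ℕ)
    (hq : ∀ j, 0 ≤ q.coeff j) (hr : ∀ j, r.coeff j = ((j : ℝ) - e) * q.coeff j)
    {a b : ℝ} (ha : 0 < a) (hab : a ≤ b) (hra : r.eval a = 0) (k : ℕ) :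
    0 ≤ (dtest (r.comp (C (b - a) * X + C a))).coeff k := by
  rcases hab.eq_or_lt with rfl | hlt
  · rw [sub_self, C_0, zero_mul, zero_add, comp_C, hra, C_0, dtest_zero, coeff_zero]
  have hc : b - a ≠ 0 := sub_ne_zero.mpr hlt.ne'
  set n := r.natDegree with hn
  rw [dtest_comp_linear_eq r hc a, add_sub_cancel, finsetSum_coeff]
  simp only [coeff_C_mul]
  suffices h : 0 ≤ a ^ n * ∑ j ∈ Finset.range (n + 1), r.coeff j * (wbasis a b n j).coeff k by
    by_contra hcon
    push Not at hcon
    have := mul_neg_of_pos_of_neg (pow_pos ha n) hcon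
    linarith
  have hexp : a ^ n * ∑ j ∈ Finset.range (n + 1), r.coeff j * (wbasis a b n j).coeff k =
      ∑ j ∈ Finset.range (n + 1), ((j : ℝ) - e) * (q.coeff j * a ^ j) * (C (a ^ (n - j)) * wbasis a b n j).coeff k := by
    rw [Finset.mul_sum]
    refine Finset.sum_congr rfl fun j hj => ?_
    have hjn : j ≤ n := Nat.lt_succ_iff.mp (Finset.mem_range.mp hj)
    rw [coeff_C_mul, hr j, ← pow_mul_pow_sub a hjn]
    ring
  rw [hexp]
  apply tiltSum_nonneg_of_monotoneOn n e (fun j => q.coeff j * a ^ j) (fun j => (C (a ^ (n - j)) * wbasis a b n j).coeff k)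
  · exact fun j => mul_nonneg (hq j) (pow_nonneg ha.le j)
  · have hstep := antitoneOn_of_step (fun j => - (C (a ^ (n - j)) * wbasis a b n j).coeff k) n
      (fun j hj => neg_le_neg (wbasis_left_step ha.le hab hj k))
    intro i j hij hjn
    simpa using hstep i j hij hjn
  · have : ∑ j ∈ Finset.range (n + 1), ((j : ℝ) - e) * (q.coeff j * a ^ j) = r.eval a := by
      rw [eval_eq_sum_range' (Nat.lt_succ_of_le le_rfl)]
      refine Finset.sum_congr rfl fun j _ => by rw [hr j]; ring
    rw [this, hra]

/-- The test polynomial of a coefficientwise nonnegative polynomial on a window `0 ≤ a ≤ b` is coefficientwise nonnegative. -/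
theorem coeffNonneg_dtest_window {P : ℝ[X]} (hP : CoeffNonneg P) {a b : ℝ} (ha : 0 ≤ a) (hab : a ≤ b) :
    CoeffNonneg (dtest (P.comp (C (b - a) * X + C a))) :=
  (hP.comp (coeffNonneg_linear (sub_nonneg.mpr hab) ha)).dtest

/-! #### Application to the letters and tilts: Theorem V3 -/

/-- Coefficients of a letter: `[X^j] q i = Σ_{l : d l = j} p l i`. -/
theorem letterPoly_coeff (d : Fin K → ℕ) (p : Fin K → Fin m → ℝ) (i : Fin m) (j : ℕ) :
    (letterPoly d p i).coeff j = ∑ l, if j = d l then p l i else 0 := by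
  simp only [letterPoly, finsetSum_coeff, coeff_C_mul_X_pow]

/-- Positive letters have nonnegative coefficients. -/
theorem letterPoly_coeffNonneg (d : Fin K → ℕ) (p : Fin K → Fin m → ℝ) (hp : ∀ l i, 0 < p l i) (i : Fin m) :
    CoeffNonneg (letterPoly d p i) := by
  intro j
  rw [letterPoly_coeff]
  exact Finset.sum_nonneg fun l _ => by split_ifs <;> [exact (hp l i).le; exact le_rfl]

/-- Coefficients of a tilt: `[X^j] r i = (j − e) · [X^j] q i` (no injectivity of `d` needed). -/
theorem tiltPoly_coeff (d : Fin K → ℕ) (e : ℕ) (p : Fin K → Fin m → ℝ) (i : Fin m) (j : ℕ) :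
    (tiltPoly d e p i).coeff j = ((j : ℝ) - e) * (letterPoly d p i).coeff j := by
  rw [letterPoly_coeff, Finset.mul_sum]
  simp only [tiltPoly, finsetSum_coeff, coeff_C_mul_X_pow]
  refine Finset.sum_congr rfl fun l _ => ?_
  split_ifs with h
  · rw [h]
  · rw [mul_zero]

/-- **Theorem V3 (end summands, every `m`).**  If the tilt `r i` vanishes at an end of the window `0 < a ≤ b`, the Vincent–Jacobi test polynomial of
the summand `r i · Π_{j ≠ i} (q j)²` on `(a,b)` has no sign variation (its coefficients are one-signed). -/
theorem summand_window_signVariations_eq_zero (d : Fin K → ℕ) (e : ℕ) (p : Fin K → Fin m → ℝ)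
    (hp : ∀ l i, 0 < p l i) (i : Fin m) {a b : ℝ} (ha : 0 < a) (hab : a ≤ b)
    (h : (tiltPoly d e p i).eval a = 0 ∨ (tiltPoly d e p i).eval b = 0) :
    (dtest ((tiltPoly d e p i * ∏ j ∈ Finset.univ.erase i, letterPoly d p j ^ 2).comp
        (C (b - a) * X + C a))).signVariations = 0 := by
  rw [mul_comp, dtest_mul]
  have hP : CoeffNonneg (dtest ((∏ j ∈ Finset.univ.erase i, letterPoly d p j ^ 2).comp (C (b - a) * X + C a))) :=
    coeffNonneg_dtest_window (CoeffNonneg.prod _ fun j _ => (letterPoly_coeffNonneg d p hp j).pow 2) ha.le hab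
  rcases h with h | h
  · exact signVariations_eq_zero_of_coeff_nonneg
      (CoeffNonneg.mul (fun k => dtest_window_coeff_nonneg_of_eval_left _ _ e (letterPoly_coeffNonneg d p hp i)
        (tiltPoly_coeff d e p i) ha hab h k) hP)
  · exact signVariations_eq_zero_of_coeff_nonpos
      (coeff_mul_nonpos_of_nonpos_of_nonneg (fun k => dtest_window_coeff_nonpos_of_eval_right _ _ e
        (letterPoly_coeffNonneg d p hp i) (tiltPoly_coeff d e p i) ha hab h k) hP)

/-- On a peak window, the summands of the letters ATTAINING the window ends pass the window test with no sign variation (every `m`). -/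
theorem summand_window_signVariations_eq_zero_of_isPeakWindow (d : Fin K → ℕ) (e : ℕ) (p : Fin K → Fin m → ℝ)
    (hp : ∀ l i, 0 < p l i) {a b : ℝ} (hw : IsPeakWindow d e p a b) (i : Fin m)
    (h : (tiltPoly d e p i).eval a = 0 ∨ (tiltPoly d e p i).eval b = 0) :
    (dtest ((tiltPoly d e p i * ∏ j ∈ Finset.univ.erase i, letterPoly d p j ^ 2).comp
        (C (b - a) * X + C a))).signVariations = 0 :=
  summand_window_signVariations_eq_zero d e p hp i hw.1 hw.2.1 h

/-- **Theorem V3 at `m = 2` (kernel): `SummandWindowLaw 2 K` for every `K`.**  With two letters each one attains an end of the peak window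
(or the window/tilts degenerate), so both summands are one-signed under the window test. -/
theorem summandWindowLaw_two (K : ℕ) : SummandWindowLaw 2 K := by
  intro d e p a b _hd hp hw i
  obtain ⟨ha, hab, hle, ⟨j, hj⟩, hge, ⟨j', hj'⟩⟩ := hw
  have main : (tiltPoly d e p i).eval a = 0 ∨ (tiltPoly d e p i).eval b = 0 := by
    by_cases hji : j = i
    · exact Or.inl (hji ▸ hj)
    by_cases hj'i : j' = i
    · exact Or.inr (hj'i ▸ hj')
    have hjj' : j' = j := by
      apply Fin.ext
      have h1 : j.val ≠ i.val := fun h => hji (Fin.ext h)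
      have h2 : j'.val ≠ i.val := fun h => hj'i (Fin.ext h)
      have := i.isLt; have := j.isLt; have := j'.isLt
      omega
    rw [hjj'] at hj'
    by_cases hne : ∃ l, d l ≠ e
    · -- the other tilt vanishes at both ends: the window is a point, and then `r i (a) = 0` as well
      have hab' : a = b := tiltPoly_root_unique d e p hp hne j ha (ha.trans_le hab) hj hj'
      refine Or.inl (le_antisymm (hle i) ?_)
      rw [hab']
      exact hge i
    · -- all exponents equal `e`: every tilt is the zero polynomial
      push Not at hne
      refine Or.inl ?_
      rw [tiltPoly_eval]
      exact Finset.sum_eq_zero fun l _ => by rw [hne l, sub_self, zero_mul, zero_mul]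
  rw [summand_window_signVariations_eq_zero d e p hp i ha hab main]
  exact Nat.zero_le _


/-! ### v1.8 — GAP WINDOWS (every `m`): all summands are one-signed; the gap-subdivided law `GapLocalizedDescartes3` (GLD(3,K)) and its
UNCONDITIONAL kernel edge to `CommCriticalBudget 3 K`

On a window `0 < a ≤ b` FREE OF INTERIOR PEAKS — every tilt is `≥ 0` at `a` (its peak at or before `a`) or `≤ 0` at `b` (its peak at or after
`b`) — EVERY summand `r_i ∏_{j≠i} q_j²` passes the Vincent–Jacobi window test with NO sign variation (`summand_window_signVariations_eq_zero'`,
every `m`, every `K`).  The signed-sum lemma below replaces the zero-sum lemma of v1.7: the weights `(j−e) q_j a^j` now have a SIGNED sum `r(a) ≥ 0`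
(resp. `r(b) ≤ 0`), and the scaled window kernel is nonnegative as well as monotone in `j`.  Consequently on each inter-peak GAP `(t_k*, t_{k+1}*)`
the window test is `(Σ_{peaks ≤ t_k*} A_i) − (Σ_{peaks ≥ t_{k+1}*} B_i)` with explicit coefficientwise-nonnegative `A_i`, `B_i`: the discrete
type principle of memo §13.3 holds GAP-WISE FOR EVERY `m` (memo §14).  The single peak window over-counts for `m ≥ 3` precisely because interior
summands are two-signed there (§13.2); a gap window has no interior summands.

`GapLocalizedDescartes3 K` (GLD(3,K)) is the located three-letter law (conjecture, no proof claimed): the two exact gap counts, plus one if the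
middle peak is itself a root of `S`, are within the kink budget `2·2·(K−1)+1`.  `commCriticalBudget_three_of_gapLocalizedDescartes3` is its kernel
edge to `CommCriticalBudget 3 K` (hence to COMM-L1(3,K) by `commOneLawSharp_of_commCriticalBudget`), unconditional (uses `peakLocalization_holds`).
EVIDENCE (exact rational arithmetic, instr/g10/gld33.py, gld33b.py, gld_mK.py, gld_gen.py; 2026-08-28): 0 violations in 13 325 three- and
four-letter designs on `d = (0,19,22), (0,5,22), (0,14,17), (0,1,3), (0,19,22,25)` with `e` in the top gap, including 1 719 near-extremal rational-peak
`(3,3)`/`(4,3)` designs around val-idea-crit-2's `¬LD(3,3)` family where the SINGLE-window count is 11–23 > budget in ≈ 30 % of designs: there the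
gap count attains the budget 9 (25×) and never exceeds it; the two `¬LD(3,3)` witnesses of record have gap counts 5+2 = 7 (5 roots) and 0+1 = 1;
the one-signedness of every summand on every gap was confirmed in all 13 325 designs (it is the theorem below).  Cheapest kill of GLD(3,K): one
positive three-letter design with gap counts summing to `> 4(K−1)+1`. -/

/-! #### Signed-sum lemma (replaces the zero-sum lemma when the peak lies outside the window) -/

/-- Centered form, antitone kernel: `Σ_j (j−e) v_j (κ_j − κ_{min e n}) ≤ 0` for `v ≥ 0` — no hypothesis on the weight sum. -/
theorem tiltSum_centered_nonpos_of_antitoneOn (n e : ℕ) (v κ : ℕ → ℝ) (hv : ∀ j, 0 ≤ v j)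
    (hκ : ∀ i j, i ≤ j → j ≤ n → κ j ≤ κ i) :
    ∑ j ∈ Finset.range (n + 1), ((j : ℝ) - e) * v j * (κ j - κ (min e n)) ≤ 0 := by
  refine Finset.sum_nonpos fun j hj => ?_
  have hjn : j ≤ n := Nat.lt_succ_iff.mp (Finset.mem_range.mp hj)
  rcases lt_trichotomy j e with hlt | heq | hgt
  · have hw : ((j : ℝ) - e) * v j ≤ 0 :=
      mul_nonpos_of_nonpos_of_nonneg (sub_nonpos.mpr (by exact_mod_cast hlt.le)) (hv j)
    have hk : 0 ≤ κ j - κ (min e n) := sub_nonneg.mpr (hκ j (min e n) (le_min hlt.le hjn) (min_le_right e n))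
    exact mul_nonpos_of_nonpos_of_nonneg hw hk
  · subst heq; simp
  · have hw : 0 ≤ ((j : ℝ) - e) * v j :=
      mul_nonneg (sub_nonneg.mpr (by exact_mod_cast hgt.le)) (hv j)
    have hmin : min e n = e := min_eq_left (hgt.le.trans hjn)
    have hk : κ j - κ (min e n) ≤ 0 := sub_nonpos.mpr (by rw [hmin]; exact hκ e j hgt.le hjn)
    exact mul_nonpos_of_nonneg_of_nonpos hw hk

/-- Centered form, monotone kernel: `0 ≤ Σ_j (j−e) v_j (κ_j − κ_{min e n})`. -/
theorem tiltSum_centered_nonneg_of_monotoneOn (n e : ℕ) (v κ : ℕ → ℝ) (hv : ∀ j, 0 ≤ v j)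
    (hκ : ∀ i j, i ≤ j → j ≤ n → κ i ≤ κ j) :
    0 ≤ ∑ j ∈ Finset.range (n + 1), ((j : ℝ) - e) * v j * (κ j - κ (min e n)) := by
  have h := tiltSum_centered_nonpos_of_antitoneOn n e v (fun j => - κ j) hv
    (fun i j hij hjn => neg_le_neg (hκ i j hij hjn))
  have : ∑ j ∈ Finset.range (n + 1), ((j : ℝ) - e) * v j * (-κ j - -κ (min e n)) =
      - ∑ j ∈ Finset.range (n + 1), ((j : ℝ) - e) * v j * (κ j - κ (min e n)) := by
    rw [← Finset.sum_neg_distrib]; refine Finset.sum_congr rfl fun j _ => by ring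
  rw [this] at h
  linarith

/-- **Signed-sum lemma (right end).** Weights `(j − e)·v_j` (`v ≥ 0`) with sum `≤ 0`, against a NONNEGATIVE kernel antitone on `[0,n]`, give a
sum `≤ 0`. -/
theorem tiltSum_nonpos_of_antitoneOn_of_sum_nonpos (n e : ℕ) (v κ : ℕ → ℝ) (hv : ∀ j, 0 ≤ v j)
    (hκ : ∀ i j, i ≤ j → j ≤ n → κ j ≤ κ i) (hκ0 : ∀ j, j ≤ n → 0 ≤ κ j)
    (h0 : ∑ j ∈ Finset.range (n + 1), ((j : ℝ) - e) * v j ≤ 0) :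
    ∑ j ∈ Finset.range (n + 1), ((j : ℝ) - e) * v j * κ j ≤ 0 := by
  have key : ∑ j ∈ Finset.range (n + 1), ((j : ℝ) - e) * v j * κ j =
      ∑ j ∈ Finset.range (n + 1), ((j : ℝ) - e) * v j * (κ j - κ (min e n)) +
        κ (min e n) * ∑ j ∈ Finset.range (n + 1), ((j : ℝ) - e) * v j := by
    rw [Finset.mul_sum, ← Finset.sum_add_distrib]
    refine Finset.sum_congr rfl fun j _ => by ring
  rw [key]
  have hA := tiltSum_centered_nonpos_of_antitoneOn n e v κ hv hκ
  have hB : κ (min e n) * ∑ j ∈ Finset.range (n + 1), ((j : ℝ) - e) * v j ≤ 0 :=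
    mul_nonpos_of_nonneg_of_nonpos (hκ0 _ (min_le_right e n)) h0
  linarith

/-- **Signed-sum lemma (left end).** Weights `(j − e)·v_j` (`v ≥ 0`) with sum `≥ 0`, against a NONNEGATIVE kernel monotone on `[0,n]`, give a
sum `≥ 0`. -/
theorem tiltSum_nonneg_of_monotoneOn_of_sum_nonneg (n e : ℕ) (v κ : ℕ → ℝ) (hv : ∀ j, 0 ≤ v j)
    (hκ : ∀ i j, i ≤ j → j ≤ n → κ i ≤ κ j) (hκ0 : ∀ j, j ≤ n → 0 ≤ κ j)
    (h0 : 0 ≤ ∑ j ∈ Finset.range (n + 1), ((j : ℝ) - e) * v j) :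
    0 ≤ ∑ j ∈ Finset.range (n + 1), ((j : ℝ) - e) * v j * κ j := by
  have key : ∑ j ∈ Finset.range (n + 1), ((j : ℝ) - e) * v j * κ j =
      ∑ j ∈ Finset.range (n + 1), ((j : ℝ) - e) * v j * (κ j - κ (min e n)) +
        κ (min e n) * ∑ j ∈ Finset.range (n + 1), ((j : ℝ) - e) * v j := by
    rw [Finset.mul_sum, ← Finset.sum_add_distrib]
    refine Finset.sum_congr rfl fun j _ => by ring
  rw [key]
  have hA := tiltSum_centered_nonneg_of_monotoneOn n e v κ hv hκ
  have hB : 0 ≤ κ (min e n) * ∑ j ∈ Finset.range (n + 1), ((j : ℝ) - e) * v j :=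
    mul_nonneg (hκ0 _ (min_le_right e n)) h0
  linarith

/-- The window test of a constant is the constant. -/
theorem dtest_C' (x : ℝ) : dtest (C x) = C x := by
  rw [dtest, reverse_C, taylor_C]

/-- **Right end, signed (peak at or after `b`).** If `r_j = (j − e) q_j` with `q ≥ 0` coefficientwise, `0 < a ≤ b` and `r(b) ≤ 0`, then the test
polynomial of `r` on the window `(a,b)` has all coefficients `≤ 0`. -/
theorem dtest_window_coeff_nonpos_of_eval_right_nonpos (q r : ℝ[X]) (e : ℕ)
    (hq : ∀ j, 0 ≤ q.coeff j) (hr : ∀ j, r.coeff j = ((j : ℝ) - e) * q.coeff j)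
    {a b : ℝ} (ha : 0 < a) (hab : a ≤ b) (hrb : r.eval b ≤ 0) (k : ℕ) :
    (dtest (r.comp (C (b - a) * X + C a))).coeff k ≤ 0 := by
  rcases hab.eq_or_lt with rfl | hlt
  · rw [sub_self, C_0, zero_mul, zero_add, comp_C, dtest_C', coeff_C]
    split_ifs
    · exact hrb
    · exact le_rfl
  have hc : b - a ≠ 0 := sub_ne_zero.mpr hlt.ne'
  have hb : 0 < b := ha.trans hlt
  set n := r.natDegree with hn
  rw [dtest_comp_linear_eq r hc a, add_sub_cancel, finsetSum_coeff]
  simp only [coeff_C_mul]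
  suffices h : b ^ n * ∑ j ∈ Finset.range (n + 1), r.coeff j * (wbasis a b n j).coeff k ≤ 0 by
    by_contra hcon
    push Not at hcon
    have := mul_pos (pow_pos hb n) hcon
    linarith
  have hexp : b ^ n * ∑ j ∈ Finset.range (n + 1), r.coeff j * (wbasis a b n j).coeff k =
      ∑ j ∈ Finset.range (n + 1), ((j : ℝ) - e) * (q.coeff j * b ^ j) * (C (b ^ (n - j)) * wbasis a b n j).coeff k := by
    rw [Finset.mul_sum]
    refine Finset.sum_congr rfl fun j hj => ?_
    have hjn : j ≤ n := Nat.lt_succ_iff.mp (Finset.mem_range.mp hj)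
    rw [coeff_C_mul, hr j, ← pow_mul_pow_sub b hjn]
    ring
  rw [hexp]
  refine tiltSum_nonpos_of_antitoneOn_of_sum_nonpos n e (fun j => q.coeff j * b ^ j)
    (fun j => (C (b ^ (n - j)) * wbasis a b n j).coeff k) ?_ ?_ ?_ ?_
  · exact fun j => mul_nonneg (hq j) (pow_nonneg hb.le j)
  · exact antitoneOn_of_step _ n fun j hj => wbasis_right_step ha.le hab hj k
  · exact fun j _ => ((coeffNonneg_C (pow_nonneg hb.le _)).mul (coeffNonneg_wbasis ha.le hb.le n j)) k
  · have : ∑ j ∈ Finset.range (n + 1), ((j : ℝ) - e) * (q.coeff j * b ^ j) = r.eval b := by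
      rw [eval_eq_sum_range' (Nat.lt_succ_of_le le_rfl)]
      refine Finset.sum_congr rfl fun j _ => by rw [hr j]; ring
    rw [this]; exact hrb

/-- **Left end, signed (peak at or before `a`).** If `r_j = (j − e) q_j` with `q ≥ 0` coefficientwise, `0 < a ≤ b` and `0 ≤ r(a)`, then the test
polynomial of `r` on the window `(a,b)` has all coefficients `≥ 0`. -/
theorem dtest_window_coeff_nonneg_of_eval_left_nonneg (q r : ℝ[X]) (e : ℕ)
    (hq : ∀ j, 0 ≤ q.coeff j) (hr : ∀ j, r.coeff j = ((j : ℝ) - e) * q.coeff j)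
    {a b : ℝ} (ha : 0 < a) (hab : a ≤ b) (hra : 0 ≤ r.eval a) (k : ℕ) :
    0 ≤ (dtest (r.comp (C (b - a) * X + C a))).coeff k := by
  rcases hab.eq_or_lt with rfl | hlt
  · rw [sub_self, C_0, zero_mul, zero_add, comp_C, dtest_C', coeff_C]
    split_ifs
    · exact hra
    · exact le_rfl
  have hc : b - a ≠ 0 := sub_ne_zero.mpr hlt.ne'
  have hb : 0 ≤ b := ha.le.trans hab
  set n := r.natDegree with hn
  rw [dtest_comp_linear_eq r hc a, add_sub_cancel, finsetSum_coeff]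
  simp only [coeff_C_mul]
  suffices h : 0 ≤ a ^ n * ∑ j ∈ Finset.range (n + 1), r.coeff j * (wbasis a b n j).coeff k by
    by_contra hcon
    push Not at hcon
    have := mul_neg_of_pos_of_neg (pow_pos ha n) hcon
    linarith
  have hexp : a ^ n * ∑ j ∈ Finset.range (n + 1), r.coeff j * (wbasis a b n j).coeff k =
      ∑ j ∈ Finset.range (n + 1), ((j : ℝ) - e) * (q.coeff j * a ^ j) * (C (a ^ (n - j)) * wbasis a b n j).coeff k := by
    rw [Finset.mul_sum]
    refine Finset.sum_congr rfl fun j hj => ?_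
    have hjn : j ≤ n := Nat.lt_succ_iff.mp (Finset.mem_range.mp hj)
    rw [coeff_C_mul, hr j, ← pow_mul_pow_sub a hjn]
    ring
  rw [hexp]
  refine tiltSum_nonneg_of_monotoneOn_of_sum_nonneg n e (fun j => q.coeff j * a ^ j)
    (fun j => (C (a ^ (n - j)) * wbasis a b n j).coeff k) ?_ ?_ ?_ ?_
  · exact fun j => mul_nonneg (hq j) (pow_nonneg ha.le j)
  · have hstep := antitoneOn_of_step (fun j => - (C (a ^ (n - j)) * wbasis a b n j).coeff k) n
      (fun j hj => neg_le_neg (wbasis_left_step ha.le hab hj k))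
    intro i j hij hjn
    simpa using hstep i j hij hjn
  · exact fun j _ => ((coeffNonneg_C (pow_nonneg ha.le _)).mul (coeffNonneg_wbasis ha.le hb n j)) k
  · have : ∑ j ∈ Finset.range (n + 1), ((j : ℝ) - e) * (q.coeff j * a ^ j) = r.eval a := by
      rw [eval_eq_sum_range' (Nat.lt_succ_of_le le_rfl)]
      refine Finset.sum_congr rfl fun j _ => by rw [hr j]; ring
    rw [this]; exact hra

/-! #### Every summand is one-signed on a window free of interior peaks -/

/-- **Gap summands (every `m`, every `K`).**  On a window `0 < a ≤ b`, the summand of a letter whose tilt is `≥ 0` at `a` (peak at or before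
`a`) or `≤ 0` at `b` (peak at or after `b`) passes the window test with NO sign variation. -/
theorem summand_window_signVariations_eq_zero' (d : Fin K → ℕ) (e : ℕ) (p : Fin K → Fin m → ℝ)
    (hp : ∀ l i, 0 < p l i) (i : Fin m) {a b : ℝ} (ha : 0 < a) (hab : a ≤ b)
    (h : 0 ≤ (tiltPoly d e p i).eval a ∨ (tiltPoly d e p i).eval b ≤ 0) :
    (dtest ((tiltPoly d e p i * ∏ j ∈ Finset.univ.erase i, letterPoly d p j ^ 2).comp
        (C (b - a) * X + C a))).signVariations = 0 := by
  rw [mul_comp, dtest_mul]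
  have hP : CoeffNonneg (dtest ((∏ j ∈ Finset.univ.erase i, letterPoly d p j ^ 2).comp (C (b - a) * X + C a))) :=
    coeffNonneg_dtest_window (CoeffNonneg.prod _ fun j _ => (letterPoly_coeffNonneg d p hp j).pow 2) ha.le hab
  rcases h with h | h
  · exact signVariations_eq_zero_of_coeff_nonneg
      (CoeffNonneg.mul (fun k => dtest_window_coeff_nonneg_of_eval_left_nonneg _ _ e (letterPoly_coeffNonneg d p hp i)
        (tiltPoly_coeff d e p i) ha hab h k) hP)
  · exact signVariations_eq_zero_of_coeff_nonpos
      (coeff_mul_nonpos_of_nonpos_of_nonneg (fun k => dtest_window_coeff_nonpos_of_eval_right_nonpos _ _ e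
        (letterPoly_coeffNonneg d p hp i) (tiltPoly_coeff d e p i) ha hab h k) hP)

/-- The same in peak language: if letter `i` has its peak `τ` (the positive root of its tilt) at or before `a`, or at or after `b`, its summand
is one-signed under the window test on `(a,b)`. -/
theorem summand_window_signVariations_eq_zero_of_peak_outside (d : Fin K → ℕ) (e : ℕ) (p : Fin K → Fin m → ℝ)
    (hp : ∀ l i, 0 < p l i) (i : Fin m) {a b τ : ℝ} (ha : 0 < a) (hab : a ≤ b) (hτ : 0 < τ)
    (hr : (tiltPoly d e p i).eval τ = 0) (h : τ ≤ a ∨ b ≤ τ) :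
    (dtest ((tiltPoly d e p i * ∏ j ∈ Finset.univ.erase i, letterPoly d p j ^ 2).comp
        (C (b - a) * X + C a))).signVariations = 0 := by
  refine summand_window_signVariations_eq_zero' d e p hp i ha hab ?_
  rcases h with h | h
  · exact Or.inl (tiltPoly_eval_nonneg_of_le d e p hp i hτ h hr.ge)
  · exact Or.inr (tiltPoly_eval_nonpos_of_le d e p hp i (ha.trans_le hab) h hr.le)

/-! #### GLD(3,K): the gap-subdivided localized Descartes law for three letters, and its kernel edge to CKB(3,K) -/

/-- A PEAK CHAIN of a three-letter design: `0 < τ₁ ≤ τ₂ ≤ τ₃`, every tilt vanishes at one of `τ₁, τ₂, τ₃`, and each `τ_k` is a root of some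
tilt (for a non-degenerate design: the three peaks in increasing order). -/
def IsPeakChain3 (d : Fin K → ℕ) (e : ℕ) (p : Fin K → Fin 3 → ℝ) (τ₁ τ₂ τ₃ : ℝ) : Prop :=
  0 < τ₁ ∧ τ₁ ≤ τ₂ ∧ τ₂ ≤ τ₃ ∧
    (∀ i, (tiltPoly d e p i).eval τ₁ = 0 ∨ (tiltPoly d e p i).eval τ₂ = 0 ∨ (tiltPoly d e p i).eval τ₃ = 0) ∧
    (∃ i, (tiltPoly d e p i).eval τ₁ = 0) ∧ (∃ i, (tiltPoly d e p i).eval τ₂ = 0) ∧ (∃ i, (tiltPoly d e p i).eval τ₃ = 0)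

/-- **GLD(3,K) — the gap-subdivided localized Descartes law for three letters** (memo `negsquares-kink.md` §14; LOCATED CONJECTURE, no proof
claimed).  For positive three-letter designs on `K` strictly increasing exponents and a peak chain `τ₁ ≤ τ₂ ≤ τ₃`, the Vincent–Jacobi counts on
the two GAP windows `(τ₁,τ₂)`, `(τ₂,τ₃)`, plus one if the middle peak is itself a root of the critical polynomial, total at most the kink budget
`2·(3−1)·(K−1)+1 = 4(K−1)+1`.  On each gap every summand is one-signed (`summand_window_signVariations_eq_zero_of_peak_outside`), so each gap
count is the number of level-one crossings of a ratio of two explicit nonnegative coefficient sequences.  It replaced the single-window law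
`LocalizedDescartes 3 K`, which is FALSE at `K = 3` (count 11 > 9); on both refuting designs the gap counts total 7 and 1.  v1.8 evidence: 13 325
exact designs, 0 violations, budget attained (near-extremal / close-peak regime).  **STATUS (v2.2, gen 11) — `GapLocalizedDescartes3 3` is FALSE
as typed; the law is WITHDRAWN (director-valiant R284 (4)).**  Witness (val-idea-crit-2 #45, found in 524 evaluations of a broad moderate-amplitude
walk; reproduced exactly by val-idea-crit-1 #94c): `d = (0,19,22)`, `e = 20`, `q_i = a_i + b_i t¹⁹ + c_i t²²` with letter 1
`(a,b,c) = (2⁻¹¹⁶, 1/20000 − 20²⁰/2¹¹⁶, 1/5)` (peak `1/20`), letter 2 `(3/5000, 1, (3/250 + 2⁵⁷)/2⁶⁷)` (peak `8`), letter 3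
`(1/64, 3, (5/16 + 3·2¹¹⁴)/2¹³³)` (peak `64`); all nine coefficients positive, `IsPeakChain3 … (1/20) 8 64` literal,
`(windowTest … (1/20) 8).signVariations = 8`, `(windowTest … 8 64).signVariations = 3`, `S(8) ≠ 0`: total `11 > 9 = 4(K−1)+1`, with only FIVE roots of
`S` in the gaps (`deg S = 110`, global `V = 15`; CKB(3,3)'s «≤ 9» untouched — the excess is pure Vincent–Jacobi over-count on the wide first gap, whose
three summands ARE one-signed).  A second, independent kill (#45b): peaks `433/16384 < 139/32 < 185/4` on the same pattern, gap counts `9 + 2 = 11` with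
`7` roots.  The v1.8 census did not visit wide chains with a light far-left letter.  The kernel edge `commCriticalBudget_three_of_gapLocalizedDescartes3`
is an implication whose antecedent is false at `K = 3`: it carries nothing there.  The definition is kept as negative knowledge. [val-idea-6 g10 v1.8
located / g11 v2.2: REFUTED at K = 3, withdrawn] -/
def GapLocalizedDescartes3 (K : ℕ) : Prop :=
  ∀ (d : Fin K → ℕ) (e : ℕ) (p : Fin K → Fin 3 → ℝ) (τ₁ τ₂ τ₃ : ℝ), StrictMono d → (∀ l i, 0 < p l i) →
    IsPeakChain3 d e p τ₁ τ₂ τ₃ →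
      (windowTest d e p τ₁ τ₂).signVariations + (windowTest d e p τ₂ τ₃).signVariations +
        (if (critPoly d e p).eval τ₂ = 0 then 1 else 0) ≤ 2 * (3 - 1) * (K - 1) + 1

/-- Window count bounds the number of distinct roots inside the (possibly empty) open window. -/
theorem card_rootsIn_le_signVariations_windowTest (d : Fin K → ℕ) (e : ℕ) (p : Fin K → Fin m → ℝ) {a b : ℝ}
    (hab : a ≤ b) :
    ((critPoly d e p).roots.toFinset.filter (fun x => a < x ∧ x < b)).card ≤ (windowTest d e p a b).signVariations := by
  classical
  rcases hab.eq_or_lt with rfl | hlt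
  · rw [Finset.card_eq_zero.mpr (Finset.filter_eq_empty_iff.mpr fun x _ h => (lt_irrefl a (h.1.trans h.2)).elim)]
    exact Nat.zero_le _
  obtain ⟨j, hj⟩ := (isVcaNode_comp (critPoly d e p) a b).signVariations_dtest hlt
  have h1 : ((critPoly d e p).roots.toFinset.filter (fun x => a < x ∧ x < b)).card ≤
      (critPoly d e p).roots.countP (fun x => a < x ∧ x < b) := by
    rw [Multiset.countP_eq_card_filter, ← Multiset.toFinset_filter]
    exact Multiset.toFinset_card_le _
  have h2 : (windowTest d e p a b).signVariations = (critPoly d e p).roots.countP (fun x => a < x ∧ x < b) + 2 * j := hj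
  omega

/-- **GLD(3,K) ⇒ CKB(3,K) (kernel, unconditional).**  Peak localisation (`peakLocalization_holds`) puts every positive root of `S` in the peak
window `(τ₁,τ₃)`; the middle peak `τ₂` (a root of the remaining tilt in `[τ₁,τ₃]`, by the intermediate value theorem) splits it into the two gaps,
and each gap count dominates the number of roots inside (`card_rootsIn_le_signVariations_windowTest`). -/
theorem commCriticalBudget_three_of_gapLocalizedDescartes3 (hG : GapLocalizedDescartes3 K) : CommCriticalBudget 3 K := by
  classical
  intro d e p hd hp
  by_cases hex : ∃ t, 0 < t ∧ (critPoly d e p).IsRoot t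
  swap
  · have h0 : posRoots (critPoly d e p) = 0 := by
      unfold posRoots
      rw [Finset.card_eq_zero, Finset.filter_eq_empty_iff]
      intro t ht h0
      exact hex ⟨t, h0, (mem_roots'.mp (Multiset.mem_toFinset.mp ht)).2⟩
    rw [h0]
    exact Nat.zero_le _
  rcases peakLocalization_holds d e p hd hp hex with h1 | ⟨a, b, hab, hwin, hroots⟩
  · exact h1.trans (Nat.le_add_left 1 _)
  obtain ⟨ha, _, hle, ⟨i₁, hi₁⟩, hge, ⟨i₃, hi₃⟩⟩ := hwin
  have hb : 0 < b := ha.trans hab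
  -- degenerate exponents: every tilt is the zero polynomial, so `S = 0`
  by_cases hne : ∃ l, d l ≠ e
  swap
  · push Not at hne
    have hS : critPoly d e p = 0 := by
      have ht : ∀ i, tiltPoly d e p i = 0 := by
        intro i
        unfold tiltPoly
        exact Finset.sum_eq_zero fun l _ => by simp [hne l]
      unfold critPoly
      exact Finset.sum_eq_zero fun i _ => by rw [ht i, zero_mul]
    simp [posRoots, hS]
  -- the letters attaining the two ends are distinct; the remaining letter peaks in between
  have h13 : i₁ ≠ i₃ := by
    rintro rfl
    exact absurd (tiltPoly_root_unique d e p hp hne i₁ ha hb hi₁ hi₃) hab.ne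
  have key3 : ∀ j₁ j₃ : Fin 3, ∃ j₂ : Fin 3, j₂ ≠ j₁ ∧ j₂ ≠ j₃ := by decide
  obtain ⟨i₂, h21, h23⟩ := key3 i₁ i₃
  have cover3 : ∀ j₁ j₂ j₃ : Fin 3, j₁ ≠ j₃ → j₂ ≠ j₁ → j₂ ≠ j₃ → ∀ i : Fin 3, i = j₁ ∨ i = j₂ ∨ i = j₃ := by decide
  have hcover := cover3 i₁ i₂ i₃ h13 h21 h23
  have hcont : ContinuousOn (fun x => (tiltPoly d e p i₂).eval x) (Set.Icc a b) :=
    (tiltPoly d e p i₂).continuous.continuousOn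
  obtain ⟨τ, hτ, hτ0⟩ := intermediate_value_Icc hab.le hcont ⟨hle i₂, hge i₂⟩
  have hchain : IsPeakChain3 d e p a τ b := by
    refine ⟨ha, hτ.1, hτ.2, fun i => ?_, ⟨i₁, hi₁⟩, ⟨i₂, hτ0⟩, ⟨i₃, hi₃⟩⟩
    rcases hcover i with rfl | rfl | rfl
    · exact Or.inl hi₁
    · exact Or.inr (Or.inl hτ0)
    · exact Or.inr (Or.inr hi₃)
  have hbound := hG d e p a τ b hd hp hchain
  -- split the positive roots at `τ`
  have hsplit : posRoots (critPoly d e p) ≤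
      ((critPoly d e p).roots.toFinset.filter (fun x => a < x ∧ x < τ)).card +
      ((critPoly d e p).roots.toFinset.filter (fun x => τ < x ∧ x < b)).card +
      ((critPoly d e p).roots.toFinset.filter (fun x => x = τ)).card := by
    unfold posRoots
    calc ((critPoly d e p).roots.toFinset.filter (fun t => 0 < t)).card
        ≤ (((critPoly d e p).roots.toFinset.filter (fun x => a < x ∧ x < τ)) ∪
            ((critPoly d e p).roots.toFinset.filter (fun x => τ < x ∧ x < b)) ∪
            ((critPoly d e p).roots.toFinset.filter (fun x => x = τ))).card := by
          apply Finset.card_le_card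
          intro t ht
          rw [Finset.mem_filter] at ht
          have hr := (mem_roots'.mp (Multiset.mem_toFinset.mp ht.1)).2
          have hab' := hroots t ht.2 hr
          simp only [Finset.mem_union, Finset.mem_filter]
          rcases lt_trichotomy t τ with h | h | h
          · exact Or.inl (Or.inl ⟨ht.1, hab'.1, h⟩)
          · exact Or.inr ⟨ht.1, h⟩
          · exact Or.inl (Or.inr ⟨ht.1, h, hab'.2⟩)
      _ ≤ _ := (Finset.card_union_le _ _).trans (Nat.add_le_add_right (Finset.card_union_le _ _) _)
  have hA := card_rootsIn_le_signVariations_windowTest d e p hτ.1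
  have hB := card_rootsIn_le_signVariations_windowTest d e p hτ.2
  have hC : ((critPoly d e p).roots.toFinset.filter (fun x => x = τ)).card ≤
      (if (critPoly d e p).eval τ = 0 then 1 else 0) := by
    split_ifs with hev
    · calc ((critPoly d e p).roots.toFinset.filter (fun x => x = τ)).card ≤ ({τ} : Finset ℝ).card :=
            Finset.card_le_card fun x hx => by
              rw [Finset.mem_filter] at hx
              rw [Finset.mem_singleton]; exact hx.2
        _ = 1 := Finset.card_singleton τ
    · rw [Finset.card_eq_zero.mpr (Finset.filter_eq_empty_iff.mpr fun x hx h => ?_)]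
      subst h
      exact hev (mem_roots'.mp (Multiset.mem_toFinset.mp hx)).2
  omega

/-- GLD(3,K) alone carries COMM-L1(3,K) in kernel (`K ≥ 1`). -/
theorem commOneLawSharp_three_of_gapLocalizedDescartes3 (hK : 0 < K) (hG : GapLocalizedDescartes3 K) :
    CommOneLawSharp 3 K :=
  commOneLawSharp_of_commCriticalBudget hK (commCriticalBudget_three_of_gapLocalizedDescartes3 hG)
/-! #### GLD(m,K) for every `m` (v1.9): peak chains of `n+1` letters, the gap-subdivided law, and its unconditional kernel edge to CKB

The general statement behind `GapLocalizedDescartes3`: for `n+1` letters with peak chain `τ 0 ≤ … ≤ τ n`, the exact Vincent–Jacobi counts on the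
`n` gap windows `(τ k, τ (k+1))`, plus the number of INTERIOR chain points that are roots of `S`, total at most the kink budget `2·n·(K−1)+1`.  On every
gap every summand is one-signed (`summand_window_signVariations_eq_zero_of_peak_outside`), so each gap count is a level-crossing count of two explicit
nonnegative coefficient sequences, the budget being SHARED along the chain (tropical Theorem A).  `commCriticalBudget_of_gapLocalizedDescartes` is the
unconditional edge `GapLocalizedDescartes n K → CommCriticalBudget (n+1) K` (peak localisation; tilt roots in the peak window by IVT, sorted into a chain
with `Tuple.sort`; positive roots split along the chain).  LOCATED (no proof claimed); evidence as for GLD(3,K) plus the four-letter censuses of memo §14.4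
(`(4,3)`: 55 near-extremal designs, single window ≤ 23 > 13 = budget in 20/55, gap total ≤ 11). -/

/-- A PEAK CHAIN of an `(n+1)`-letter design: a monotone tuple of positive reals such that every tilt vanishes at some chain point and every chain point
is a root of some tilt (non-degenerate designs: the sorted peaks). -/
def IsPeakChain {n : ℕ} (d : Fin K → ℕ) (e : ℕ) (p : Fin K → Fin (n + 1) → ℝ) (τ : Fin (n + 1) → ℝ) : Prop :=
  Monotone τ ∧ 0 < τ 0 ∧ (∀ i, ∃ k, (tiltPoly d e p i).eval (τ k) = 0) ∧ (∀ k, ∃ i, (tiltPoly d e p i).eval (τ k) = 0)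

/-- **GLD(n+1,K) — the gap-subdivided localized Descartes law for `n+1` letters** (memo `negsquares-kink.md` §14; LOCATED CONJECTURE, no proof claimed):
the `n` exact gap counts plus the number of interior chain points that are roots of the critical polynomial total at most `2·n·(K−1)+1`.
`GapLocalizedDescartes 2 K` is `GapLocalizedDescartes3 K` up to reindexing.  Kernel edge: `commCriticalBudget_of_gapLocalizedDescartes`.
Cheapest kill: one positive design whose gap counts (+ interior chain roots) exceed the budget.  **STATUS (v2.2, gen 11) — FALSE at
`(n,K) = (2,3)` and `(1,4)`: both val-idea-crit-2 #45 witnesses (see `GapLocalizedDescartes3`, `LocalizedDescartes`) hit this definition verbatim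
(`11 > 9` with a strictly increasing chain `1/20 < 8 < 64`; `9 > 7` on the single gap `[1/5, 100]`); WITHDRAWN as a law (R284 (4)), kept as negative
knowledge; the kernel edge is an implication with a false antecedent in those cells.** [val-idea-6 g10 v1.9 located / g11 v2.2: refuted at (2,3), (1,4)] -/
def GapLocalizedDescartes (n K : ℕ) : Prop :=
  ∀ (d : Fin K → ℕ) (e : ℕ) (p : Fin K → Fin (n + 1) → ℝ) (τ : Fin (n + 1) → ℝ), StrictMono d → (∀ l i, 0 < p l i) →
    IsPeakChain d e p τ →
      ∑ k : Fin n, (windowTest d e p (τ k.castSucc) (τ k.succ)).signVariations +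
        ((Finset.univ : Finset (Fin (n + 1))).filter
            (fun k => 0 < k.val ∧ k.val < n ∧ (critPoly d e p).eval (τ k) = 0)).card ≤ 2 * n * (K - 1) + 1

/-- Order lemma: a point strictly between the ends of a chain lies in one of its open gaps or IS an interior chain point (no monotonicity needed:
take the last chain point below `t`). -/
theorem exists_gap_or_node {n : ℕ} (τ : Fin (n + 1) → ℝ) {t : ℝ} (h0 : τ 0 < t)
    (h1 : t < τ (Fin.last n)) :
    (∃ k : Fin n, τ k.castSucc < t ∧ t < τ k.succ) ∨ (∃ k : Fin (n + 1), 0 < k.val ∧ k.val < n ∧ t = τ k) := by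
  classical
  have hne : (Finset.univ.filter (fun k : Fin (n + 1) => τ k < t)).Nonempty := ⟨0, by simp [h0]⟩
  obtain ⟨k₀, hk₀mem, hk₀max⟩ := Finset.exists_max_image (Finset.univ.filter (fun k : Fin (n + 1) => τ k < t)) (fun k => k.val) hne
  have hk₀t : τ k₀ < t := by simpa using hk₀mem
  have hk₀n : k₀.val < n := by
    by_contra hcon
    push Not at hcon
    have : k₀ = Fin.last n := Fin.ext (le_antisymm (Nat.lt_succ_iff.mp k₀.isLt) hcon)
    rw [this] at hk₀t
    linarith
  have hk₁ge : t ≤ τ ⟨k₀.val + 1, by omega⟩ := by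
    by_contra hcon
    push Not at hcon
    have := hk₀max ⟨k₀.val + 1, by omega⟩ (by simpa using hcon)
    simp at this
  rcases hk₁ge.lt_or_eq with hlt | heq
  · left
    refine ⟨⟨k₀.val, hk₀n⟩, ?_, ?_⟩
    · have : (⟨k₀.val, hk₀n⟩ : Fin n).castSucc = k₀ := Fin.ext rfl
      rw [this]; exact hk₀t
    · have : (⟨k₀.val, hk₀n⟩ : Fin n).succ = ⟨k₀.val + 1, by omega⟩ := Fin.ext rfl
      rw [this]; exact hlt
  · right
    refine ⟨⟨k₀.val + 1, by omega⟩, Nat.succ_pos _, ?_, heq⟩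
    show k₀.val + 1 < n
    by_contra hcon
    push Not at hcon
    have : (⟨k₀.val + 1, by omega⟩ : Fin (n + 1)) = Fin.last n := Fin.ext (by simp; omega)
    rw [this] at heq
    linarith

/-- Root splitting along a chain: the distinct positive roots of `f`, all strictly between the chain ends, are at most the gap-wise counts of roots
plus the number of interior chain points that are roots. -/
theorem posRoots_le_gapSum (f : ℝ[X]) {n : ℕ} (τ : Fin (n + 1) → ℝ)
    (hroots : ∀ t, 0 < t → f.IsRoot t → τ 0 < t ∧ t < τ (Fin.last n)) :
    posRoots f ≤ ∑ k : Fin n, (f.roots.toFinset.filter (fun x => τ k.castSucc < x ∧ x < τ k.succ)).card +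
      ((Finset.univ : Finset (Fin (n + 1))).filter (fun k => 0 < k.val ∧ k.val < n ∧ f.eval (τ k) = 0)).card := by
  classical
  have hcover : f.roots.toFinset.filter (fun t => 0 < t) ⊆
      (Finset.univ.biUnion fun k : Fin n => f.roots.toFinset.filter (fun x => τ k.castSucc < x ∧ x < τ k.succ)) ∪
        (((Finset.univ : Finset (Fin (n + 1))).filter (fun k => 0 < k.val ∧ k.val < n ∧ f.eval (τ k) = 0)).image τ) := by
    intro t ht
    rw [Finset.mem_filter] at ht
    have hr := (mem_roots'.mp (Multiset.mem_toFinset.mp ht.1)).2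
    have hb := hroots t ht.2 hr
    rcases exists_gap_or_node τ hb.1 hb.2 with ⟨k, hk1, hk2⟩ | ⟨k, hk0, hkn, hkt⟩
    · exact Finset.mem_union_left _ (Finset.mem_biUnion.mpr ⟨k, Finset.mem_univ _, Finset.mem_filter.mpr ⟨ht.1, hk1, hk2⟩⟩)
    · refine Finset.mem_union_right _ (Finset.mem_image.mpr ⟨k, Finset.mem_filter.mpr ⟨Finset.mem_univ _, hk0, hkn, ?_⟩, hkt.symm⟩)
      rw [← hkt]; exact hr
  unfold posRoots
  calc (f.roots.toFinset.filter (fun t => 0 < t)).card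
      ≤ ((Finset.univ.biUnion fun k : Fin n => f.roots.toFinset.filter (fun x => τ k.castSucc < x ∧ x < τ k.succ)) ∪
          (((Finset.univ : Finset (Fin (n + 1))).filter (fun k => 0 < k.val ∧ k.val < n ∧ f.eval (τ k) = 0)).image τ)).card :=
        Finset.card_le_card hcover
    _ ≤ (Finset.univ.biUnion fun k : Fin n => f.roots.toFinset.filter (fun x => τ k.castSucc < x ∧ x < τ k.succ)).card +
          (((Finset.univ : Finset (Fin (n + 1))).filter (fun k => 0 < k.val ∧ k.val < n ∧ f.eval (τ k) = 0)).image τ).card :=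
        Finset.card_union_le _ _
    _ ≤ _ := Nat.add_le_add Finset.card_biUnion_le Finset.card_image_le

/-- **GLD(n+1,K) ⇒ CKB(n+1,K) (kernel, unconditional, every number of letters).**  Peak localisation puts every positive root of `S` inside the peak
window; each tilt has a root there (IVT), the roots sorted by `Tuple.sort` form a peak chain from `a` to `b` (root uniqueness pins the ends); the
positive roots split along the chain (`posRoots_le_gapSum`) and each gap part is dominated by its window count. -/
theorem commCriticalBudget_of_gapLocalizedDescartes {n : ℕ} (hG : GapLocalizedDescartes n K) :
    CommCriticalBudget (n + 1) K := by
  classical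
  intro d e p hd hp
  simp only [Nat.add_sub_cancel]
  by_cases hex : ∃ t, 0 < t ∧ (critPoly d e p).IsRoot t
  swap
  · have h0 : posRoots (critPoly d e p) = 0 := by
      unfold posRoots
      rw [Finset.card_eq_zero, Finset.filter_eq_empty_iff]
      intro t ht h0
      exact hex ⟨t, h0, (mem_roots'.mp (Multiset.mem_toFinset.mp ht)).2⟩
    rw [h0]
    exact Nat.zero_le _
  rcases peakLocalization_holds d e p hd hp hex with h1 | ⟨a, b, hab, hwin, hroots⟩
  · exact h1.trans (Nat.le_add_left 1 _)
  obtain ⟨ha, _, hle, ⟨i₁, hi₁⟩, hge, ⟨i₃, hi₃⟩⟩ := hwin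
  have hb : 0 < b := ha.trans hab
  by_cases hne : ∃ l, d l ≠ e
  swap
  · push Not at hne
    have hS : critPoly d e p = 0 := by
      have ht : ∀ i, tiltPoly d e p i = 0 := by
        intro i
        unfold tiltPoly
        exact Finset.sum_eq_zero fun l _ => by simp [hne l]
      unfold critPoly
      exact Finset.sum_eq_zero fun i _ => by rw [ht i, zero_mul]
    simp [posRoots, hS]
  -- tilt roots in `[a,b]`, sorted into a chain
  have hex_root : ∀ i, ∃ ρ, ρ ∈ Set.Icc a b ∧ (tiltPoly d e p i).eval ρ = 0 := fun i =>
    intermediate_value_Icc hab.le (tiltPoly d e p i).continuous.continuousOn ⟨hle i, hge i⟩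
  choose ρ hρI hρ0 using hex_root
  have hτ : Monotone (ρ ∘ ⇑(Tuple.sort ρ)) := Tuple.monotone_sort ρ
  have hτρ : ∀ i, (ρ ∘ ⇑(Tuple.sort ρ)) ((Tuple.sort ρ).symm i) = ρ i := fun i => by simp
  have hρa : ρ i₁ = a := tiltPoly_root_unique d e p hp hne i₁ (ha.trans_le (hρI i₁).1) ha (hρ0 i₁) hi₁
  have hρb : ρ i₃ = b := tiltPoly_root_unique d e p hp hne i₃ (ha.trans_le (hρI i₃).1) hb (hρ0 i₃) hi₃
  have hτ0 : (ρ ∘ ⇑(Tuple.sort ρ)) 0 = a := by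
    apply le_antisymm
    · calc (ρ ∘ ⇑(Tuple.sort ρ)) 0 ≤ (ρ ∘ ⇑(Tuple.sort ρ)) ((Tuple.sort ρ).symm i₁) := hτ (Fin.zero_le _)
        _ = a := by rw [hτρ, hρa]
    · exact (hρI _).1
  have hτn : (ρ ∘ ⇑(Tuple.sort ρ)) (Fin.last n) = b := by
    apply le_antisymm
    · exact (hρI _).2
    · calc b = (ρ ∘ ⇑(Tuple.sort ρ)) ((Tuple.sort ρ).symm i₃) := by rw [hτρ, hρb]
        _ ≤ (ρ ∘ ⇑(Tuple.sort ρ)) (Fin.last n) := hτ (Fin.le_last _)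
  have hchain : IsPeakChain d e p (ρ ∘ ⇑(Tuple.sort ρ)) :=
    ⟨hτ, by rw [hτ0]; exact ha, fun i => ⟨(Tuple.sort ρ).symm i, by rw [hτρ]; exact hρ0 i⟩, fun k => ⟨Tuple.sort ρ k, hρ0 _⟩⟩
  have hbound := hG d e p _ hd hp hchain
  have hroots' : ∀ t, 0 < t → (critPoly d e p).IsRoot t →
      (ρ ∘ ⇑(Tuple.sort ρ)) 0 < t ∧ t < (ρ ∘ ⇑(Tuple.sort ρ)) (Fin.last n) := by
    intro t ht hr
    rw [hτ0, hτn]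
    exact hroots t ht hr
  have hsplit := posRoots_le_gapSum (critPoly d e p) _ hroots'
  have hgaps : ∑ k : Fin n, ((critPoly d e p).roots.toFinset.filter
      (fun x => (ρ ∘ ⇑(Tuple.sort ρ)) k.castSucc < x ∧ x < (ρ ∘ ⇑(Tuple.sort ρ)) k.succ)).card ≤
      ∑ k : Fin n, (windowTest d e p ((ρ ∘ ⇑(Tuple.sort ρ)) k.castSucc) ((ρ ∘ ⇑(Tuple.sort ρ)) k.succ)).signVariations :=
    Finset.sum_le_sum fun k _ => card_rootsIn_le_signVariations_windowTest d e p (hτ (show k.castSucc < k.succ from Fin.castSucc_lt_succ).le)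
  omega

/-- GLD(n+1,K) alone carries COMM-L1(n+1,K) in kernel (`K ≥ 1`). -/
theorem commOneLawSharp_of_gapLocalizedDescartes {n : ℕ} (hK : 0 < K) (hG : GapLocalizedDescartes n K) :
    CommOneLawSharp (n + 1) K :=
  commOneLawSharp_of_commCriticalBudget hK (commCriticalBudget_of_gapLocalizedDescartes hG)

/-! #### The TILT PENCIL, the e-free INFLECTION LAW IB(m,K), its SUM-LETTER form and THEOREM IB(m,2) — see `Lines/negsquares_inflection.lean`

(v2.0–v2.1 sections moved there verbatim in v2.2, gen 11, when this file reached the crux-workfile size cap; nothing below this line in v2.1 is lost: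
`pencilDir`, `critPoly_pencil`, `pencilDir_eval_pos`, `inflWronskian`, `posRoots_pencil_le_succ`, `InflectionBudget`,
`commCriticalBudget_of_inflectionBudget`, `commOneLawSharp_of_inflectionBudget`, `thetaOp`, `lagVar`, `sumLetterExcess`,
`wronskian_two_eq_neg_sumLetterExcess`, `critPoly_zero_two`, `pencilDir_two`, `X_mul_inflWronskian_two`, `posRoots_X_mul`, `posRoots_neg'`,
`posRoots_inflWronskian_two`, `inflectionBudget_two_iff` are declared there with the same statements, namespace `…NegSquaresInflection`.) -/

end Commuting

end Summit.ValiantsHypothesis.ValiantsHypothesis.Cruxes.MatrixDescartes.NegSquaresTropical
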